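import Summits.QuantumFields.YangMills.Theorems.IR.Negative.TypShellCondFalseAllG
import Summits.QuantumFields.YangMills.Theorems.IR.AfPincerUcFormat
import Summits.QuantumFields.YangMills.Theorems.BalabanLadderIRAfOnsetPlaquetteMoments
import Summits.QuantumFields.YangMills.Theorems.EquipartitionCriticalityFreeEnergyLogCoefficientStubExpChartPackage

/-!
# CruxIdea2RowFloorPolyCert — single-file KERNEL CERTIFICATE (machine-generated; do not edit by hand)

This file is the concatenation of the two documented crux workfiles
`Cruxes/IR/CruxIdea2RowFloorPoly.lean` (rev 14, commit 0fbe1c64e572) and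
`Cruxes/IR/CruxIdea2HairpinStokes.lean` (rev 3, commit 06e197071208) with
(i) ALL docstrings / comments stripped (200 kB workfile cap — read the two source files for the
mathematics, every declaration here has the same name and statement there), and
(ii) the import-placeholder `sorry` of R1d `CruxIdea2g7.refAction_le_weighted` replaced by its
4-line proof from `CruxIdea2g7Hairpin.twistAction_le_weighted` (crux workfiles cannot import each other).
Purpose: let the gate/farm elaborate the COMPLETE chain with NO `sorry`:
`CruxIdea2g7.typFloor_seventh` / `rowFloorPoly_seventh` — the polynomial row floor
`RowFloorPoly ρ n ε δ (1/7)`: for compact second-countable `G`, `[Nontrivial G]`, a continuous injective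
unitary representation `ρ`, `1 ≤ N`, every `n`, `ε < 1`, `0 ≤ δ`, `4·#windowCellsPlus n·δ < 1`, there are
`c > 0`, `β₀` with: for all `β ≥ β₀` and all `1 ≤ b ≤ c (β/log β)^{1/7}` the typical shell condition
`TypShellCond ρ β b n ε δ` fails.  Card: `Cruxes/IR/Ideas/ym19354-2-frame-twist-row.md` §R (rev 4.7).
Seat ym-cruxidea-19354-2 GEN 7, 2026-08-27.  The companion's declarations sit in the nested namespace
`CruxIdea2g7.CompanionFileB.…CruxIdea2g7Hairpin` exactly as in the checked `Combined-AB.lean`.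
-/

set_option autoImplicit false

noncomputable section

open MeasureTheory Filter Topology
open Literature.MathematicalPhysics.QuantumLattice
open Literature.Probability.LatticeModels
open Summit.QuantumFields.YangMills.Cruxes.IR.Tempered (cellEdges windowCells regionEdges)
open Summit.QuantumFields.YangMills.Cruxes.IR.ShellTempered (windowCellsPlus)
open Summit.QuantumFields.YangMills.Cruxes.IR.OnsetFormats (TypShellCond shellCount)
open Summit.QuantumFields.YangMills.Cruxes.IR.FixedMesh
open Summit.QuantumFields.YangMills.Cruxes.IR.FixedMeshAllG

noncomputable section CompanionFileB
namespace Summit.QuantumFields.YangMills.Cruxes.IR.CruxIdea2g7Hairpin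

section Algebra

variable {G : Type} [Group G]

def slideLoop (ζ : LGConfig 4 G) (μ ν : Fin 4) (n : ℕ) (y : Site 4) : G :=
  ζ (y, μ) * zline ζ ν n (y + Pi.single μ 1) * (ζ (y + Pi.single ν (n : ℤ), μ))⁻¹ * (zline ζ ν n y)⁻¹

theorem slideLoop_zero (ζ : LGConfig 4 G) (μ ν : Fin 4) (y : Site 4) : slideLoop ζ μ ν 0 y = 1 := by
  simp [slideLoop]

theorem slideLoop_succ (ζ : LGConfig 4 G) (μ ν : Fin 4) (n : ℕ) (y : Site 4) :
    slideLoop ζ μ ν (n + 1) y =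
      plaquetteHolonomyZd ζ y μ ν * (ζ (y, ν) * slideLoop ζ μ ν n (y + Pi.single ν 1) * (ζ (y, ν))⁻¹) := by
  simp only [slideLoop, plaquetteHolonomyZd, zline_succ]
  rw [show y + Pi.single μ (1 : ℤ) + Pi.single ν 1 = y + Pi.single ν 1 + Pi.single μ 1 from add_right_comm _ _ _,
    show y + Pi.single ν (1 : ℤ) + Pi.single ν (n : ℤ) = y + Pi.single ν ((n + 1 : ℕ) : ℤ) by
      rw [add_assoc, single_add_nat]]
  group

theorem mul_zline_eq_slideLoop (ζ : LGConfig 4 G) (μ ν : Fin 4) (n : ℕ) (y : Site 4) :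
    ζ (y, μ) * zline ζ ν n (y + Pi.single μ 1) =
      slideLoop ζ μ ν n y * zline ζ ν n y * ζ (y + Pi.single ν (n : ℤ), μ) := by
  simp only [slideLoop]
  group

theorem hairpin_three (ζ : LGConfig 4 G) {b R : ℕ} {x : Site 4} (hx : InLayer b R x) :
    stair b R ζ x * ζ (x, 3) * (stair b R ζ (x + Pi.single 3 1))⁻¹ = 1 := by
  rw [stair_add_single_three ζ hx]
  group

theorem stair_add_single_two_eq (ζ : LGConfig 4 G) {b R : ℕ} {x : Site 4} (hx : InLayer b R x) :
    stair b R ζ (x + Pi.single 2 1) =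
      zline ζ 1 (combLen R x 1) (combRoot b R) * zline ζ 2 (combLen R x 2) (combPt2 b R x) *
        slideLoop ζ 2 3 (combLen R x 3) (combPt3 b R x) * zline ζ 3 (combLen R x 3) (combPt3 b R x) * ζ (x, 2) := by
  have hx3 := combPt3_add_eq hx
  have e1 : combLen R (x + Pi.single 2 1) 1 = combLen R x 1 := combLen_add_single_of_ne x (by decide)
  have e3 : combLen R (x + Pi.single 2 1) 3 = combLen R x 3 := combLen_add_single_of_ne x (by decide)
  have e2 : combLen R (x + Pi.single 2 1) 2 = combLen R x 2 + 1 := combLen_add_single_self (hx.2 2 (by decide))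
  have p2 : combPt2 b R (x + Pi.single 2 1) = combPt2 b R x := by simp only [combPt2, e1]
  have p3 : combPt3 b R (x + Pi.single 2 1) = combPt3 b R x + Pi.single 2 1 := by
    simp only [combPt3, p2, e2, single_natCast_succ, add_assoc]
  have s3 := mul_zline_eq_slideLoop ζ 2 3 (combLen R x 3) (combPt3 b R x)
  rw [hx3] at s3
  have hp3 : combPt2 b R x + Pi.single 2 (combLen R x 2 : ℤ) = combPt3 b R x := rfl
  unfold stair
  rw [e1, e2, e3, p2, p3, zline_succ_right, hp3]
  calc zline ζ 1 (combLen R x 1) (combRoot b R) * (zline ζ 2 (combLen R x 2) (combPt2 b R x) * ζ (combPt3 b R x, 2)) *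
        zline ζ 3 (combLen R x 3) (combPt3 b R x + Pi.single 2 1)
      = zline ζ 1 (combLen R x 1) (combRoot b R) * zline ζ 2 (combLen R x 2) (combPt2 b R x) *
        (ζ (combPt3 b R x, 2) * zline ζ 3 (combLen R x 3) (combPt3 b R x + Pi.single 2 1)) := by group
    _ = _ := by rw [s3]; group

theorem stair_add_single_one_eq (ζ : LGConfig 4 G) {b R : ℕ} {x : Site 4} (hx : InLayer b R x) :
    stair b R ζ (x + Pi.single 1 1) =
      zline ζ 1 (combLen R x 1) (combRoot b R) *
        slideLoop ζ 1 2 (combLen R x 2) (combPt2 b R x) * zline ζ 2 (combLen R x 2) (combPt2 b R x) *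
        slideLoop ζ 1 3 (combLen R x 3) (combPt3 b R x) * zline ζ 3 (combLen R x 3) (combPt3 b R x) * ζ (x, 1) := by
  have hx3 := combPt3_add_eq hx
  have e2 : combLen R (x + Pi.single 1 1) 2 = combLen R x 2 := combLen_add_single_of_ne x (by decide)
  have e3 : combLen R (x + Pi.single 1 1) 3 = combLen R x 3 := combLen_add_single_of_ne x (by decide)
  have e1 : combLen R (x + Pi.single 1 1) 1 = combLen R x 1 + 1 := combLen_add_single_self (hx.2 1 (by decide))
  have p2 : combPt2 b R (x + Pi.single 1 1) = combPt2 b R x + Pi.single 1 1 := by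
    simp only [combPt2, e1, single_natCast_succ, add_assoc]
  have p3 : combPt3 b R (x + Pi.single 1 1) = combPt3 b R x + Pi.single 1 1 := by
    simp only [combPt3, p2, e2]; rw [add_right_comm]
  have s2 := mul_zline_eq_slideLoop ζ 1 2 (combLen R x 2) (combPt2 b R x)
  have s3 := mul_zline_eq_slideLoop ζ 1 3 (combLen R x 3) (combPt3 b R x)
  rw [hx3] at s3
  have hp2 : combRoot b R + Pi.single 1 (combLen R x 1 : ℤ) = combPt2 b R x := rfl
  have hp3 : combPt2 b R x + Pi.single 2 (combLen R x 2 : ℤ) = combPt3 b R x := rfl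
  rw [hp3] at s2
  unfold stair
  rw [e1, e2, e3, p2, p3, zline_succ_right, hp2]
  calc zline ζ 1 (combLen R x 1) (combRoot b R) * ζ (combPt2 b R x, 1) *
        zline ζ 2 (combLen R x 2) (combPt2 b R x + Pi.single 1 1) *
        zline ζ 3 (combLen R x 3) (combPt3 b R x + Pi.single 1 1)
      = zline ζ 1 (combLen R x 1) (combRoot b R) * (ζ (combPt2 b R x, 1) *
        zline ζ 2 (combLen R x 2) (combPt2 b R x + Pi.single 1 1)) *
        zline ζ 3 (combLen R x 3) (combPt3 b R x + Pi.single 1 1) := by group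
    _ = zline ζ 1 (combLen R x 1) (combRoot b R) * slideLoop ζ 1 2 (combLen R x 2) (combPt2 b R x) *
        zline ζ 2 (combLen R x 2) (combPt2 b R x) *
        (ζ (combPt3 b R x, 1) * zline ζ 3 (combLen R x 3) (combPt3 b R x + Pi.single 1 1)) := by
        rw [s2]; group
    _ = _ := by rw [s3]; group

theorem hairpin_two_eq (ζ : LGConfig 4 G) {b R : ℕ} {x : Site 4} (hx : InLayer b R x) :
    stair b R ζ x * ζ (x, 2) * (stair b R ζ (x + Pi.single 2 1))⁻¹ =
      (zline ζ 1 (combLen R x 1) (combRoot b R) * zline ζ 2 (combLen R x 2) (combPt2 b R x)) *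
        (slideLoop ζ 2 3 (combLen R x 3) (combPt3 b R x))⁻¹ *
        (zline ζ 1 (combLen R x 1) (combRoot b R) * zline ζ 2 (combLen R x 2) (combPt2 b R x))⁻¹ := by
  rw [stair_add_single_two_eq ζ hx]
  unfold stair
  group

theorem hairpin_one_eq (ζ : LGConfig 4 G) {b R : ℕ} {x : Site 4} (hx : InLayer b R x) :
    stair b R ζ x * ζ (x, 1) * (stair b R ζ (x + Pi.single 1 1))⁻¹ =
      ((zline ζ 1 (combLen R x 1) (combRoot b R) * zline ζ 2 (combLen R x 2) (combPt2 b R x)) *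
          (slideLoop ζ 1 3 (combLen R x 3) (combPt3 b R x))⁻¹ *
          (zline ζ 1 (combLen R x 1) (combRoot b R) * zline ζ 2 (combLen R x 2) (combPt2 b R x))⁻¹) *
        (zline ζ 1 (combLen R x 1) (combRoot b R) * (slideLoop ζ 1 2 (combLen R x 2) (combPt2 b R x))⁻¹ *
          (zline ζ 1 (combLen R x 1) (combRoot b R))⁻¹) := by
  rw [stair_add_single_one_eq ζ hx]
  unfold stair
  group

end Algebra

section Frobenius

open scoped Matrix Matrix.Norms.Frobenius

variable {G : Type} [Group G] {N : ℕ} (ρ : G →* Matrix (Fin N) (Fin N) ℂ)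

theorem norm_map_mul_sub_one_le (hρu : ∀ g, ρ g ∈ Matrix.unitaryGroup (Fin N) ℂ) (g h : G) :
    ‖ρ (g * h) - 1‖ ≤ ‖ρ g - 1‖ + ‖ρ h - 1‖ := by
  have hsplit : ρ (g * h) - 1 = ρ g * (ρ h - 1) + (ρ g - 1) := by rw [map_mul]; noncomm_ring
  rw [hsplit]
  refine (norm_add_le _ _).trans ?_
  rw [Matrix.frobenius_norm_unitaryGroup_mul ⟨ρ g, hρu g⟩ (ρ h - 1)]
  linarith

theorem norm_map_inv_sub_one (hρu : ∀ g, ρ g ∈ Matrix.unitaryGroup (Fin N) ℂ) (g : G) :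
    ‖ρ g⁻¹ - 1‖ = ‖ρ g - 1‖ := by
  have h : ρ g⁻¹ - 1 = ρ g⁻¹ * (1 - ρ g) := by
    rw [mul_sub, mul_one, ← map_mul, inv_mul_cancel, map_one]
  rw [h, Matrix.frobenius_norm_unitaryGroup_mul ⟨ρ g⁻¹, hρu g⁻¹⟩, norm_sub_rev]

theorem norm_map_conj_sub_one (hρu : ∀ g, ρ g ∈ Matrix.unitaryGroup (Fin N) ℂ) (k g : G) :
    ‖ρ (k * g * k⁻¹) - 1‖ = ‖ρ g - 1‖ := by
  have h : ρ (k * g * k⁻¹) - 1 = ρ k * (ρ g - 1) * ρ k⁻¹ := by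
    rw [map_mul, map_mul, mul_sub, sub_mul, mul_one, mul_assoc (ρ k) (ρ g), ← map_mul, ← map_mul,
      ← map_mul, mul_inv_cancel, map_one]
  rw [h, Matrix.frobenius_norm_mul_unitaryGroup _ ⟨ρ k⁻¹, hρu k⁻¹⟩,
    Matrix.frobenius_norm_unitaryGroup_mul ⟨ρ k, hρu k⟩]

theorem norm_map_slideLoop_sub_one_le (hρu : ∀ g, ρ g ∈ Matrix.unitaryGroup (Fin N) ℂ) (ζ : LGConfig 4 G)
    (μ ν : Fin 4) : ∀ (n : ℕ) (y : Site 4),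
    ‖ρ (slideLoop ζ μ ν n y) - 1‖ ≤
      ∑ k ∈ Finset.range n, ‖ρ (plaquetteHolonomyZd ζ (y + Pi.single ν (k : ℤ)) μ ν) - 1‖
  | 0, y => by simp [slideLoop_zero]
  | n + 1, y => by
    rw [slideLoop_succ, Finset.sum_range_succ']
    refine (norm_map_mul_sub_one_le ρ hρu _ _).trans ?_
    rw [norm_map_conj_sub_one ρ hρu]
    have ih := norm_map_slideLoop_sub_one_le hρu ζ μ ν n (y + Pi.single ν 1)
    have hshift : ∀ k : ℕ, y + Pi.single ν (1 : ℤ) + Pi.single ν (k : ℤ) = y + Pi.single ν ((k + 1 : ℕ) : ℤ) := by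
      intro k; rw [add_assoc, single_add_nat]
    simp only [hshift] at ih
    simp only [Nat.cast_zero, Pi.single_zero, add_zero]
    linarith

theorem norm_map_hairpin_three (ζ : LGConfig 4 G) {b R : ℕ} {x : Site 4} (hx : InLayer b R x) :
    ‖ρ (stair b R ζ x * ζ (x, 3) * (stair b R ζ (x + Pi.single 3 1))⁻¹) - 1‖ = 0 := by
  rw [hairpin_three ζ hx, map_one, sub_self, norm_zero]

theorem norm_map_hairpin_two_le (hρu : ∀ g, ρ g ∈ Matrix.unitaryGroup (Fin N) ℂ) (ζ : LGConfig 4 G) {b R : ℕ}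
    {x : Site 4} (hx : InLayer b R x) :
    ‖ρ (stair b R ζ x * ζ (x, 2) * (stair b R ζ (x + Pi.single 2 1))⁻¹) - 1‖ ≤
      ∑ k ∈ Finset.range (combLen R x 3),
        ‖ρ (plaquetteHolonomyZd ζ (combPt3 b R x + Pi.single 3 (k : ℤ)) 2 3) - 1‖ := by
  rw [hairpin_two_eq ζ hx, norm_map_conj_sub_one ρ hρu, norm_map_inv_sub_one ρ hρu]
  exact norm_map_slideLoop_sub_one_le ρ hρu ζ 2 3 _ _

theorem norm_map_hairpin_one_le (hρu : ∀ g, ρ g ∈ Matrix.unitaryGroup (Fin N) ℂ) (ζ : LGConfig 4 G) {b R : ℕ}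
    {x : Site 4} (hx : InLayer b R x) :
    ‖ρ (stair b R ζ x * ζ (x, 1) * (stair b R ζ (x + Pi.single 1 1))⁻¹) - 1‖ ≤
      ∑ k ∈ Finset.range (combLen R x 3),
          ‖ρ (plaquetteHolonomyZd ζ (combPt3 b R x + Pi.single 3 (k : ℤ)) 1 3) - 1‖ +
        ∑ k ∈ Finset.range (combLen R x 2),
          ‖ρ (plaquetteHolonomyZd ζ (combPt2 b R x + Pi.single 2 (k : ℤ)) 1 2) - 1‖ := by
  rw [hairpin_one_eq ζ hx]
  refine (norm_map_mul_sub_one_le ρ hρu _ _).trans ?_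
  rw [norm_map_conj_sub_one ρ hρu, norm_map_inv_sub_one ρ hρu, norm_map_conj_sub_one ρ hρu,
    norm_map_inv_sub_one ρ hρu]
  exact add_le_add (norm_map_slideLoop_sub_one_le ρ hρu ζ 1 3 _ _) (norm_map_slideLoop_sub_one_le ρ hρu ζ 1 2 _ _)

theorem norm_map_hairpin_sub_one_le (hρu : ∀ g, ρ g ∈ Matrix.unitaryGroup (Fin N) ℂ) (ζ : LGConfig 4 G) {b R : ℕ}
    {x : Site 4} (hx : InLayer b R x) {j : Fin 4} (hj : j ≠ 0) :
    ‖ρ (stair b R ζ x * ζ (x, j) * (stair b R ζ (x + Pi.single j 1))⁻¹) - 1‖ ≤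
      ∑ k ∈ Finset.range (combLen R x 3),
          ‖ρ (plaquetteHolonomyZd ζ (combPt3 b R x + Pi.single 3 (k : ℤ)) j 3) - 1‖ +
        ∑ k ∈ Finset.range (combLen R x 2),
          ‖ρ (plaquetteHolonomyZd ζ (combPt2 b R x + Pi.single 2 (k : ℤ)) 1 2) - 1‖ := by
  have hA : 0 ≤ ∑ k ∈ Finset.range (combLen R x 3),
      ‖ρ (plaquetteHolonomyZd ζ (combPt3 b R x + Pi.single 3 (k : ℤ)) j 3) - 1‖ :=
    Finset.sum_nonneg fun _ _ => norm_nonneg _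
  have hB : 0 ≤ ∑ k ∈ Finset.range (combLen R x 2),
      ‖ρ (plaquetteHolonomyZd ζ (combPt2 b R x + Pi.single 2 (k : ℤ)) 1 2) - 1‖ :=
    Finset.sum_nonneg fun _ _ => norm_nonneg _
  have h123 : j = 1 ∨ j = 2 ∨ j = 3 := by
    fin_cases j
    · exact absurd rfl hj
    · exact Or.inl rfl
    · exact Or.inr (Or.inl rfl)
    · exact Or.inr (Or.inr rfl)
  rcases h123 with rfl | rfl | rfl
  · exact norm_map_hairpin_one_le ρ hρu ζ hx
  · exact (norm_map_hairpin_two_le ρ hρu ζ hx).trans (le_add_of_nonneg_right hB)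
  · rw [norm_map_hairpin_three ρ ζ hx]; exact add_nonneg hA hB

theorem norm_map_hairpin_sub_one_sq_le (hρu : ∀ g, ρ g ∈ Matrix.unitaryGroup (Fin N) ℂ) (ζ : LGConfig 4 G) {b R : ℕ}
    {x : Site 4} (hx : InLayer b R x) {j : Fin 4} (hj : j ≠ 0) :
    ‖ρ (stair b R ζ x * ζ (x, j) * (stair b R ζ (x + Pi.single j 1))⁻¹) - 1‖ ^ 2 ≤
      2 * ((combLen R x 3 : ℝ) * ∑ k ∈ Finset.range (combLen R x 3),
          ‖ρ (plaquetteHolonomyZd ζ (combPt3 b R x + Pi.single 3 (k : ℤ)) j 3) - 1‖ ^ 2 +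
        (combLen R x 2 : ℝ) * ∑ k ∈ Finset.range (combLen R x 2),
          ‖ρ (plaquetteHolonomyZd ζ (combPt2 b R x + Pi.single 2 (k : ℤ)) 1 2) - 1‖ ^ 2) := by
  have h := norm_map_hairpin_sub_one_le ρ hρu ζ hx hj
  have hA := sq_sum_le_card_mul_sum_sq (s := Finset.range (combLen R x 3))
    (f := fun k : ℕ => ‖ρ (plaquetteHolonomyZd ζ (combPt3 b R x + Pi.single 3 (k : ℤ)) j 3) - 1‖)
  have hB := sq_sum_le_card_mul_sum_sq (s := Finset.range (combLen R x 2))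
    (f := fun k : ℕ => ‖ρ (plaquetteHolonomyZd ζ (combPt2 b R x + Pi.single 2 (k : ℤ)) 1 2) - 1‖)
  rw [Finset.card_range] at hA hB
  have h0 : 0 ≤ ‖ρ (stair b R ζ x * ζ (x, j) * (stair b R ζ (x + Pi.single j 1))⁻¹) - 1‖ := norm_nonneg _
  have h1 := pow_le_pow_left₀ h0 h 2
  nlinarith [h1, hA, hB,
    sq_nonneg (∑ k ∈ Finset.range (combLen R x 3),
        ‖ρ (plaquetteHolonomyZd ζ (combPt3 b R x + Pi.single 3 (k : ℤ)) j 3) - 1‖ -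
      ∑ k ∈ Finset.range (combLen R x 2),
        ‖ρ (plaquetteHolonomyZd ζ (combPt2 b R x + Pi.single 2 (k : ℤ)) 1 2) - 1‖)]

end Frobenius

section Counting

theorem combLen_le {R : ℕ} {x : Site 4} {l : Fin 4} (h : x l ≤ (R : ℤ)) : combLen R x l ≤ 2 * R := by
  unfold combLen
  omega

open Summit.QuantumFields.YangMills.Cruxes.IR.Tempered (cellEdges windowCells regionEdges)
open Summit.QuantumFields.YangMills.Cruxes.IR.FixedMesh

theorem spatial_of_mem_cellEdges {b : ℕ} {c : Fin 4 → ℤ} {e : ZdEdge 4} (he : e ∈ cellEdges (stdFrame b) c)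
    {i : Fin 4} (hi : i ≠ 0) : (b : ℤ) * c i ≤ e.1 i ∧ e.1 i < (b : ℤ) * (c i + 1) := by
  have h := Fintype.mem_piFinset.1 (Finset.mem_product.1 he).1 i
  have h' := Finset.mem_Ico.1 h
  simp only [stdFrame, if_neg hi] at h'
  exact h'

theorem box_of_mem_rowRegion {b n : ℕ} {e : ZdEdge 4} (he : e ∈ rowRegion b n) :
    (1 ≤ e.1 0 ∧ e.1 0 ≤ (b : ℤ)) ∧
      ∀ i : Fin 4, i ≠ 0 → -(2 * (n : ℤ) * b) ≤ e.1 i ∧ e.1 i ≤ (2 * (n : ℤ) + 1) * b - 1 := by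
  unfold rowRegion regionEdges at he
  obtain ⟨c, hc, hec⟩ := Finset.mem_biUnion.1 he
  have hcw := Finset.mem_filter.1 (show c ∈ (windowCells n).filter (fun y => y 0 = 0) from hc)
  have hc0 : c 0 = 0 := hcw.2
  have hcI : ∀ i, -(2 * (n : ℤ)) ≤ c i ∧ c i ≤ 2 * (n : ℤ) := fun i => by
    have h := Fintype.mem_piFinset.1 hcw.1 i
    rw [Finset.mem_Icc] at h
    exact_mod_cast h
  have hb0 : (0 : ℤ) ≤ (b : ℤ) := Int.natCast_nonneg b
  refine ⟨?_, fun i hi => ?_⟩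
  · have h := base_height_of_mem_cellEdges hec
    rw [hc0] at h
    constructor <;> linarith [h.1, h.2]
  · have h := spatial_of_mem_cellEdges hec hi
    have h1 := mul_le_mul_of_nonneg_left (hcI i).1 hb0
    have h2 := mul_le_mul_of_nonneg_left (show c i + 1 ≤ 2 * (n : ℤ) + 1 by linarith [(hcI i).2]) hb0
    constructor <;> linarith [h.1, h.2]

def topBox (b n : ℕ) : Finset (Site 4) :=
  Fintype.piFinset fun i : Fin 4 =>
    if i = 0 then {(b : ℤ)} else Finset.Icc (-(2 * (n : ℤ) * b) - 1) ((2 * (n : ℤ) + 1) * b - 1)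

theorem card_topBox (b n : ℕ) : (topBox b n).card = ((4 * n + 1) * b + 1) ^ 3 := by
  rw [topBox, Fintype.card_piFinset, Fin.prod_univ_four, if_pos rfl, if_neg (show (1 : Fin 4) ≠ 0 by decide),
    if_neg (show (2 : Fin 4) ≠ 0 by decide), if_neg (show (3 : Fin 4) ≠ 0 by decide), Finset.card_singleton,
    Int.card_Icc]
  have h : (2 * (n : ℤ) + 1) * b - 1 + 1 - (-(2 * (n : ℤ) * b) - 1) = (((4 * n + 1) * b + 1 : ℕ) : ℤ) := by
    push_cast; ring
  rw [h, Int.toNat_natCast]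
  ring

theorem mem_topBox_of_touching {b n : ℕ} {q : ZdPlaquette 4} (hq : q ∈ plaquettesTouching (rowRegion b n))
    (hq0 : q.1 0 = (b : ℤ)) : q.1 ∈ topBox b n := by
  rw [mem_plaquettesTouching_iff] at hq
  obtain ⟨e, he⟩ := hq
  rw [Finset.mem_inter] at he
  obtain ⟨he1, he2⟩ := he
  rw [topBox, Fintype.mem_piFinset]
  intro i
  by_cases hi : i = 0
  · subst hi
    rw [if_pos rfl, Finset.mem_singleton, hq0]
  · rw [if_neg hi, Finset.mem_Icc]
    have hs := (box_of_mem_rowRegion he2).2 i hi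
    simp only [plaquetteEdges, Finset.mem_insert, Finset.mem_singleton] at he1
    rcases he1 with rfl | rfl | rfl | rfl
    · dsimp only at hs
      constructor <;> linarith [hs.1, hs.2]
    · dsimp only at hs
      rw [Pi.add_apply, Pi.single_apply] at hs
      split_ifs at hs <;> constructor <;> linarith [hs.1, hs.2]
    · dsimp only at hs
      rw [Pi.add_apply, Pi.single_apply] at hs
      split_ifs at hs <;> constructor <;> linarith [hs.1, hs.2]
    · dsimp only at hs
      constructor <;> linarith [hs.1, hs.2]

theorem card_touching_height_eq_le (b n : ℕ) :
    ((plaquettesTouching (rowRegion b n)).filter (fun q => q.1 0 = (b : ℤ))).card ≤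
      Fintype.card {p : Fin 4 × Fin 4 // p.1 < p.2} * ((4 * n + 1) * b + 1) ^ 3 := by
  have hsub : (plaquettesTouching (rowRegion b n)).filter (fun q => q.1 0 = (b : ℤ)) ⊆
      topBox b n ×ˢ (Finset.univ : Finset {p : Fin 4 × Fin 4 // p.1 < p.2}) := by
    intro q hq
    rw [Finset.mem_filter] at hq
    exact Finset.mem_product.2 ⟨mem_topBox_of_touching hq.1 hq.2, Finset.mem_univ _⟩
  refine (Finset.card_le_card hsub).trans ?_
  rw [Finset.card_product, card_topBox, Finset.card_univ, mul_comm]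

theorem card_orientations : Fintype.card {p : Fin 4 × Fin 4 // p.1 < p.2} = 6 := by
  decide

end Counting

section TopFace

open scoped Matrix Matrix.Norms.Frobenius

variable {G : Type} [Group G] {N : ℕ} (ρ : G →* Matrix (Fin N) (Fin N) ℂ)

theorem sub_re_trace_eq_norm_sq (hρu : ∀ g, ρ g ∈ Matrix.unitaryGroup (Fin N) ℂ) (g : G) :
    (N : ℝ) - (ρ g).trace.re = ‖ρ g - 1‖ ^ 2 / 2 := by
  have hU : (ρ g)ᴴ * ρ g = 1 := Matrix.mem_unitaryGroup_iff'.1 (hρu g)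
  have h1 : ‖ρ g - 1‖ ^ 2 = RCLike.re (Matrix.trace ((ρ g - 1)ᴴ * (ρ g - 1))) :=
    Matrix.frobenius_norm_sq_eq_re_trace _
  have h2 : (ρ g - 1)ᴴ * (ρ g - 1) = 2 • (1 : Matrix (Fin N) (Fin N) ℂ) - ρ g - (ρ g)ᴴ := by
    rw [Matrix.conjTranspose_sub, Matrix.conjTranspose_one, sub_mul, mul_sub, mul_sub, hU, one_mul,
      mul_one, one_mul, two_smul]
    abel
  rw [h1, h2]
  simp only [Matrix.trace_sub, Matrix.trace_smul, Matrix.trace_one, Fintype.card_fin, map_sub,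
    Matrix.trace_conjTranspose, RCLike.star_def, RCLike.conj_re]
  simp only [RCLike.re_to_complex, nsmul_eq_mul, Complex.mul_re]
  norm_num
  ring

theorem topTwist_apply_of_dir_ne {b : ℕ} (k : Site 4 → G) (U : LGConfig 4 G) {e : ZdEdge 4} (he : e.2 ≠ 0) :
    topTwist b k U e = U e := by
  unfold topTwist; exact if_neg fun h => he h.1

theorem plaquetteHolonomyZd_topTwist_of_not_topFace (b : ℕ) (k : Site 4 → G) (σ : LGConfig 4 G) (x : Site 4)
    {i j : Fin 4} (hj : j ≠ 0) (h : ¬ (i = 0 ∧ x 0 = (b : ℤ))) :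
    plaquetteHolonomyZd (topTwist b k σ) x i j = plaquetteHolonomyZd σ x i j := by
  unfold plaquetteHolonomyZd
  have e2 : topTwist b k σ (x + Pi.single i 1, j) = σ (x + Pi.single i 1, j) := topTwist_apply_of_dir_ne k σ hj
  have e4 : topTwist b k σ (x, j) = σ (x, j) := topTwist_apply_of_dir_ne k σ hj
  by_cases hi : i = 0
  · have hx : x 0 ≠ (b : ℤ) := fun hx => h ⟨hi, hx⟩
    have e1 : topTwist b k σ (x, i) = σ (x, i) := topTwist_apply_of_ne k σ hx
    have hx' : ((x + Pi.single j (1 : ℤ) : Site 4)) 0 ≠ (b : ℤ) := by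
      rw [add_single_apply_zero, if_neg hj, add_zero]; exact hx
    have e3 : topTwist b k σ (x + Pi.single j 1, i) = σ (x + Pi.single j 1, i) := topTwist_apply_of_ne k σ hx'
    rw [e1, e2, e3, e4]
  · have e1 : topTwist b k σ (x, i) = σ (x, i) := topTwist_apply_of_dir_ne k σ hi
    have e3 : topTwist b k σ (x + Pi.single j 1, i) = σ (x + Pi.single j 1, i) := topTwist_apply_of_dir_ne k σ hi
    rw [e1, e2, e3, e4]

def linkDefect (k : Site 4 → G) (σ : LGConfig 4 G) (y : Site 4) (j : Fin 4) : G :=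
  (k y)⁻¹ * σ (y, j) * k (y + Pi.single j 1) * (σ (y, j))⁻¹

theorem plaquetteHolonomyZd_topTwist_topFace (b : ℕ) (k : Site 4 → G) (σ : LGConfig 4 G) (x : Site 4) {j : Fin 4}
    (hj : j ≠ 0) (hx : x 0 = (b : ℤ)) :
    plaquetteHolonomyZd (topTwist b k σ) x 0 j =
      σ (x, 0) * linkDefect k σ (x + Pi.single 0 1) j * (σ (x, 0))⁻¹ * plaquetteHolonomyZd σ x 0 j := by
  unfold plaquetteHolonomyZd linkDefect
  have e1 : topTwist b k σ (x, 0) = σ (x, 0) * (k (x + Pi.single 0 1))⁻¹ := by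
    unfold topTwist; exact if_pos ⟨rfl, hx⟩
  have e2 : topTwist b k σ (x + Pi.single 0 1, j) = σ (x + Pi.single 0 1, j) := topTwist_apply_of_dir_ne k σ hj
  have hx' : ((x + Pi.single j (1 : ℤ) : Site 4)) 0 = (b : ℤ) := by
    rw [add_single_apply_zero, if_neg hj, add_zero]; exact hx
  have e3 : topTwist b k σ (x + Pi.single j 1, 0) =
      σ (x + Pi.single j 1, 0) * (k (x + Pi.single j 1 + Pi.single 0 1))⁻¹ := by
    unfold topTwist; exact if_pos ⟨rfl, hx'⟩
  have e4 : topTwist b k σ (x, j) = σ (x, j) := topTwist_apply_of_dir_ne k σ hj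
  rw [e1, e2, e3, e4]
  have hc : x + Pi.single j (1 : ℤ) + Pi.single 0 1 = x + Pi.single 0 1 + Pi.single j 1 := add_right_comm _ _ _
  rw [hc]
  group

theorem topFace_energy_le (hρu : ∀ g, ρ g ∈ Matrix.unitaryGroup (Fin N) ℂ) (b : ℕ) (k : Site 4 → G)
    (σ : LGConfig 4 G) (x : Site 4) {j : Fin 4} (hj : j ≠ 0) (hx : x 0 = (b : ℤ)) :
    (N : ℝ) - plaquetteObs ρ x 0 j (topTwist b k σ) ≤
      ‖ρ (linkDefect k σ (x + Pi.single 0 1) j) - 1‖ ^ 2 + 2 * ((N : ℝ) - plaquetteObs ρ x 0 j σ) := by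
  unfold plaquetteObs
  rw [plaquetteHolonomyZd_topTwist_topFace b k σ x hj hx, sub_re_trace_eq_norm_sq ρ hρu, sub_re_trace_eq_norm_sq ρ hρu]
  have h1 : ‖ρ (σ (x, 0) * linkDefect k σ (x + Pi.single 0 1) j * (σ (x, 0))⁻¹ * plaquetteHolonomyZd σ x 0 j) - 1‖ ≤
      ‖ρ (linkDefect k σ (x + Pi.single 0 1) j) - 1‖ + ‖ρ (plaquetteHolonomyZd σ x 0 j) - 1‖ := by
    calc _ ≤ ‖ρ (σ (x, 0) * linkDefect k σ (x + Pi.single 0 1) j * (σ (x, 0))⁻¹) - 1‖ +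
          ‖ρ (plaquetteHolonomyZd σ x 0 j) - 1‖ := norm_map_mul_sub_one_le ρ hρu _ _
      _ = _ := by rw [norm_map_conj_sub_one ρ hρu]
  nlinarith [h1, norm_nonneg (ρ (σ (x, 0) * linkDefect k σ (x + Pi.single 0 1) j * (σ (x, 0))⁻¹ *
    plaquetteHolonomyZd σ x 0 j) - 1), norm_nonneg (ρ (linkDefect k σ (x + Pi.single 0 1) j) - 1),
    norm_nonneg (ρ (plaquetteHolonomyZd σ x 0 j) - 1),
    sq_nonneg (‖ρ (linkDefect k σ (x + Pi.single 0 1) j) - 1‖ - ‖ρ (plaquetteHolonomyZd σ x 0 j) - 1‖)]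

def hairpin (b R : ℕ) (σ : LGConfig 4 G) (y : Site 4) (j : Fin 4) : G :=
  stair b R σ y * σ (y, j) * (stair b R σ (y + Pi.single j 1))⁻¹

theorem norm_linkDefect_comb_le (hρu : ∀ g, ρ g ∈ Matrix.unitaryGroup (Fin N) ℂ) (b R : ℕ) (k₀ : G)
    (σ : LGConfig 4 G) (y : Site 4) (j : Fin 4) :
    ‖ρ (linkDefect (comb b R k₀ σ) σ y j) - 1‖ ≤ 2 * ‖ρ (hairpin b R σ y j) - 1‖ := by
  have hD : linkDefect (comb b R k₀ σ) σ y j =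
      (stair b R σ y)⁻¹ * (k₀⁻¹ * hairpin b R σ y j * k₀ * (hairpin b R σ y j)⁻¹) * (stair b R σ y)⁻¹⁻¹ := by
    unfold linkDefect comb hairpin; group
  rw [hD, norm_map_conj_sub_one ρ hρu]
  have h1 := norm_map_mul_sub_one_le ρ hρu (k₀⁻¹ * hairpin b R σ y j * k₀) (hairpin b R σ y j)⁻¹
  have h2 := norm_map_conj_sub_one ρ hρu k₀⁻¹ (hairpin b R σ y j)
  rw [inv_inv] at h2
  rw [norm_map_inv_sub_one ρ hρu, h2] at h1
  linarith

theorem topFace_energy_comb_le (hρu : ∀ g, ρ g ∈ Matrix.unitaryGroup (Fin N) ℂ) (b R : ℕ) (k₀ : G)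
    (σ : LGConfig 4 G) (x : Site 4) {j : Fin 4} (hj : j ≠ 0) (hx : x 0 = (b : ℤ)) :
    (N : ℝ) - plaquetteObs ρ x 0 j (topTwist b (comb b R k₀ σ) σ) ≤
      4 * ‖ρ (hairpin b R σ (x + Pi.single 0 1) j) - 1‖ ^ 2 + 2 * ((N : ℝ) - plaquetteObs ρ x 0 j σ) := by
  have h1 := topFace_energy_le ρ hρu b (comb b R k₀ σ) σ x hj hx
  have h2 := norm_linkDefect_comb_le ρ hρu b R k₀ σ (x + Pi.single 0 1) j
  have h0 := norm_nonneg (ρ (linkDefect (comb b R k₀ σ) σ (x + Pi.single 0 1) j) - 1)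
  nlinarith [h1, h2, h0]

theorem energy_topTwist_of_not_topFace (b : ℕ) (k : Site 4 → G) (σ : LGConfig 4 G) (q : ZdPlaquette 4)
    (h : ¬ (q.2.1.1 = 0 ∧ q.1 0 = (b : ℤ))) :
    (N : ℝ) - plaquetteObs ρ q.1 q.2.1.1 q.2.1.2 (topTwist b k σ) = (N : ℝ) - plaquetteObs ρ q.1 q.2.1.1 q.2.1.2 σ := by
  have hj : q.2.1.2 ≠ 0 := fun h0 => by have := q.2.2; rw [h0] at this; exact (Fin.not_lt_zero _) this
  unfold plaquetteObs
  rw [plaquetteHolonomyZd_topTwist_of_not_topFace b k σ q.1 hj h]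

end TopFace

section Assembly

open scoped Matrix Matrix.Norms.Frobenius
open Summit.QuantumFields.YangMills.Cruxes.IR.FixedMesh

variable {G : Type} [Group G] {N : ℕ} (ρ : G →* Matrix (Fin N) (Fin N) ℂ)

def pe (q : ZdPlaquette 4) (σ : LGConfig 4 G) : ℝ := (N : ℝ) - plaquetteObs ρ q.1 q.2.1.1 q.2.1.2 σ

theorem pe_nonneg (hρu : ∀ g, ρ g ∈ Matrix.unitaryGroup (Fin N) ℂ) (q : ZdPlaquette 4) (σ : LGConfig 4 G) :
    0 ≤ pe ρ q σ := by
  unfold pe plaquetteObs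
  rw [sub_re_trace_eq_norm_sq ρ hρu]
  positivity

theorem norm_sq_eq_two_mul_energy (hρu : ∀ g, ρ g ∈ Matrix.unitaryGroup (Fin N) ℂ) (x : Site 4) (i j : Fin 4)
    (σ : LGConfig 4 G) :
    ‖ρ (plaquetteHolonomyZd σ x i j) - 1‖ ^ 2 = 2 * ((N : ℝ) - plaquetteObs ρ x i j σ) := by
  unfold plaquetteObs
  rw [sub_re_trace_eq_norm_sq ρ hρu]
  ring

theorem wilsonBoundaryAction_eq_sum_pe (Λ : Finset (ZdEdge 4)) (σ : LGConfig 4 G) :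
    wilsonBoundaryAction ρ Λ σ = ∑ q ∈ plaquettesTouching Λ, pe ρ q σ := rfl

def hp3 (b R : ℕ) (y : Site 4) (j : Fin 4) (k : ℕ) : ZdPlaquette 4 :=
  if h : j < 3 then (combPt3 b R y + Pi.single 3 (k : ℤ), ⟨(j, 3), h⟩) else (y, ⟨(0, 1), by decide⟩)

def hp2 (b R : ℕ) (y : Site 4) (k : ℕ) : ZdPlaquette 4 :=
  (combPt2 b R y + Pi.single 2 (k : ℤ), ⟨(1, 2), by decide⟩)

def coef (b R : ℕ) (q p : ZdPlaquette 4) : ℝ :=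
  2 * (if q = p then 1 else 0) +
    if q.2.1.1 = 0 ∧ q.1 0 = (b : ℤ) then
      32 * (R : ℝ) *
        ((∑ k ∈ Finset.range (combLen R (q.1 + Pi.single 0 1) 3),
            if hp3 b R (q.1 + Pi.single 0 1) q.2.1.2 k = p then (1 : ℝ) else 0) +
          ∑ k ∈ Finset.range (combLen R (q.1 + Pi.single 0 1) 2),
            if hp2 b R (q.1 + Pi.single 0 1) k = p then (1 : ℝ) else 0)
    else 0

theorem coef_nonneg (b R : ℕ) (q p : ZdPlaquette 4) : 0 ≤ coef b R q p := by
  unfold coef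
  have h1 : (0 : ℝ) ≤ 2 * (if q = p then 1 else 0) := by split_ifs <;> norm_num
  have h2 : (0 : ℝ) ≤ ∑ k ∈ Finset.range (combLen R (q.1 + Pi.single 0 1) 3),
      (if hp3 b R (q.1 + Pi.single 0 1) q.2.1.2 k = p then (1 : ℝ) else 0) :=
    Finset.sum_nonneg fun k _ => by split_ifs <;> norm_num
  have h3 : (0 : ℝ) ≤ ∑ k ∈ Finset.range (combLen R (q.1 + Pi.single 0 1) 2),
      (if hp2 b R (q.1 + Pi.single 0 1) k = p then (1 : ℝ) else 0) :=
    Finset.sum_nonneg fun k _ => by split_ifs <;> norm_num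
  split_ifs <;> positivity

theorem sum_ite_eq_mul {α : Type} [DecidableEq α] (P : Finset α) (a : α) (f : α → ℝ) (ha : a ∈ P) :
    ∑ p ∈ P, (if a = p then (1 : ℝ) else 0) * f p = f a := by
  rw [Finset.sum_eq_single a (fun p _ hp => by rw [if_neg (Ne.symm hp), zero_mul]) (fun h => (h ha).elim),
    if_pos rfl, one_mul]

theorem sum_sum_ite_eq_mul {α : Type} [DecidableEq α] (P : Finset α) (s : Finset ℕ) (h : ℕ → α) (f : α → ℝ)
    (hh : ∀ k ∈ s, h k ∈ P) :
    ∑ p ∈ P, (∑ k ∈ s, if h k = p then (1 : ℝ) else 0) * f p = ∑ k ∈ s, f (h k) := by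
  simp_rw [Finset.sum_mul]
  rw [Finset.sum_comm]
  exact Finset.sum_congr rfl fun k hk => sum_ite_eq_mul P (h k) f (hh k hk)

theorem sum_coef_mul (b R : ℕ) (P : Finset (ZdPlaquette 4)) (f : ZdPlaquette 4 → ℝ) (q : ZdPlaquette 4)
    (hq : q ∈ P)
    (h3 : ∀ k ∈ Finset.range (combLen R (q.1 + Pi.single 0 1) 3), hp3 b R (q.1 + Pi.single 0 1) q.2.1.2 k ∈ P)
    (h2 : ∀ k ∈ Finset.range (combLen R (q.1 + Pi.single 0 1) 2), hp2 b R (q.1 + Pi.single 0 1) k ∈ P) :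
    ∑ p ∈ P, coef b R q p * f p =
      2 * f q +
        if q.2.1.1 = 0 ∧ q.1 0 = (b : ℤ) then
          32 * (R : ℝ) *
            (∑ k ∈ Finset.range (combLen R (q.1 + Pi.single 0 1) 3), f (hp3 b R (q.1 + Pi.single 0 1) q.2.1.2 k) +
              ∑ k ∈ Finset.range (combLen R (q.1 + Pi.single 0 1) 2), f (hp2 b R (q.1 + Pi.single 0 1) k))
        else 0 := by
  unfold coef
  by_cases ht : q.2.1.1 = 0 ∧ q.1 0 = (b : ℤ)
  · simp only [if_pos ht]
    have hsplit : ∀ p ∈ P,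
        (2 * (if q = p then 1 else 0) + 32 * (R : ℝ) *
          ((∑ k ∈ Finset.range (combLen R (q.1 + Pi.single 0 1) 3),
              if hp3 b R (q.1 + Pi.single 0 1) q.2.1.2 k = p then (1 : ℝ) else 0) +
            ∑ k ∈ Finset.range (combLen R (q.1 + Pi.single 0 1) 2),
              if hp2 b R (q.1 + Pi.single 0 1) k = p then (1 : ℝ) else 0)) * f p =
        2 * ((if q = p then 1 else 0) * f p) +
          (32 * (R : ℝ) * ((∑ k ∈ Finset.range (combLen R (q.1 + Pi.single 0 1) 3),
              if hp3 b R (q.1 + Pi.single 0 1) q.2.1.2 k = p then (1 : ℝ) else 0) * f p) +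
           32 * (R : ℝ) * ((∑ k ∈ Finset.range (combLen R (q.1 + Pi.single 0 1) 2),
              if hp2 b R (q.1 + Pi.single 0 1) k = p then (1 : ℝ) else 0) * f p)) := by
      intro p _; ring
    rw [Finset.sum_congr rfl hsplit, Finset.sum_add_distrib, Finset.sum_add_distrib, ← Finset.mul_sum, ← Finset.mul_sum,
      ← Finset.mul_sum, sum_ite_eq_mul P q f hq, sum_sum_ite_eq_mul P _ _ f h3, sum_sum_ite_eq_mul P _ _ f h2]
    ring
  · simp only [if_neg ht, add_zero]
    have hsplit : ∀ p ∈ P, (2 * (if q = p then 1 else 0)) * f p = 2 * ((if q = p then (1 : ℝ) else 0) * f p) := by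
      intro p _; ring
    rw [Finset.sum_congr rfl hsplit, ← Finset.mul_sum, sum_ite_eq_mul P q f hq]

theorem pe_twist_top_le (hρu : ∀ g, ρ g ∈ Matrix.unitaryGroup (Fin N) ℂ) {b n R : ℕ} (hb : 1 ≤ b)
    (hR : (2 * n + 1) * b ≤ R) (k₀ : G) (σ : LGConfig 4 G) {q : ZdPlaquette 4}
    (hq : q ∈ plaquettesTouching (rowRegion b n)) (ht : q.2.1.1 = 0 ∧ q.1 0 = (b : ℤ)) :
    pe ρ q (topTwist b (comb b R k₀ σ) σ) ≤
      2 * pe ρ q σ +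
        32 * (R : ℝ) *
          (∑ k ∈ Finset.range (combLen R (q.1 + Pi.single 0 1) 3), pe ρ (hp3 b R (q.1 + Pi.single 0 1) q.2.1.2 k) σ +
            ∑ k ∈ Finset.range (combLen R (q.1 + Pi.single 0 1) 2), pe ρ (hp2 b R (q.1 + Pi.single 0 1) k) σ) := by
  have hbox := mem_topBox_of_touching hq ht.2
  rw [topBox, Fintype.mem_piFinset] at hbox
  obtain ⟨x, ⟨⟨i, j⟩, hij⟩⟩ := q
  dsimp only at ht hbox hij ⊢
  obtain ⟨hi, hx⟩ := ht
  subst hi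
  have hj0 : j ≠ 0 := by rintro rfl; exact lt_irrefl _ hij
  have hsp : ∀ l : Fin 4, l ≠ 0 → -(2 * (n : ℤ) * b) - 1 ≤ x l ∧ x l ≤ (2 * (n : ℤ) + 1) * b - 1 := fun l hl => by
    have h := hbox l
    rw [if_neg hl, Finset.mem_Icc] at h
    exact h
  have hyl : ∀ l : Fin 4, l ≠ 0 → ((x + Pi.single (0 : Fin 4) (1 : ℤ) : Site 4)) l = x l := fun l hl => by
    rw [Pi.add_apply, Pi.single_apply, if_neg hl, add_zero]
  have hy0 : ((x + Pi.single (0 : Fin 4) (1 : ℤ) : Site 4)) 0 = (b : ℤ) + 1 := by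
    rw [Pi.add_apply, Pi.single_eq_same, hx]
  have hRz : (((2 * n + 1) * b : ℕ) : ℤ) ≤ (R : ℤ) := by exact_mod_cast hR
  push_cast at hRz
  have hbz : (1 : ℤ) ≤ (b : ℤ) := by exact_mod_cast hb
  have hy : InLayer b R (x + Pi.single 0 1) :=
    ⟨hy0, fun l hl => by rw [hyl l hl]; linarith [(hsp l hl).1]⟩
  have hle : ∀ l : Fin 4, l ≠ 0 → ((x + Pi.single (0 : Fin 4) (1 : ℤ) : Site 4)) l ≤ (R : ℤ) := fun l hl => by
    rw [hyl l hl]; linarith [(hsp l hl).2]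
  have hn3 : (combLen R (x + Pi.single 0 1) 3 : ℝ) ≤ 2 * R := by
    exact_mod_cast combLen_le (hle 3 (by decide))
  have hn2 : (combLen R (x + Pi.single 0 1) 2 : ℝ) ≤ 2 * R := by
    exact_mod_cast combLen_le (hle 2 (by decide))
  have h1 := topFace_energy_comb_le ρ hρu b R k₀ σ x hj0 hx
  have hS3 : 0 ≤ ∑ k ∈ Finset.range (combLen R (x + Pi.single 0 1) 3), pe ρ (hp3 b R (x + Pi.single 0 1) j k) σ :=
    Finset.sum_nonneg fun k _ => pe_nonneg ρ hρu _ _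
  have hS2 : 0 ≤ ∑ k ∈ Finset.range (combLen R (x + Pi.single 0 1) 2), pe ρ (hp2 b R (x + Pi.single 0 1) k) σ :=
    Finset.sum_nonneg fun k _ => pe_nonneg ρ hρu _ _
  have hR0 : (0 : ℝ) ≤ (R : ℝ) := Nat.cast_nonneg R
  unfold pe at hS3 hS2 ⊢
  dsimp only at hS3 hS2 ⊢
  by_cases hj3 : j = 3
  · subst hj3
    have h0 : ‖ρ (hairpin b R σ (x + Pi.single 0 1) 3) - 1‖ = 0 := norm_map_hairpin_three ρ σ hy
    rw [h0] at h1
    norm_num at h1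
    nlinarith [h1, hS3, hS2, hR0, mul_nonneg hR0 (add_nonneg hS3 hS2)]
  · have hj3' : j < 3 := Fin.lt_last_iff_ne_last.2 hj3
    have h2 : ‖ρ (hairpin b R σ (x + Pi.single 0 1) j) - 1‖ ^ 2 ≤ _ :=
      norm_map_hairpin_sub_one_sq_le ρ hρu σ hy hj0
    have e3 : ∑ k ∈ Finset.range (combLen R (x + Pi.single 0 1) 3),
        ‖ρ (plaquetteHolonomyZd σ (combPt3 b R (x + Pi.single 0 1) + Pi.single 3 (k : ℤ)) j 3) - 1‖ ^ 2 =
        ∑ k ∈ Finset.range (combLen R (x + Pi.single 0 1) 3),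
          2 * ((N : ℝ) - plaquetteObs ρ (hp3 b R (x + Pi.single 0 1) j k).1 (hp3 b R (x + Pi.single 0 1) j k).2.1.1
            (hp3 b R (x + Pi.single 0 1) j k).2.1.2 σ) :=
      Finset.sum_congr rfl fun k _ => by rw [norm_sq_eq_two_mul_energy ρ hρu]; simp only [hp3, dif_pos hj3']
    have e2 : ∑ k ∈ Finset.range (combLen R (x + Pi.single 0 1) 2),
        ‖ρ (plaquetteHolonomyZd σ (combPt2 b R (x + Pi.single 0 1) + Pi.single 2 (k : ℤ)) 1 2) - 1‖ ^ 2 =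
        ∑ k ∈ Finset.range (combLen R (x + Pi.single 0 1) 2),
          2 * ((N : ℝ) - plaquetteObs ρ (hp2 b R (x + Pi.single 0 1) k).1 (hp2 b R (x + Pi.single 0 1) k).2.1.1
            (hp2 b R (x + Pi.single 0 1) k).2.1.2 σ) :=
      Finset.sum_congr rfl fun k _ => by rw [norm_sq_eq_two_mul_energy ρ hρu]; simp only [hp2]
    rw [e3, e2, ← Finset.mul_sum, ← Finset.mul_sum] at h2
    have hm3 := mul_le_mul_of_nonneg_right hn3 hS3
    have hm2 := mul_le_mul_of_nonneg_right hn2 hS2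
    nlinarith [h1, h2, hm3, hm2, hS3, hS2, hR0]

theorem pe_twist_le_sum_coef (hρu : ∀ g, ρ g ∈ Matrix.unitaryGroup (Fin N) ℂ) {b n R : ℕ} (hb : 1 ≤ b)
    (hR : (2 * n + 1) * b ≤ R) (k₀ : G) (σ : LGConfig 4 G) (P : Finset (ZdPlaquette 4)) {q : ZdPlaquette 4}
    (hqT : q ∈ plaquettesTouching (rowRegion b n)) (hq : q ∈ P)
    (h3 : ∀ k ∈ Finset.range (combLen R (q.1 + Pi.single 0 1) 3), hp3 b R (q.1 + Pi.single 0 1) q.2.1.2 k ∈ P)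
    (h2 : ∀ k ∈ Finset.range (combLen R (q.1 + Pi.single 0 1) 2), hp2 b R (q.1 + Pi.single 0 1) k ∈ P) :
    pe ρ q (topTwist b (comb b R k₀ σ) σ) ≤ ∑ p ∈ P, coef b R q p * pe ρ p σ := by
  rw [sum_coef_mul b R P _ q hq h3 h2]
  by_cases ht : q.2.1.1 = 0 ∧ q.1 0 = (b : ℤ)
  · rw [if_pos ht]
    exact pe_twist_top_le ρ hρu hb hR k₀ σ hqT ht
  · rw [if_neg ht, add_zero]
    have he : pe ρ q (topTwist b (comb b R k₀ σ) σ) = pe ρ q σ := energy_topTwist_of_not_topFace ρ b _ σ q ht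
    rw [he]
    linarith [pe_nonneg ρ hρu q σ]

theorem sum_coef_le {b n R : ℕ} (hR : (2 * n + 1) * b ≤ R) (P : Finset (ZdPlaquette 4)) {q : ZdPlaquette 4}
    (hqT : q ∈ plaquettesTouching (rowRegion b n)) (hq : q ∈ P)
    (h3 : ∀ k ∈ Finset.range (combLen R (q.1 + Pi.single 0 1) 3), hp3 b R (q.1 + Pi.single 0 1) q.2.1.2 k ∈ P)
    (h2 : ∀ k ∈ Finset.range (combLen R (q.1 + Pi.single 0 1) 2), hp2 b R (q.1 + Pi.single 0 1) k ∈ P) :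
    ∑ p ∈ P, coef b R q p ≤ 2 + if q.2.1.1 = 0 ∧ q.1 0 = (b : ℤ) then 128 * (R : ℝ) ^ 2 else 0 := by
  have h := sum_coef_mul b R P (fun _ => (1 : ℝ)) q hq h3 h2
  simp only [mul_one, Finset.sum_const, Finset.card_range, nsmul_eq_mul] at h
  rw [h]
  by_cases ht : q.2.1.1 = 0 ∧ q.1 0 = (b : ℤ)
  · rw [if_pos ht, if_pos ht]
    have hbox := mem_topBox_of_touching hqT ht.2
    rw [topBox, Fintype.mem_piFinset] at hbox
    have hsp : ∀ l : Fin 4, l ≠ 0 → q.1 l ≤ (2 * (n : ℤ) + 1) * b - 1 := fun l hl => by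
      have h := hbox l
      rw [if_neg hl, Finset.mem_Icc] at h
      exact h.2
    have hyl : ∀ l : Fin 4, l ≠ 0 → ((q.1 + Pi.single (0 : Fin 4) (1 : ℤ) : Site 4)) l = q.1 l := fun l hl => by
      rw [Pi.add_apply, Pi.single_apply, if_neg hl, add_zero]
    have hRz : (((2 * n + 1) * b : ℕ) : ℤ) ≤ (R : ℤ) := by exact_mod_cast hR
    push_cast at hRz
    have hle : ∀ l : Fin 4, l ≠ 0 → ((q.1 + Pi.single (0 : Fin 4) (1 : ℤ) : Site 4)) l ≤ (R : ℤ) := fun l hl => by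
      rw [hyl l hl]; linarith [hsp l hl]
    have hn3 : (combLen R (q.1 + Pi.single 0 1) 3 : ℝ) ≤ 2 * R := by
      exact_mod_cast combLen_le (hle 3 (by decide))
    have hn2 : (combLen R (q.1 + Pi.single 0 1) 2 : ℝ) ≤ 2 * R := by
      exact_mod_cast combLen_le (hle 2 (by decide))
    have hR0 : (0 : ℝ) ≤ (R : ℝ) := Nat.cast_nonneg R
    have hm := mul_le_mul_of_nonneg_left (add_le_add hn3 hn2) (by positivity : (0 : ℝ) ≤ 32 * (R : ℝ))
    nlinarith [hn3, hn2, hR0, hm]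
  · rw [if_neg ht, if_neg ht]

def bigBox (b n : ℕ) : Finset (Site 4) :=
  Fintype.piFinset fun i : Fin 4 =>
    if i = 0 then Finset.Icc (0 : ℤ) b else Finset.Icc (-(2 * (n : ℤ) * b) - 1) ((2 * (n : ℤ) + 1) * b - 1)

theorem card_bigBox (b n : ℕ) : (bigBox b n).card = (b + 1) * ((4 * n + 1) * b + 1) ^ 3 := by
  rw [bigBox, Fintype.card_piFinset, Fin.prod_univ_four, if_pos rfl, if_neg (show (1 : Fin 4) ≠ 0 by decide),
    if_neg (show (2 : Fin 4) ≠ 0 by decide), if_neg (show (3 : Fin 4) ≠ 0 by decide), Int.card_Icc, Int.card_Icc]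
  have h : (2 * (n : ℤ) + 1) * b - 1 + 1 - (-(2 * (n : ℤ) * b) - 1) = (((4 * n + 1) * b + 1 : ℕ) : ℤ) := by
    push_cast; ring
  have h0 : (b : ℤ) + 1 - 0 = ((b + 1 : ℕ) : ℤ) := by push_cast; ring
  rw [h, h0, Int.toNat_natCast, Int.toNat_natCast]
  ring

theorem mem_bigBox_of_touching {b n : ℕ} {q : ZdPlaquette 4} (hq : q ∈ plaquettesTouching (rowRegion b n)) :
    q.1 ∈ bigBox b n := by
  rw [mem_plaquettesTouching_iff] at hq
  obtain ⟨e, he⟩ := hq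
  rw [Finset.mem_inter] at he
  obtain ⟨he1, he2⟩ := he
  rw [bigBox, Fintype.mem_piFinset]
  have hbox := box_of_mem_rowRegion he2
  intro i
  by_cases hi : i = 0
  · subst hi
    rw [if_pos rfl, Finset.mem_Icc]
    have hs := hbox.1
    simp only [plaquetteEdges, Finset.mem_insert, Finset.mem_singleton] at he1
    rcases he1 with rfl | rfl | rfl | rfl
    · dsimp only at hs
      constructor <;> linarith [hs.1, hs.2]
    · dsimp only at hs
      rw [Pi.add_apply, Pi.single_apply] at hs
      split_ifs at hs <;> constructor <;> linarith [hs.1, hs.2]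
    · dsimp only at hs
      rw [Pi.add_apply, Pi.single_apply] at hs
      split_ifs at hs <;> constructor <;> linarith [hs.1, hs.2]
    · dsimp only at hs
      constructor <;> linarith [hs.1, hs.2]
  · rw [if_neg hi, Finset.mem_Icc]
    have hs := hbox.2 i hi
    simp only [plaquetteEdges, Finset.mem_insert, Finset.mem_singleton] at he1
    rcases he1 with rfl | rfl | rfl | rfl
    · dsimp only at hs
      constructor <;> linarith [hs.1, hs.2]
    · dsimp only at hs
      rw [Pi.add_apply, Pi.single_apply] at hs
      split_ifs at hs <;> constructor <;> linarith [hs.1, hs.2]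
    · dsimp only at hs
      rw [Pi.add_apply, Pi.single_apply] at hs
      split_ifs at hs <;> constructor <;> linarith [hs.1, hs.2]
    · dsimp only at hs
      constructor <;> linarith [hs.1, hs.2]

theorem card_touching_rowRegion_le (b n : ℕ) :
    (plaquettesTouching (rowRegion b n)).card ≤ 6 * ((b + 1) * ((4 * n + 1) * b + 1) ^ 3) := by
  have hsub : plaquettesTouching (rowRegion b n) ⊆
      bigBox b n ×ˢ (Finset.univ : Finset {p : Fin 4 × Fin 4 // p.1 < p.2}) := fun q hq =>
    Finset.mem_product.2 ⟨mem_bigBox_of_touching hq, Finset.mem_univ _⟩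
  refine (Finset.card_le_card hsub).trans ?_
  rw [Finset.card_product, card_bigBox, Finset.card_univ, card_orientations, mul_comm]

theorem card_touching_top_le (b n : ℕ) :
    ((plaquettesTouching (rowRegion b n)).filter (fun q => q.2.1.1 = 0 ∧ q.1 0 = (b : ℤ))).card ≤
      6 * ((4 * n + 1) * b + 1) ^ 3 := by
  refine le_trans (Finset.card_le_card ?_) ((card_touching_height_eq_le b n).trans_eq (by rw [card_orientations]))
  intro q hq
  rw [Finset.mem_filter] at hq ⊢
  exact ⟨hq.1, hq.2.2⟩

theorem twistAction_le_weighted (hρu : ∀ g, ρ g ∈ Matrix.unitaryGroup (Fin N) ℂ) (n : ℕ) (k₀ : G) :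
    ∃ C : ℝ, 0 < C ∧ ∀ b : ℕ, 1 ≤ b →
      ∃ (P : Finset (ZdPlaquette 4)) (w : ZdPlaquette 4 → ℝ), (∀ q, 0 ≤ w q) ∧
        ∑ q ∈ P, w q ≤ C * (b : ℝ) ^ 5 ∧
        ∀ σ : LGConfig 4 G,
          wilsonBoundaryAction ρ (rowRegion b n) (twistΦ b (comb b ((2 * n + 2) * b + 1) k₀) σ) ≤
            ∑ q ∈ P, w q * ((N : ℝ) - plaquetteObs ρ q.1 q.2.1.1 q.2.1.2 σ) := by
  refine ⟨24 * (4 * (n : ℝ) + 2) ^ 3 + 768 * (4 * (n : ℝ) + 2) ^ 3 * (2 * (n : ℝ) + 3) ^ 2, by positivity,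
    fun b hb => ?_⟩
  set R : ℕ := (2 * n + 2) * b + 1 with hRdef
  have hR : (2 * n + 1) * b ≤ R := by rw [hRdef]; nlinarith
  let T : Finset (ZdPlaquette 4) := plaquettesTouching (rowRegion b n)
  let H : ZdPlaquette 4 → Finset (ZdPlaquette 4) := fun q =>
    (Finset.range (combLen R (q.1 + Pi.single 0 1) 3)).image (hp3 b R (q.1 + Pi.single 0 1) q.2.1.2) ∪
      (Finset.range (combLen R (q.1 + Pi.single 0 1) 2)).image (hp2 b R (q.1 + Pi.single 0 1))
  let P : Finset (ZdPlaquette 4) := T ∪ T.biUnion H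
  have hTP : ∀ q ∈ T, q ∈ P := fun q hq => Finset.mem_union_left _ hq
  have h3P : ∀ q ∈ T, ∀ k ∈ Finset.range (combLen R (q.1 + Pi.single 0 1) 3),
      hp3 b R (q.1 + Pi.single 0 1) q.2.1.2 k ∈ P := fun q hq k hk =>
    Finset.mem_union_right _ (Finset.mem_biUnion.2 ⟨q, hq, Finset.mem_union_left _ (Finset.mem_image_of_mem _ hk)⟩)
  have h2P : ∀ q ∈ T, ∀ k ∈ Finset.range (combLen R (q.1 + Pi.single 0 1) 2),
      hp2 b R (q.1 + Pi.single 0 1) k ∈ P := fun q hq k hk =>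
    Finset.mem_union_right _ (Finset.mem_biUnion.2 ⟨q, hq, Finset.mem_union_right _ (Finset.mem_image_of_mem _ hk)⟩)
  refine ⟨P, fun p => ∑ q ∈ T, coef b R q p, fun p => Finset.sum_nonneg fun q _ => coef_nonneg b R q p, ?_, ?_⟩
  · -- total weight
    rw [Finset.sum_comm]
    have hq : ∀ q ∈ T, ∑ p ∈ P, coef b R q p ≤ 2 + if q.2.1.1 = 0 ∧ q.1 0 = (b : ℤ) then 128 * (R : ℝ) ^ 2 else 0 :=
      fun q hqT => sum_coef_le hR P hqT (hTP q hqT) (h3P q hqT) (h2P q hqT)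
    refine (Finset.sum_le_sum hq).trans ?_
    rw [Finset.sum_add_distrib, Finset.sum_const, nsmul_eq_mul, ← Finset.sum_filter, Finset.sum_const, nsmul_eq_mul]
    have hT : (T.card : ℝ) ≤ 6 * (((b : ℝ) + 1) * ((4 * n + 1) * b + 1) ^ 3) := by
      exact_mod_cast card_touching_rowRegion_le b n
    have hTt : ((T.filter (fun q => q.2.1.1 = 0 ∧ q.1 0 = (b : ℤ))).card : ℝ) ≤ 6 * ((4 * (n : ℝ) + 1) * b + 1) ^ 3 := by
      exact_mod_cast card_touching_top_le b n
    have hb1 : (1 : ℝ) ≤ (b : ℝ) := by exact_mod_cast hb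
    have hRr : (R : ℝ) = (2 * n + 2) * b + 1 := by rw [hRdef]; push_cast; ring
    have hL : (4 * (n : ℝ) + 1) * b + 1 ≤ (4 * (n : ℝ) + 2) * b := by nlinarith
    have hRle : (R : ℝ) ≤ (2 * (n : ℝ) + 3) * b := by rw [hRr]; nlinarith
    have hn0 : (0 : ℝ) ≤ (n : ℝ) := Nat.cast_nonneg n
    have hL0 : (0 : ℝ) ≤ (4 * (n : ℝ) + 1) * b + 1 := by positivity
    have hR0 : (0 : ℝ) ≤ (R : ℝ) := Nat.cast_nonneg R
    have hb4 : (b : ℝ) ^ 4 ≤ (b : ℝ) ^ 5 := pow_le_pow_right₀ hb1 (by norm_num)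
    calc (T.card : ℝ) * 2 + ((T.filter (fun q => q.2.1.1 = 0 ∧ q.1 0 = (b : ℤ))).card : ℝ) * (128 * (R : ℝ) ^ 2)
        ≤ 6 * (((b : ℝ) + 1) * ((4 * n + 1) * b + 1) ^ 3) * 2 +
            6 * ((4 * (n : ℝ) + 1) * b + 1) ^ 3 * (128 * (R : ℝ) ^ 2) := by gcongr
      _ ≤ 6 * ((2 * (b : ℝ)) * ((4 * (n : ℝ) + 2) * b) ^ 3) * 2 +
            6 * ((4 * (n : ℝ) + 2) * b) ^ 3 * (128 * ((2 * (n : ℝ) + 3) * b) ^ 2) := by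
          gcongr
          · linarith
      _ = 24 * (4 * (n : ℝ) + 2) ^ 3 * (b : ℝ) ^ 4 + 768 * (4 * (n : ℝ) + 2) ^ 3 * (2 * (n : ℝ) + 3) ^ 2 * (b : ℝ) ^ 5 := by
          ring
      _ ≤ 24 * (4 * (n : ℝ) + 2) ^ 3 * (b : ℝ) ^ 5 + 768 * (4 * (n : ℝ) + 2) ^ 3 * (2 * (n : ℝ) + 3) ^ 2 * (b : ℝ) ^ 5 := by
          gcongr
      _ = _ := by ring
  · -- domination
    intro σ
    rw [twistΦ, wilsonBoundaryAction_eq_sum_pe]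
    have hq : ∀ q ∈ T, pe ρ q (topTwist b (comb b R k₀ σ) σ) ≤ ∑ p ∈ P, coef b R q p * pe ρ p σ := fun q hqT =>
      pe_twist_le_sum_coef ρ hρu hb hR k₀ σ P hqT (hTP q hqT) (h3P q hqT) (h2P q hqT)
    refine (Finset.sum_le_sum hq).trans_eq ?_
    rw [Finset.sum_comm]
    refine Finset.sum_congr rfl fun p _ => ?_
    rw [Finset.sum_mul]
    rfl

end Assembly

end Summit.QuantumFields.YangMills.Cruxes.IR.CruxIdea2g7Hairpin

end CompanionFileB

namespace Summit.QuantumFields.YangMills.Cruxes.IR.CruxIdea2g7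

section GibbsTail

variable {X : Type*} [MeasurableSpace X]

theorem gibbsTail_le (μ : Measure X) [IsProbabilityMeasure μ] {A : X → ℝ} (hAm : Measurable A)
    (hA0 : ∀ x, 0 ≤ A x) {β : ℝ} (hβ : 0 ≤ β) (a s : ℝ) (hs : 0 < μ.real {x | A x ≤ s}) :
    (μ.tilted fun x => -(β * A x)).real {x | a < A x} ≤
      Real.exp (-(β * (a - s))) / μ.real {x | A x ≤ s} := by
  set w : X → ℝ := fun x => Real.exp (-(β * A x)) with hw
  have hwm : Measurable w := (Real.measurable_exp.comp ((hAm.const_mul β).neg))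
  have hw0 : ∀ x, 0 < w x := fun x => Real.exp_pos _
  have hw1 : ∀ x, w x ≤ 1 := fun x => by
    show Real.exp (-(β * A x)) ≤ 1
    rw [Real.exp_le_one_iff]
    have := mul_nonneg hβ (hA0 x)
    linarith
  have hwi : Integrable w μ :=
    (integrable_const (1 : ℝ)).mono' hwm.aestronglyMeasurable
      (ae_of_all _ fun x => by rw [Real.norm_eq_abs, abs_of_pos (hw0 x)]; exact hw1 x)
  set Z : ℝ := ∫ x, w x ∂μ with hZ
  have hSm : MeasurableSet {x | A x ≤ s} := measurableSet_le hAm measurable_const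
  have hTm : MeasurableSet {x | a < A x} := measurableSet_lt measurable_const hAm
  have hZlow : Real.exp (-(β * s)) * μ.real {x | A x ≤ s} ≤ Z := by
    calc Real.exp (-(β * s)) * μ.real {x | A x ≤ s}
        = ∫ x in {x | A x ≤ s}, Real.exp (-(β * s)) ∂μ := by
          rw [setIntegral_const, smul_eq_mul, mul_comm]
      _ ≤ ∫ x in {x | A x ≤ s}, w x ∂μ := by
          refine setIntegral_mono_on (integrable_const _).integrableOn hwi.integrableOn hSm fun x hx => ?_
          have hx' : A x ≤ s := hx
          exact Real.exp_le_exp.2 (neg_le_neg (mul_le_mul_of_nonneg_left hx' hβ))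
      _ ≤ Z := setIntegral_le_integral hwi (ae_of_all _ fun x => (hw0 x).le)
  have hZpos : 0 < Z := lt_of_lt_of_le (mul_pos (Real.exp_pos _) hs) hZlow
  have hreal : (μ.tilted fun x => -(β * A x)).real {x | a < A x} =
      ∫ x in {x | a < A x}, w x / Z ∂μ := by
    rw [measureReal_def, tilted_apply_eq_ofReal_integral' _ hTm, ENNReal.toReal_ofReal]
    exact integral_nonneg fun x => div_nonneg (Real.exp_pos _).le hZpos.le
  have hbound : ∫ x in {x | a < A x}, w x / Z ∂μ ≤ ∫ x in {x | a < A x}, Real.exp (-(β * a)) / Z ∂μ := by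
    refine setIntegral_mono_on (hwi.div_const Z).integrableOn (integrable_const _).integrableOn hTm
      fun x hx => ?_
    have hx' : a < A x := hx
    exact div_le_div_of_nonneg_right
      (Real.exp_le_exp.2 (neg_le_neg (mul_le_mul_of_nonneg_left hx'.le hβ))) hZpos.le
  have hmass : ∫ x in {x | a < A x}, Real.exp (-(β * a)) / Z ∂μ ≤ Real.exp (-(β * a)) / Z := by
    rw [setIntegral_const, smul_eq_mul]
    have h1 : μ.real {x | a < A x} ≤ 1 := measureReal_le_one
    have h2 : 0 ≤ Real.exp (-(β * a)) / Z := div_nonneg (Real.exp_pos _).le hZpos.le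
    nlinarith
  have hfin : Real.exp (-(β * a)) / Z ≤ Real.exp (-(β * (a - s))) / μ.real {x | A x ≤ s} := by
    have hden : 0 < Real.exp (-(β * s)) * μ.real {x | A x ≤ s} := mul_pos (Real.exp_pos _) hs
    calc Real.exp (-(β * a)) / Z
        ≤ Real.exp (-(β * a)) / (Real.exp (-(β * s)) * μ.real {x | A x ≤ s}) :=
          div_le_div_of_nonneg_left (Real.exp_pos _).le hden hZlow
      _ = Real.exp (-(β * (a - s))) / μ.real {x | A x ≤ s} := by
          rw [← div_div, ← Real.exp_sub]
          congr 2
          ring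
  rw [hreal]
  exact hbound.trans (hmass.trans hfin)

theorem gibbsTail_le_exp_neg (μ : Measure X) [IsProbabilityMeasure μ] {A : X → ℝ} (hAm : Measurable A)
    (hA0 : ∀ x, 0 ≤ A x) {β : ℝ} (hβ : 0 < β) (s t : ℝ) (hs : 0 < μ.real {x | A x ≤ s}) :
    (μ.tilted fun x => -(β * A x)).real
        {x | s + (Real.log (1 / μ.real {x | A x ≤ s}) + t) / β < A x} ≤ Real.exp (-t) := by
  have h := gibbsTail_le μ hAm hA0 hβ.le (s + (Real.log (1 / μ.real {x | A x ≤ s}) + t) / β) s hs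
  refine h.trans (le_of_eq ?_)
  have hm : 0 < μ.real {x | A x ≤ s} := hs
  have e1 : β * (s + (Real.log (1 / μ.real {x | A x ≤ s}) + t) / β - s) =
      Real.log (1 / μ.real {x | A x ≤ s}) + t := by
    field_simp
    ring
  rw [e1, neg_add, Real.exp_add, Real.exp_neg, Real.exp_log (one_div_pos.2 hm), one_div, inv_inv,
    mul_comm, mul_div_assoc, div_self hm.ne', mul_one]

theorem gibbsMean_le_of_tail (μ : Measure X) [IsProbabilityMeasure μ] {A : X → ℝ} (hAm : Measurable A)
    (hA0 : ∀ x, 0 ≤ A x) {M : ℝ} (hAM : ∀ x, A x ≤ M) (β : ℝ) {a r : ℝ} (ha : 0 ≤ a)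
    (htail : (μ.tilted fun x => -(β * A x)).real {x | a < A x} ≤ r) :
    ∫ x, A x ∂(μ.tilted fun x => -(β * A x)) ≤ a + M * r := by
  set ν := μ.tilted fun x => -(β * A x) with hν
  have hexp : Integrable (fun x => Real.exp (-(β * A x))) μ := by
    refine Integrable.of_bound ((hAm.const_mul β).neg.exp.aestronglyMeasurable) (Real.exp (|β| * M))
      (ae_of_all _ fun x => ?_)
    rw [Real.norm_eq_abs, abs_of_pos (Real.exp_pos _), Real.exp_le_exp]
    calc -(β * A x) ≤ |β * A x| := neg_le_abs _
      _ = |β| * A x := by rw [abs_mul, abs_of_nonneg (hA0 x)]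
      _ ≤ |β| * M := mul_le_mul_of_nonneg_left (hAM x) (abs_nonneg β)
  haveI : IsProbabilityMeasure ν := isProbabilityMeasure_tilted hexp
  have hS : MeasurableSet {x | a < A x} := measurableSet_lt measurable_const hAm
  by_cases hM : 0 ≤ M
  swap
  · have hX : IsEmpty X :=
      ⟨fun x => (not_le.2 (lt_of_le_of_lt (hA0 x) (lt_of_le_of_lt (hAM x) (not_le.1 hM)))) le_rfl⟩
    have : (ν : Measure X) = 0 := Measure.eq_zero_of_isEmpty ν
    exact absurd (IsProbabilityMeasure.ne_zero ν) (by simpa using this)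
  have hpt : ∀ x, A x ≤ a + M * Set.indicator {x | a < A x} (1 : X → ℝ) x := by
    intro x
    by_cases hx : a < A x
    · have hmem : x ∈ {x | a < A x} := hx
      rw [Set.indicator_of_mem hmem]
      simp only [Pi.one_apply, mul_one]
      linarith [hAM x]
    · have hnm : x ∉ {x | a < A x} := hx
      rw [Set.indicator_of_notMem hnm, mul_zero, add_zero]
      exact not_lt.1 hx
  have hintA : Integrable A ν := Integrable.of_bound hAm.aestronglyMeasurable M
    (ae_of_all _ fun x => by rw [Real.norm_eq_abs, abs_of_nonneg (hA0 x)]; exact hAM x)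
  have hintI : Integrable (fun x => Set.indicator {x | a < A x} (1 : X → ℝ) x) ν :=
    show Integrable (fun x => Set.indicator {x | a < A x} (1 : X → ℝ) x) ν from
      (integrable_const (1 : ℝ)).indicator hS
  have hint2 : Integrable (fun x => a + M * Set.indicator {x | a < A x} (1 : X → ℝ) x) ν :=
    (integrable_const a).add (hintI.const_mul M)
  calc ∫ x, A x ∂ν ≤ ∫ x, (a + M * Set.indicator {x | a < A x} (1 : X → ℝ) x) ∂ν :=
        integral_mono hintA hint2 hpt
    _ = a + M * ν.real {x | a < A x} := by
        rw [integral_add (integrable_const a) (hintI.const_mul M), integral_const, integral_const_mul,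
          integral_indicator_one hS]
        simp
    _ ≤ a + M * r := by gcongr

theorem gibbsMean_le (μ : Measure X) [IsProbabilityMeasure μ] {A : X → ℝ} (hAm : Measurable A)
    (hA0 : ∀ x, 0 ≤ A x) {M : ℝ} (hAM : ∀ x, A x ≤ M) {β : ℝ} (hβ : 0 < β) {s t : ℝ}
    (hs0 : 0 ≤ s) (ht : 0 ≤ t) (hs : 0 < μ.real {x | A x ≤ s}) :
    ∫ x, A x ∂(μ.tilted fun x => -(β * A x)) ≤
      s + (Real.log (1 / μ.real {x | A x ≤ s}) + t) / β + M * Real.exp (-t) := by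
  have hm1 : μ.real {x | A x ≤ s} ≤ 1 :=
    (measureReal_mono (Set.subset_univ _)).trans_eq probReal_univ
  have hlog : 0 ≤ Real.log (1 / μ.real {x | A x ≤ s}) := Real.log_nonneg (one_le_one_div hs hm1)
  have ha : 0 ≤ s + (Real.log (1 / μ.real {x | A x ≤ s}) + t) / β := by positivity
  exact gibbsMean_le_of_tail μ hAm hA0 hAM β ha (gibbsTail_le_exp_neg μ hAm hA0 hβ s t hs)

end GibbsTail

section Telescoping

variable {R : Type*} [NormedRing R]

end Telescoping

section Core

open Literature.MathematicalPhysics.QuantumFieldTheory (wilsonMeasure GaugeConfig isProbabilityMeasure_wilsonMeasure)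

variable {G : Type} [Group G] [TopologicalSpace G] [IsTopologicalGroup G] [CompactSpace G]
  [SecondCountableTopology G] [MeasurableSpace G] [BorelSpace G]
  {N : ℕ} (ρ : G →* Matrix (Fin N) (Fin N) ℂ)

theorem frame_core_at (hρ : Continuous ρ)
    (hρu : ∀ g, ρ g ∈ Matrix.unitaryGroup (Fin N) ℂ)
    {b : ℕ} (hb : 1 ≤ b) (n : ℕ) (κ : LGConfig 4 G → Site 4 → G)
    {ψ : ℝ → ℝ} (hψ : Continuous ψ) (hψ1 : ∀ t, |t| ≤ 1 → |ψ t| ≤ 1)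
    {A : ℝ} (hA : 0 ≤ A) (hψA : ∀ t, t ≤ 1 → 1 - ψ t ≤ A * (1 - t)) {v : ℝ}
    (hT : TopTwistTransfer ρ κ b n) {β ε δ s : ℝ} (hs0 : 0 < s) (hs8 : s ≤ 1 / 8)
    (hs4 : s ≤ (1 - v - 2 * ε) / 4)
    (hfreeze0 : 1 - s * s / (A + 1) ≤
      ∫ V, loopObs ρ b ((2 * n + 1) * b) (torusLift (2 * ((2 * n + 2) * b + 1) + 1) V)
        ∂(wilsonMeasure (d := 4) (L := 2 * ((2 * n + 2) * b + 1) + 1) ρ β))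
    (hFat : (wilsonMeasure (d := 4) (L := 2 * ((2 * n + 2) * b + 1) + 1) ρ β)
        {V | v + s < twistedMeanObs ρ β b n κ ψ V} ≤ ENNReal.ofReal s)
    (hδ0 : 0 ≤ δ) (hδ : 4 * ((windowCellsPlus n).card : ℝ) * δ < 1)
    (Typ : (Fin 4 → ℤ) → Set (LGConfig 4 G)) (hmeas : ∀ c, MeasurableSet (Typ c))
    (hdep : ∀ c, DependsOn (fun σ : LGConfig 4 G => σ ∈ Typ c) ↑(cellEdges (stdFrame b) c))
    (hI : RowClauseI ρ β (stdFrame b) n ε Typ)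
    (hanch' : ∀ c ∈ windowCellsPlus n,
      (wilsonMeasure (d := 4) (L := 2 * ((2 * n + 2) * b + 1) + 1) ρ β)
        {V | torusLift (2 * ((2 * n + 2) * b + 1) + 1) V ∉ Typ c} ≤ ENNReal.ofReal δ) : False := by
  classical
  have hA1 : 0 < A + 1 := by linarith
  have hm : (((2 * n + 1) * b : ℕ) : ℤ) = (2 * (n : ℤ) + 1) * b := by push_cast; ring
  set L : ℕ := 2 * ((2 * n + 2) * b + 1) + 1 with hL
  set μ := wilsonMeasure (d := 4) (L := L) ρ β with hμ
  haveI : IsProbabilityMeasure μ := isProbabilityMeasure_wilsonMeasure ρ hρ β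
  set Λ := rowRegion b n with hΛ
  set m : ℕ := (2 * n + 1) * b with hmdef
  set F : LGConfig 4 G → ℝ := loopObs ρ b m with hFdef
  set Fψ : LGConfig 4 G → ℝ := fun U => ψ (loopObs ρ b m U) with hFψdef
  set Ψ : GaugeConfig 4 L G → ℝ := fun V => ∫ U, F U ∂(ymSpecification ρ β Λ (torusLift L V)) with hΨ
  set Ψψ : GaugeConfig 4 L G → ℝ := fun V => ∫ U, Fψ U ∂(ymSpecification ρ β Λ (torusLift L V)) with hΨψ
  set Ψ' : GaugeConfig 4 L G → ℝ := twistedMeanObs ρ β b n κ ψ with hΨ'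
  set Ac : (Fin 4 → ℤ) → Set (GaugeConfig 4 L G) := fun c => {V | torusLift L V ∉ Typ c} with hAc
  set T : (Fin 4 → ℤ) → Set (GaugeConfig 4 L G) := fun c => {V | twistΦ b κ (torusLift L V) ∉ Typ c} with hTset
  have hμT : ∀ c ∈ windowCellsPlus n, μ (T c) ≤ ENNReal.ofReal δ := fun c hc =>
    (hT β Typ hmeas hdep c hc).trans (hanch' c hc)
  set B : Set (GaugeConfig 4 L G) := ⋃ c ∈ windowCellsPlus n, (Ac c ∪ T c) with hB
  have hμB : μ B ≤ ENNReal.ofReal (2 * ((windowCellsPlus n).card : ℝ) * δ) := by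
    calc μ B ≤ ∑ c ∈ windowCellsPlus n, μ (Ac c ∪ T c) := measure_biUnion_finset_le _ _
      _ ≤ ∑ c ∈ windowCellsPlus n, (ENNReal.ofReal δ + ENNReal.ofReal δ) :=
          Finset.sum_le_sum fun c hc =>
            (measure_union_le _ _).trans (add_le_add (hanch' c hc) (hμT c hc))
      _ = ENNReal.ofReal (2 * ((windowCellsPlus n).card : ℝ) * δ) := by
          rw [Finset.sum_const, nsmul_eq_mul, ← ENNReal.ofReal_add hδ0 hδ0, ← ENNReal.ofReal_natCast,
            ← ENNReal.ofReal_mul (Nat.cast_nonneg _)]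
          congr 1
          ring
  have hgood : ∀ V ∉ B, ∀ c ∈ windowCellsPlus n, c ∉ rowCells n →
      torusLift L V ∈ Typ c ∧ twistΦ b κ (torusLift L V) ∈ Typ c := by
    intro V hV c hc _
    simp only [hB, Set.mem_iUnion, Set.mem_union, not_exists, not_or] at hV
    have h := hV c hc
    exact ⟨of_not_not h.1, of_not_not h.2⟩
  have hF1 : ∀ U, |F U| ≤ 1 := abs_loopObs_le ρ hρu b _
  have hpair : ∀ V ∉ B, Ψψ V - Ψ' V ≤ 2 * ε := by
    intro V hV
    have hprop : Ψψ V = ∫ U, ψ (chargedTest ρ b m (torusLift L V) U).re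
        ∂(ymSpecification ρ β Λ (torusLift L V)) := integral_comp_loopObs_eq ρ hρ β hm hψ _
    have h2 := abs_integral_sub_le_of_rowClauseI ρ hρ hb hI (κ (torusLift L V))
      (u := fun U => ψ (chargedTest ρ b m (torusLift L V) U).re)
      (hψ.measurable.comp (Complex.measurable_re.comp (measurable_chargedTest ρ hρ b m _)))
      (fun U => hψ1 _ ((Complex.abs_re_le_norm _).trans (norm_chargedTest_le ρ hρu b m _ U)))
      (fun x y hxy => by
        show ψ (chargedTest ρ b m (torusLift L V) x).re = ψ (chargedTest ρ b m (torusLift L V) y).re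
        rw [chargedTest_isCylinder ρ hb m _ hxy])
      (torusLift L V) (hgood V hV)
    rw [hprop]
    exact (le_abs_self _).trans h2
  set C : Set (GaugeConfig 4 L G) := {V | v + s < Ψ' V} with hC
  have hμC : μ C ≤ ENNReal.ofReal s := hFat
  set D : Set (GaugeConfig 4 L G) := {V | s ≤ 1 - Ψψ V} with hD
  have hFψ1 : ∀ U, |Fψ U| ≤ 1 := fun U => hψ1 _ (hF1 U)
  have hΨ1 : ∀ V, |Ψ V| ≤ 1 := fun V => abs_integral_ymSpecification_le ρ hρ β Λ hF1 _
  have hΨψ1 : ∀ V, |Ψψ V| ≤ 1 := fun V => abs_integral_ymSpecification_le ρ hρ β Λ hFψ1 _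
  have hFψc : Continuous Fψ := hψ.comp (continuous_loopObs ρ hρ b _)
  have hΨm : Measurable Ψ :=
    ((continuous_integral_ymSpecification ρ hρ β Λ (continuous_loopObs ρ hρ b _) hF1).comp
      (continuous_torusLift L)).measurable
  have hΨψm : Measurable Ψψ :=
    ((continuous_integral_ymSpecification ρ hρ β Λ hFψc hFψ1).comp (continuous_torusLift L)).measurable
  have hΨi : Integrable Ψ μ :=
    (integrable_const (1 : ℝ)).mono' hΨm.aestronglyMeasurable
      (ae_of_all _ fun V => by simpa [Real.norm_eq_abs] using hΨ1 V)
  have hΨψi : Integrable Ψψ μ :=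
    (integrable_const (1 : ℝ)).mono' hΨψm.aestronglyMeasurable
      (ae_of_all _ fun V => by simpa [Real.norm_eq_abs] using hΨψ1 V)
  have h1Ψi : Integrable (fun V => 1 - Ψ V) μ := (integrable_const _).sub hΨi
  have h1Ψψi : Integrable (fun V => 1 - Ψψ V) μ := (integrable_const _).sub hΨψi
  have hdom : ∀ V, 1 - Ψψ V ≤ A * (1 - Ψ V) := by
    intro V
    haveI : IsProbabilityMeasure (ymSpecification ρ β Λ (torusLift L V)) :=
      isProbabilityMeasure_ymSpecification ρ hρ β _ _
    have hiF : Integrable F (ymSpecification ρ β Λ (torusLift L V)) :=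
      (integrable_const (1 : ℝ)).mono' (continuous_loopObs ρ hρ b _).measurable.aestronglyMeasurable
        (ae_of_all _ fun U => by simpa [Real.norm_eq_abs] using hF1 U)
    have hiFψ : Integrable Fψ (ymSpecification ρ β Λ (torusLift L V)) :=
      (integrable_const (1 : ℝ)).mono' hFψc.measurable.aestronglyMeasurable
        (ae_of_all _ fun U => by simpa [Real.norm_eq_abs] using hFψ1 U)
    have e1 : ∫ U, (1 - Fψ U) ∂(ymSpecification ρ β Λ (torusLift L V)) =
        1 - ∫ U, Fψ U ∂(ymSpecification ρ β Λ (torusLift L V)) := by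
      rw [integral_sub (integrable_const _) hiFψ, integral_const]
      simp only [Measure.real, measure_univ, ENNReal.toReal_one, smul_eq_mul, one_mul]
    have e2 : ∫ U, A * (1 - F U) ∂(ymSpecification ρ β Λ (torusLift L V)) =
        A * (1 - ∫ U, F U ∂(ymSpecification ρ β Λ (torusLift L V))) := by
      rw [integral_const_mul, integral_sub (integrable_const _) hiF, integral_const]
      simp only [Measure.real, measure_univ, ENNReal.toReal_one, smul_eq_mul, one_mul]
    have key : ∫ U, (1 - Fψ U) ∂(ymSpecification ρ β Λ (torusLift L V)) ≤
        ∫ U, A * (1 - F U) ∂(ymSpecification ρ β Λ (torusLift L V)) :=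
      integral_mono ((integrable_const _).sub hiFψ) (((integrable_const _).sub hiF).const_mul A)
        fun U => hψA _ (abs_le.1 (hF1 U)).2
    rw [e1, e2] at key
    exact key
  have hfreeze : 1 - s * s / (A + 1) ≤ ∫ V, F (torusLift L V) ∂μ := hfreeze0
  have hDLR : ∫ V, F (torusLift L V) ∂μ = ∫ V, Ψ V ∂μ := integral_loopObs_torus ρ hρ hρu β hm
  have hE : ∫ V, (1 - Ψ V) ∂μ ≤ s * s / (A + 1) := by
    rw [integral_sub (integrable_const _) hΨi, integral_const]
    simp only [Measure.real, measure_univ, ENNReal.toReal_one, smul_eq_mul, one_mul]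
    linarith
  have hEψ : ∫ V, (1 - Ψψ V) ∂μ ≤ s * s := by
    have h3 : A * (s * s / (A + 1)) ≤ s * s := by
      rw [mul_div_assoc', div_le_iff₀ hA1]
      nlinarith [mul_pos hs0 hs0]
    calc ∫ V, (1 - Ψψ V) ∂μ ≤ ∫ V, A * (1 - Ψ V) ∂μ := integral_mono h1Ψψi (h1Ψi.const_mul A) hdom
      _ = A * ∫ V, (1 - Ψ V) ∂μ := integral_const_mul _ _
      _ ≤ A * (s * s / (A + 1)) := mul_le_mul_of_nonneg_left hE hA
      _ ≤ s * s := h3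
  have hMarkov : s * μ.real D ≤ ∫ V, (1 - Ψψ V) ∂μ :=
    mul_meas_ge_le_integral_of_nonneg (ae_of_all _ fun V => by
      have := (abs_le.1 (hΨψ1 V)).2; show (0 : ℝ) ≤ 1 - Ψψ V; linarith) h1Ψψi s
  have hμD : μ.real D ≤ s := by
    have : s * μ.real D ≤ s * s := hMarkov.trans hEψ
    exact le_of_mul_le_mul_left this hs0
  have hμB' : μ.real B ≤ 2 * ((windowCellsPlus n).card : ℝ) * δ :=
    ENNReal.toReal_le_of_le_ofReal (by positivity) hμB
  have hμC' : μ.real C ≤ s := ENNReal.toReal_le_of_le_ofReal hs0.le hμC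
  have hcover : μ.real (B ∪ C ∪ D) < 1 := by
    calc μ.real (B ∪ C ∪ D) ≤ μ.real (B ∪ C) + μ.real D := measureReal_union_le _ _
      _ ≤ μ.real B + μ.real C + μ.real D := by
          have := measureReal_union_le (μ := μ) B C; linarith
      _ < 1 := by nlinarith
  have hex : ∃ V, V ∉ B ∪ C ∪ D := by
    by_contra hne
    push Not at hne
    have huniv : B ∪ C ∪ D = Set.univ := Set.eq_univ_of_forall hne
    rw [huniv] at hcover
    simp [Measure.real] at hcover
  obtain ⟨V, hV⟩ := hex
  simp only [Set.mem_union, not_or] at hV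
  obtain ⟨⟨hVB, hVC⟩, hVD⟩ := hV
  have h1 : Ψψ V - Ψ' V ≤ 2 * ε := hpair V hVB
  have h2 : Ψ' V ≤ v + s := not_lt.1 hVC
  have h3 : 1 - Ψψ V < s := not_le.1 hVD
  linarith

end Core

section Poly

open Literature.MathematicalPhysics.QuantumFieldTheory (wilsonMeasure GaugeConfig isProbabilityMeasure_wilsonMeasure)

variable {G : Type} [Group G] [TopologicalSpace G] [IsTopologicalGroup G] [CompactSpace G]
  [SecondCountableTopology G] [MeasurableSpace G] [BorelSpace G]
  {N : ℕ} (ρ : G →* Matrix (Fin N) (Fin N) ℂ)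

def clip (r t : ℝ) : ℝ := max (-1) (min 1 (2 * (t - r) / (1 - r) - 1))

omit [TopologicalSpace G] [IsTopologicalGroup G] [CompactSpace G] [SecondCountableTopology G] [MeasurableSpace G]
  [BorelSpace G] in
theorem continuous_clip (r : ℝ) : Continuous (clip r) := by
  unfold clip
  exact continuous_const.max (continuous_const.min
    (((continuous_const.mul (continuous_id.sub continuous_const)).div_const _).sub continuous_const))

theorem abs_clip_le (r t : ℝ) : |clip r t| ≤ 1 :=
  abs_le.2 ⟨le_max_left _ _, max_le (by norm_num) (min_le_left _ _)⟩

theorem one_sub_clip_le {r : ℝ} (hr : r < 1) (t : ℝ) (ht : t ≤ 1) :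
    1 - clip r t ≤ 2 / (1 - r) * (1 - t) := by
  have h1r : 0 < 1 - r := by linarith
  unfold clip
  have hφ : 1 - (2 * (t - r) / (1 - r) - 1) = 2 / (1 - r) * (1 - t) := by
    field_simp
    ring
  have hmin : min 1 (2 * (t - r) / (1 - r) - 1) ≤ max (-1) (min 1 (2 * (t - r) / (1 - r) - 1)) :=
    le_max_right _ _
  rcases le_total 1 (2 * (t - r) / (1 - r) - 1) with h | h
  · rw [min_eq_left h] at hmin ⊢
    have : 0 ≤ 2 / (1 - r) * (1 - t) := mul_nonneg (div_nonneg (by norm_num) h1r.le) (by linarith)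
    linarith
  · rw [min_eq_right h] at hmin ⊢
    linarith

def polyRegime (θ c β₀ : ℝ) (P : ℝ → ℕ → Prop) : Prop :=
  ∀ β : ℝ, β₀ ≤ β → ∀ b : ℕ, 1 ≤ b → (b : ℝ) ≤ c * (β / Real.log β) ^ θ → P β b

omit [TopologicalSpace G] [IsTopologicalGroup G] [CompactSpace G] [SecondCountableTopology G] [MeasurableSpace G]
  [BorelSpace G] in
theorem polyRegime_mono_threshold {θ c β₀ β₀' : ℝ} (hβ : β₀ ≤ β₀') {P : ℝ → ℕ → Prop}
    (h : polyRegime θ c β₀ P) : polyRegime θ c β₀' P :=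
  fun β hβ' b hb hbc => h β (hβ.trans hβ') b hb hbc

omit [TopologicalSpace G] [IsTopologicalGroup G] [CompactSpace G] [SecondCountableTopology G] [MeasurableSpace G]
  [BorelSpace G] in
theorem polyRegime_mono_exponent {θ θ' c β₀ : ℝ} (hθ : θ' ≤ θ) (hc : 0 ≤ c) (hβ₀ : 3 ≤ β₀)
    {P : ℝ → ℕ → Prop} (h : polyRegime θ c β₀ P) : polyRegime θ' c β₀ P := by
  intro β hβ b hb hbc
  refine h β hβ b hb (hbc.trans (mul_le_mul_of_nonneg_left ?_ hc))
  have hβ3 : (3 : ℝ) ≤ β := hβ₀.trans hβ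
  have hβ0 : (0 : ℝ) < β := by linarith
  have hlogpos : 0 < Real.log β := Real.log_pos (by linarith)
  have h1 : 1 ≤ β / Real.log β := by
    rw [le_div_iff₀ hlogpos, one_mul]
    have := Real.log_le_sub_one_of_pos hβ0
    linarith
  exact Real.rpow_le_rpow_of_exponent_le h1 hθ

def LoopFreezingPoly (n : ℕ) (θ : ℝ) : Prop :=
  ∀ η : ℝ, 0 < η → ∃ c : ℝ, 0 < c ∧ ∃ β₀ : ℝ, polyRegime θ c β₀ fun β b =>
    1 - η ≤ ∫ V, loopObs ρ b ((2 * n + 1) * b) (torusLift (2 * ((2 * n + 2) * b + 1) + 1) V)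
      ∂(wilsonMeasure (d := 4) (L := 2 * ((2 * n + 2) * b + 1) + 1) ρ β)

def FrameValuePoly (n : ℕ) (k₀ : G) (θ : ℝ) : Prop :=
  ∀ η : ℝ, 0 < η → ∃ c : ℝ, 0 < c ∧ ∃ β₀ : ℝ, polyRegime θ c β₀ fun β b =>
    (wilsonMeasure (d := 4) (L := 2 * ((2 * n + 2) * b + 1) + 1) ρ β)
        {V | -1 + η < twistedMeanObs ρ β b n (comb b ((2 * n + 2) * b + 1) k₀)
          (clip ((ρ k₀).trace.re / N)) V} ≤ ENNReal.ofReal η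

def RowFloorPoly (n : ℕ) (ε δ θ : ℝ) : Prop :=
  ∃ c : ℝ, 0 < c ∧ ∃ β₀ : ℝ, polyRegime θ c β₀ fun β b => ¬ TypShellCond ρ β b n ε δ

omit [SecondCountableTopology G] in
theorem loopFreezingPoly_mono {n : ℕ} {θ θ' : ℝ} (hθ : θ' ≤ θ) (h : LoopFreezingPoly ρ n θ) :
    LoopFreezingPoly ρ n θ' := by
  intro η hη
  obtain ⟨c, hc, β₀, h⟩ := h η hη
  exact ⟨c, hc, max β₀ 3, polyRegime_mono_exponent hθ hc.le (le_max_right _ _)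
    (polyRegime_mono_threshold (le_max_left _ _) h)⟩

theorem rowFloorPoly_of_inputs (hρ : Continuous ρ) (hρi : Function.Injective ρ)
    (hρu : ∀ g, ρ g ∈ Matrix.unitaryGroup (Fin N) ℂ) (hN : 1 ≤ N) {k₀ : G} (hk₀ : k₀ ≠ 1)
    (n : ℕ) {ε δ : ℝ} (hε : ε < 1) (hδ0 : 0 ≤ δ) (hδ : 4 * ((windowCellsPlus n).card : ℝ) * δ < 1)
    {θ : ℝ} (hFr : LoopFreezingPoly ρ n θ) (hF : FrameValuePoly ρ n k₀ θ) :
    RowFloorPoly ρ n ε δ θ := by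
  obtain ⟨r, hrdef⟩ : ∃ r : ℝ, (ρ k₀).trace.re / N = r := ⟨_, rfl⟩
  have hr : r < 1 := hrdef ▸ re_trace_div_lt_one ρ hρi hρu hN hk₀
  have h1r : 0 < 1 - r := by linarith
  set s : ℝ := min ((1 - (-1) - 2 * ε) / 4) (1 / 8) with hs
  have hs0 : 0 < s := lt_min (by linarith) (by norm_num)
  have hs8 : s ≤ 1 / 8 := min_le_right _ _
  have hs4 : s ≤ (1 - (-1) - 2 * ε) / 4 := min_le_left _ _
  have hA0 : 0 ≤ 2 / (1 - r) := div_nonneg (by norm_num) h1r.le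
  have hA1 : 0 < 2 / (1 - r) + 1 := by linarith
  have hss : 0 < s * s / (2 / (1 - r) + 1) := div_pos (mul_pos hs0 hs0) hA1
  obtain ⟨c₁, hc₁, β₁, h₁⟩ := hFr (s * s / (2 / (1 - r) + 1)) hss
  obtain ⟨c₂, hc₂, β₂, h₂⟩ := hF s hs0
  refine ⟨min c₁ c₂, lt_min hc₁ hc₂, max (max β₁ β₂) 1, ?_⟩
  intro β hβ b hb hbc
  have hβ1 : β₁ ≤ β := ((le_max_left _ _).trans (le_max_left _ _)).trans hβ
  have hβ2 : β₂ ≤ β := ((le_max_right _ _).trans (le_max_left _ _)).trans hβ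
  have hβone : (1 : ℝ) ≤ β := (le_max_right _ _).trans hβ
  have hx : 0 ≤ (β / Real.log β) ^ θ :=
    Real.rpow_nonneg (div_nonneg (by linarith) (Real.log_nonneg hβone)) θ
  have hb1 : (b : ℝ) ≤ c₁ * (β / Real.log β) ^ θ :=
    hbc.trans (mul_le_mul_of_nonneg_right (min_le_left _ _) hx)
  have hb2 : (b : ℝ) ≤ c₂ * (β / Real.log β) ^ θ :=
    hbc.trans (mul_le_mul_of_nonneg_right (min_le_right _ _) hx)
  have hfreeze0 := h₁ β hβ1 b hb hb1
  have hFat := h₂ β hβ2 b hb hb2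
  simp only [hrdef] at hFat
  intro hTyp
  obtain ⟨Typ, hmeas, hdep, hI, hanch⟩ := clauseI_of_typShellCond hTyp
  exact frame_core_at ρ hρ hρu hb n (comb b ((2 * n + 2) * b + 1) k₀) (continuous_clip r)
    (fun t _ => abs_clip_le r t) hA0 (one_sub_clip_le hr) (topTwistTransfer_comb ρ hb n k₀) hs0 hs8 hs4
    hfreeze0 hFat hδ0 hδ Typ hmeas hdep (rowClauseI_of_clauseI hI) fun c' hc' =>
    hanch ((2 * n + 2) * b + 1) (by nlinarith) c' (stdFrame_windowCellsPlus_bounds hc')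

omit [SecondCountableTopology G] in
theorem typFloor_of_rowFloorPoly {n : ℕ} {ε δ θ : ℝ} (h : RowFloorPoly ρ n ε δ θ) :
    ∃ c : ℝ, 0 < c ∧ ∃ β₀ : ℝ, ∀ β : ℝ, β₀ ≤ β → ∀ b : ℕ, 1 ≤ b → TypShellCond ρ β b n ε δ →
      c * (β / Real.log β) ^ θ < b := by
  obtain ⟨c, hc, β₀, h⟩ := h
  exact ⟨c, hc, β₀, fun β hβ b hb hT => lt_of_not_ge fun hle => h β hβ b hb hle hT⟩

omit [SecondCountableTopology G] in
theorem ukpcFloor_of_rowFloorPoly {n : ℕ} {ε δ θ : ℝ} (h : RowFloorPoly ρ n ε δ θ) :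
    ∃ c : ℝ, 0 < c ∧ ∃ β₀ : ℝ, ∀ β : ℝ, β₀ ≤ β → ∀ b : ℕ, 1 ≤ b →
      AfPincerUc.TypShellCondUKPc ρ β b n ε δ → c * (β / Real.log β) ^ θ < b := by
  obtain ⟨c, hc, β₀, h⟩ := typFloor_of_rowFloorPoly ρ h
  exact ⟨c, hc, β₀, fun β hβ b hb hU => h β hβ b hb (AfPincerUc.typShellCond_of_UKPc hU)⟩

omit [SecondCountableTopology G] in
theorem mixOnsetUc_floor_of_rowFloorPoly {n : ℕ} {ε δ θ : ℝ} (h : RowFloorPoly ρ n ε δ θ) :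
    ∃ c : ℝ, 0 < c ∧ ∃ β₀ : ℝ, ∀ β : ℝ, β₀ ≤ β →
      (AfPincerUc.fmtSet (fun β' b => AfPincerUc.TypShellCondUKPc ρ β' b n ε δ) β).Nonempty →
        c * (β / Real.log β) ^ θ < AfPincerUc.mixOnsetUc ρ β n ε δ := by
  obtain ⟨c, hc, β₀, h⟩ := ukpcFloor_of_rowFloorPoly ρ h
  refine ⟨c, hc, β₀, fun β hβ hne => ?_⟩
  have hmem := Nat.sInf_mem hne
  exact h β hβ _ hmem.1 hmem.2

end Poly

section Hygiene

theorem tendsto_div_log_atTop' : Tendsto (fun β : ℝ => β / Real.log β) atTop atTop := by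
  have h0 : Tendsto (fun β : ℝ => Real.log β / β) atTop (𝓝 0) := by
    have := Real.tendsto_pow_log_div_mul_add_atTop 1 0 1 one_ne_zero
    simpa using this
  have hpos : ∀ᶠ β : ℝ in atTop, 0 < Real.log β / β := by
    filter_upwards [eventually_gt_atTop 1] with β hβ
    exact div_pos (Real.log_pos hβ) (by linarith)
  have h1 : Tendsto (fun β : ℝ => Real.log β / β) atTop (𝓝[>] 0) :=
    tendsto_nhdsWithin_iff.2 ⟨h0, hpos.mono fun β hβ => hβ⟩
  have h2 := tendsto_inv_nhdsGT_zero.comp h1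
  refine h2.congr' ?_
  filter_upwards with β
  simp [inv_div]

theorem polyRegime_eventually_ge {θ c : ℝ} (hθ : 0 < θ) (hc : 0 < c) (B : ℝ) :
    ∃ β₂ : ℝ, ∀ β : ℝ, β₂ ≤ β → B ≤ c * (β / Real.log β) ^ θ := by
  have h := ((tendsto_rpow_atTop hθ).comp tendsto_div_log_atTop').const_mul_atTop hc
  obtain ⟨β₂, hβ₂⟩ := Filter.eventually_atTop.1 (h.eventually_ge_atTop B)
  exact ⟨β₂, fun β hβ => by simpa using hβ₂ β hβ⟩

variable {G : Type} [Group G] [TopologicalSpace G] [IsTopologicalGroup G] [CompactSpace G]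
  [MeasurableSpace G] [BorelSpace G] {N : ℕ} (ρ : G →* Matrix (Fin N) (Fin N) ℂ)

theorem fixedMesh_of_rowFloorPoly {n : ℕ} {ε δ θ : ℝ} (hθ : 0 < θ) (h : RowFloorPoly ρ n ε δ θ) (b : ℕ)
    (hb : 1 ≤ b) : ∃ β₂ : ℝ, ∀ β : ℝ, β₂ ≤ β → ¬ TypShellCond ρ β b n ε δ := by
  obtain ⟨c, hc, β₀, hreg⟩ := h
  obtain ⟨β₂, hβ₂⟩ := polyRegime_eventually_ge hθ hc (b : ℝ)
  exact ⟨max β₀ β₂, fun β hβ =>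
    hreg β ((le_max_left _ _).trans hβ) b hb (hβ₂ β ((le_max_right _ _).trans hβ))⟩

end Hygiene

section QuantStokes

variable {G : Type} [Group G] {N : ℕ} (ρ : G →* Matrix (Fin N) (Fin N) ℂ)

def plaq (U : LGConfig 4 G) (t s : ℤ) : G := plaquetteHolonomyZd U (site2 t s) 0 1

def stripHol (U : LGConfig 4 G) (M A : ℕ) : G :=
  upT U M A * U (site2 (A : ℤ) M, 1) * (upT U ((M : ℤ) + 1) A)⁻¹ * (U (site2 0 (M : ℤ), 1))⁻¹

def rectHol (U : LGConfig 4 G) (A M : ℕ) : G :=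
  upT U 0 A * rightT U (A : ℤ) M * (upT U (M : ℤ) A)⁻¹ * (rightT U 0 M)⁻¹

theorem link_eq_of_plaq (U : LGConfig 4 G) (t s : ℤ) :
    U (site2 (t + 1) s, 1) = (U (site2 t s, 0))⁻¹ * plaq U t s * U (site2 t s, 1) * U (site2 t (s + 1), 0) := by
  rw [plaq, plaquetteHolonomyZd, site2_add_single_zero, site2_add_single_one]
  group

@[simp] theorem stripHol_zero (U : LGConfig 4 G) (M : ℕ) : stripHol U M 0 = 1 := by
  simp [stripHol]

theorem stripHol_succ (U : LGConfig 4 G) (M A : ℕ) :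
    stripHol U M (A + 1) = (upT U M A * plaq U A M * (upT U M A)⁻¹) * stripHol U M A := by
  simp only [stripHol]
  rw [upT_succ, upT_succ]
  push_cast
  rw [link_eq_of_plaq U (A : ℤ) (M : ℤ)]
  group

@[simp] theorem rectHol_zero (U : LGConfig 4 G) (A : ℕ) : rectHol U A 0 = 1 := by
  simp [rectHol]

theorem rectHol_succ (U : LGConfig 4 G) (A M : ℕ) :
    rectHol U A (M + 1) = rectHol U A M * (rightT U 0 M * stripHol U M A * (rightT U 0 M)⁻¹) := by
  simp only [rectHol, stripHol]
  rw [rightT_succ, rightT_succ]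
  push_cast
  group

theorem col_mul_staple_eq_conj_rectHol {b : ℕ} (hb : 1 ≤ b) (m : ℕ) (U : LGConfig 4 G) :
    col b U * staple b m U = (U (site2 0 0, 0))⁻¹ * rectHol U (b + 1) m * U (site2 0 0, 0) := by
  have hcol : col b U = (U (site2 0 0, 0))⁻¹ * upT U 0 (b + 1) := by
    rw [← mul_col_eq_upT hb U]; group
  rw [hcol, staple_eq_transport, rectHol]
  push_cast
  group

end QuantStokes

section Frobenius

open scoped Matrix Matrix.Norms.Frobenius

variable {G : Type} [Group G] {N : ℕ} (ρ : G →* Matrix (Fin N) (Fin N) ℂ)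

theorem norm_map_mul_sub_one_le (hρu : ∀ g, ρ g ∈ Matrix.unitaryGroup (Fin N) ℂ) (g h : G) :
    ‖ρ (g * h) - 1‖ ≤ ‖ρ g - 1‖ + ‖ρ h - 1‖ := by
  have hsplit : ρ (g * h) - 1 = ρ g * (ρ h - 1) + (ρ g - 1) := by rw [map_mul]; noncomm_ring
  rw [hsplit]
  refine (norm_add_le _ _).trans ?_
  rw [Matrix.frobenius_norm_unitaryGroup_mul ⟨ρ g, hρu g⟩ (ρ h - 1)]
  linarith

theorem norm_map_inv_sub_one (hρu : ∀ g, ρ g ∈ Matrix.unitaryGroup (Fin N) ℂ) (g : G) :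
    ‖ρ g⁻¹ - 1‖ = ‖ρ g - 1‖ := by
  have h : ρ g⁻¹ - 1 = ρ g⁻¹ * (1 - ρ g) := by
    rw [mul_sub, mul_one, ← map_mul, inv_mul_cancel, map_one]
  rw [h, Matrix.frobenius_norm_unitaryGroup_mul ⟨ρ g⁻¹, hρu g⁻¹⟩, norm_sub_rev]

theorem norm_map_conj_sub_one (hρu : ∀ g, ρ g ∈ Matrix.unitaryGroup (Fin N) ℂ) (k g : G) :
    ‖ρ (k * g * k⁻¹) - 1‖ = ‖ρ g - 1‖ := by
  have h : ρ (k * g * k⁻¹) - 1 = ρ k * (ρ g - 1) * ρ k⁻¹ := by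
    rw [map_mul, map_mul, mul_sub, sub_mul, mul_one, mul_assoc (ρ k) (ρ g), ← map_mul, ← map_mul,
      ← map_mul, mul_inv_cancel, map_one]
  rw [h, Matrix.frobenius_norm_mul_unitaryGroup _ ⟨ρ k⁻¹, hρu k⁻¹⟩,
    Matrix.frobenius_norm_unitaryGroup_mul ⟨ρ k, hρu k⟩]

theorem norm_stripHol_sub_one_le (hρu : ∀ g, ρ g ∈ Matrix.unitaryGroup (Fin N) ℂ) (U : LGConfig 4 G)
    (M : ℕ) : ∀ A : ℕ,
    ‖ρ (stripHol U M A) - 1‖ ≤ ∑ t ∈ Finset.range A, ‖ρ (plaq U t M) - 1‖ := by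
  intro A
  induction A with
  | zero => simp
  | succ A ih =>
    rw [stripHol_succ, Finset.sum_range_succ]
    refine (norm_map_mul_sub_one_le ρ hρu _ _).trans ?_
    rw [norm_map_conj_sub_one ρ hρu]
    linarith

theorem norm_rectHol_sub_one_le (hρu : ∀ g, ρ g ∈ Matrix.unitaryGroup (Fin N) ℂ) (U : LGConfig 4 G)
    (A : ℕ) : ∀ M : ℕ,
    ‖ρ (rectHol U A M) - 1‖ ≤ ∑ s ∈ Finset.range M, ∑ t ∈ Finset.range A, ‖ρ (plaq U t s) - 1‖ := by
  intro M
  induction M with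
  | zero => simp
  | succ M ih =>
    rw [rectHol_succ, Finset.sum_range_succ]
    refine (norm_map_mul_sub_one_le ρ hρu _ _).trans ?_
    rw [norm_map_conj_sub_one ρ hρu]
    have := norm_stripHol_sub_one_le ρ hρu U M A
    linarith

theorem sub_re_trace_eq_norm_sq (hρu : ∀ g, ρ g ∈ Matrix.unitaryGroup (Fin N) ℂ) (g : G) :
    (N : ℝ) - (ρ g).trace.re = ‖ρ g - 1‖ ^ 2 / 2 := by
  have hU : (ρ g)ᴴ * ρ g = 1 := Matrix.mem_unitaryGroup_iff'.1 (hρu g)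
  have h1 : ‖ρ g - 1‖ ^ 2 = RCLike.re (Matrix.trace ((ρ g - 1)ᴴ * (ρ g - 1))) :=
    Matrix.frobenius_norm_sq_eq_re_trace _
  have h2 : (ρ g - 1)ᴴ * (ρ g - 1) = 2 • (1 : Matrix (Fin N) (Fin N) ℂ) - ρ g - (ρ g)ᴴ := by
    rw [Matrix.conjTranspose_sub, Matrix.conjTranspose_one, sub_mul, mul_sub, mul_sub, hU, one_mul,
      mul_one, one_mul, two_smul]
    abel
  rw [h1, h2]
  simp only [Matrix.trace_sub, Matrix.trace_smul, Matrix.trace_one, Fintype.card_fin, map_sub,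
    Matrix.trace_conjTranspose, RCLike.star_def, RCLike.conj_re]
  simp only [RCLike.re_to_complex, nsmul_eq_mul, Complex.mul_re]
  norm_num
  ring

theorem one_sub_loopObs_le (hρu : ∀ g, ρ g ∈ Matrix.unitaryGroup (Fin N) ℂ) (hN : 1 ≤ N) {b : ℕ}
    (hb : 1 ≤ b) (m : ℕ) (U : LGConfig 4 G) :
    1 - loopObs ρ b m U ≤ ((b + 1 : ℕ) * m / N : ℝ) *
      ∑ s ∈ Finset.range m, ∑ t ∈ Finset.range (b + 1), ((N : ℝ) - (ρ (plaq U t s)).trace.re) := by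
  have hN0 : (0 : ℝ) < N := by exact_mod_cast hN
  have hloop : loopObs ρ b m U = (ρ (col b U * staple b m U)).trace.re / N := by
    simp [loopObs, chargedTest, Complex.div_natCast_re]
  have hdef : 1 - loopObs ρ b m U = ‖ρ (col b U * staple b m U) - 1‖ ^ 2 / 2 / N := by
    rw [hloop, ← sub_re_trace_eq_norm_sq ρ hρu]
    field_simp
  have hconj : ‖ρ (col b U * staple b m U) - 1‖ = ‖ρ (rectHol U (b + 1) m) - 1‖ := by
    rw [col_mul_staple_eq_conj_rectHol hb m U]
    have := norm_map_conj_sub_one ρ hρu (U (site2 0 0, 0))⁻¹ (rectHol U (b + 1) m)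
    rwa [inv_inv] at this
  set D : ℝ := ∑ s ∈ Finset.range m, ∑ t ∈ Finset.range (b + 1), ‖ρ (plaq U t s) - 1‖ with hD
  have hnorm : ‖ρ (col b U * staple b m U) - 1‖ ≤ D := hconj ▸ norm_rectHol_sub_one_le ρ hρu U (b + 1) m
  have hCS : D ^ 2 ≤ ((b + 1 : ℕ) * m : ℝ) *
      ∑ s ∈ Finset.range m, ∑ t ∈ Finset.range (b + 1), ‖ρ (plaq U t s) - 1‖ ^ 2 := by
    have h := sq_sum_le_card_mul_sum_sq (s := Finset.range m ×ˢ Finset.range (b + 1))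
      (f := fun p : ℕ × ℕ => ‖ρ (plaq U p.2 p.1) - 1‖)
    rw [Finset.sum_product, Finset.sum_product, Finset.card_product, Finset.card_range,
      Finset.card_range] at h
    push_cast at h ⊢
    rw [hD]
    linarith
  have hsq : ∑ s ∈ Finset.range m, ∑ t ∈ Finset.range (b + 1), ‖ρ (plaq U t s) - 1‖ ^ 2 =
      2 * ∑ s ∈ Finset.range m, ∑ t ∈ Finset.range (b + 1), ((N : ℝ) - (ρ (plaq U t s)).trace.re) := by
    rw [Finset.mul_sum]
    refine Finset.sum_congr rfl fun s _ => ?_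
    rw [Finset.mul_sum]
    refine Finset.sum_congr rfl fun t _ => ?_
    rw [sub_re_trace_eq_norm_sq ρ hρu]
    ring
  rw [hdef]
  have h0 : 0 ≤ ‖ρ (col b U * staple b m U) - 1‖ := norm_nonneg _
  have h1 : ‖ρ (col b U * staple b m U) - 1‖ ^ 2 ≤ D ^ 2 := pow_le_pow_left₀ h0 hnorm 2
  rw [hsq] at hCS
  have h2 : ‖ρ (col b U * staple b m U) - 1‖ ^ 2 / 2 / N ≤ D ^ 2 / 2 / N := by
    gcongr
  refine h2.trans ?_
  rw [div_div, div_le_iff₀ (by positivity)]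
  have hN1 : (N : ℝ) ≠ 0 := hN0.ne'
  calc D ^ 2 ≤ _ := hCS
    _ = _ := by field_simp

end Frobenius

section FreezeAssembly

open Literature.MathematicalPhysics.QuantumFieldTheory (wilsonMeasure GaugeConfig isProbabilityMeasure_wilsonMeasure
  LatticeRep plaquetteCost Plaquette)
open Summit.QuantumFields.YangMills.Theorems.TunedSequenceExists.Negative.Freezing (plaquetteHolonomyZd_torusLift')

variable {G : Type} [Group G] [TopologicalSpace G] [IsTopologicalGroup G] [CompactSpace G]
  [SecondCountableTopology G] [MeasurableSpace G] [BorelSpace G]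
  {N : ℕ} (ρ : G →* Matrix (Fin N) (Fin N) ℂ)

def torusPlaq (L : ℕ) (t s : ℤ) : Plaquette 4 L :=
  (Torus.proj L (site2 t s), ⟨((0 : Fin 4), (1 : Fin 4)), by decide⟩)

omit [TopologicalSpace G] [IsTopologicalGroup G] [CompactSpace G] [SecondCountableTopology G] [MeasurableSpace G]
  [BorelSpace G] in
theorem plaqCost_torusLift (L : ℕ) (V : GaugeConfig 4 L G) (t s : ℤ) :
    (N : ℝ) - (ρ (plaq (torusLift L V) t s)).trace.re = plaquetteCost ρ V (torusPlaq L t s) := by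
  simp only [plaq, plaquetteHolonomyZd_torusLift', plaquetteCost, torusPlaq]

theorem one_sub_integral_loopObs_le (hρ : Continuous ρ) (hρi : Function.Injective ρ)
    (hρu : ∀ g, ρ g ∈ Matrix.unitaryGroup (Fin N) ℂ) (hN : 1 ≤ N) :
    ∃ K : ℝ, 0 ≤ K ∧ ∀ (L : ℕ), 1 ≤ L → ∀ β : ℝ, 1 ≤ β → ∀ {b : ℕ}, 1 ≤ b → ∀ m : ℕ,
      1 - ∫ V, loopObs ρ b m (torusLift (2 * L + 1) V) ∂(wilsonMeasure (d := 4) (L := 2 * L + 1) ρ β) ≤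
        ((b + 1 : ℕ) * m : ℝ) ^ 2 / N * (K * (1 + Real.log β) / β) := by
  set r : LatticeRep G := ⟨N, ρ, hρ, hρi, hρu⟩ with hr
  obtain ⟨K, hK0, hmom⟩ := AfOnset.exists_plaquetteCost_moments_le r
  refine ⟨K, hK0, fun L hL β hβ b hb m => ?_⟩
  set S : ℕ := 2 * L + 1 with hS
  set μ := wilsonMeasure (d := 4) (L := S) ρ β with hμ
  haveI : IsProbabilityMeasure μ := isProbabilityMeasure_wilsonMeasure ρ hρ β
  have hN0 : (0 : ℝ) < N := by exact_mod_cast hN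
  set φ : ℤ → ℤ → GaugeConfig 4 S G → ℝ := fun t s V => (N : ℝ) - (ρ (plaq (torusLift S V) t s)).trace.re with hφ
  have hφcont : ∀ t s, Continuous (φ t s) := by
    intro t s
    simp only [hφ, plaq]
    exact continuous_const.sub ((continuous_plaquetteObs ρ hρ (site2 t s) 0 1).comp (continuous_torusLift S))
  have hφint : ∀ t s, Integrable (φ t s) μ := by
    intro t s
    refine Integrable.of_bound (hφcont t s).measurable.aestronglyMeasurable (2 * N) (ae_of_all _ fun V => ?_)
    have h := abs_le.1 (abs_plaquetteObs_le_holds ρ hρu (site2 t s) 0 1 (torusLift S V))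
    simp only [hφ, plaq, Real.norm_eq_abs]
    rw [abs_le]
    simp only [plaquetteObs] at h
    constructor <;> linarith [h.1, h.2]
  have hφmean : ∀ t s, ∫ V, φ t s V ∂μ ≤ K * (1 + Real.log β) / β := by
    intro t s
    have h := (hmom L hL β hβ (torusPlaq S t s)).1
    have heq : ∫ V, φ t s V ∂μ = ∫ V, plaquetteCost r.ρ V (torusPlaq S t s) ∂μ :=
      integral_congr_ae (ae_of_all _ fun V => plaqCost_torusLift ρ S V t s)
    rw [heq]
    exact h
  have hWint : Integrable (fun V : GaugeConfig 4 S G => loopObs ρ b m (torusLift S V)) μ := by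
    refine Integrable.of_bound
      (((continuous_loopObs ρ hρ b m).comp (continuous_torusLift S)).measurable.aestronglyMeasurable) 1
      (ae_of_all _ fun V => ?_)
    rw [Real.norm_eq_abs]
    exact abs_loopObs_le ρ hρu b m _
  set A : ℝ := ((b + 1 : ℕ) * m : ℝ) with hA
  have hpt : ∀ V : GaugeConfig 4 S G, 1 - loopObs ρ b m (torusLift S V) ≤
      A / N * ∑ s ∈ Finset.range m, ∑ t ∈ Finset.range (b + 1), φ t s V := by
    intro V
    have h := one_sub_loopObs_le ρ hρu hN hb m (torusLift S V)
    simpa [hφ, hA] using h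
  have hsumint : Integrable (fun V => A / N * ∑ s ∈ Finset.range m, ∑ t ∈ Finset.range (b + 1), φ t s V) μ := by
    refine Integrable.const_mul ?_ _
    refine integrable_finsetSum (Finset.range m) fun s _ => ?_
    exact integrable_finsetSum (Finset.range (b + 1)) fun t _ => hφint t s
  have h1 : 1 - ∫ V, loopObs ρ b m (torusLift S V) ∂μ = ∫ V, (1 - loopObs ρ b m (torusLift S V)) ∂μ := by
    rw [integral_sub (integrable_const _) hWint, integral_const, smul_eq_mul, mul_one]
    simp
  rw [h1]
  calc ∫ V, (1 - loopObs ρ b m (torusLift S V)) ∂μ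
      ≤ ∫ V, A / N * ∑ s ∈ Finset.range m, ∑ t ∈ Finset.range (b + 1), φ t s V ∂μ :=
        integral_mono ((integrable_const _).sub hWint) hsumint hpt
    _ = A / N * ∑ s ∈ Finset.range m, ∑ t ∈ Finset.range (b + 1), ∫ V, φ t s V ∂μ := by
        rw [integral_const_mul]
        congr 1
        rw [integral_finsetSum (Finset.range m) fun s _ =>
          integrable_finsetSum (Finset.range (b + 1)) fun t _ => hφint t s]
        refine Finset.sum_congr rfl fun s _ => ?_
        rw [integral_finsetSum (Finset.range (b + 1)) fun t _ => hφint t s]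
    _ ≤ A / N * ∑ s ∈ Finset.range m, ∑ t ∈ Finset.range (b + 1), K * (1 + Real.log β) / β := by
        gcongr with s _ t _
        exact hφmean t s
    _ = A ^ 2 / N * (K * (1 + Real.log β) / β) := by
        rw [Finset.sum_const, Finset.sum_const, Finset.card_range, Finset.card_range, nsmul_eq_mul, nsmul_eq_mul,
          hA]
        push_cast
        ring

end FreezeAssembly

section FrobeniusTrace

open scoped Matrix Matrix.Norms.Frobenius

variable {N : ℕ}

theorem abs_re_trace_le_sqrt_mul_norm (T : Matrix (Fin N) (Fin N) ℂ) :
    |T.trace.re| ≤ Real.sqrt N * ‖T‖ := by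
  have hexp : ∀ t : ℝ, ‖T - (t : ℂ) • (1 : Matrix (Fin N) (Fin N) ℂ)‖ ^ 2 =
      ‖T‖ ^ 2 - 2 * t * T.trace.re + t ^ 2 * N := by
    intro t
    have h1 := Matrix.frobenius_norm_sq_eq_re_trace (T - (t : ℂ) • (1 : Matrix (Fin N) (Fin N) ℂ))
    have h0 := Matrix.frobenius_norm_sq_eq_re_trace T
    rw [h1]
    simp only [Matrix.conjTranspose_sub, Matrix.conjTranspose_smul, Matrix.conjTranspose_one, sub_mul, mul_sub,
      Matrix.smul_mul, Matrix.mul_smul, one_mul, mul_one, Matrix.trace_sub, Matrix.trace_smul, Matrix.trace_one,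
      map_sub, smul_eq_mul, Fintype.card_fin, RCLike.star_def, Complex.conj_ofReal]
    rw [h0]
    simp only [RCLike.re_to_complex, Complex.mul_re, Complex.ofReal_re, Complex.ofReal_im, Complex.natCast_re,
      Complex.natCast_im, Matrix.trace_conjTranspose, RCLike.star_def, Complex.conj_re, Complex.conj_im]
    ring
  by_cases hN : N = 0
  · subst hN
    simp [Matrix.trace]
  have hNpos : (0 : ℝ) < N := by exact_mod_cast Nat.pos_of_ne_zero hN
  have hkey : (T.trace.re) ^ 2 ≤ N * ‖T‖ ^ 2 := by
    have h := sq_nonneg ‖T - ((T.trace.re / N : ℝ) : ℂ) • (1 : Matrix (Fin N) (Fin N) ℂ)‖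
    rw [hexp] at h
    have e : ‖T‖ ^ 2 - 2 * (T.trace.re / N) * T.trace.re + (T.trace.re / N) ^ 2 * N =
        (N * ‖T‖ ^ 2 - T.trace.re ^ 2) / N := by field_simp; ring
    rw [e] at h
    have := (div_nonneg_iff.1 h)
    rcases this with ⟨h1, _⟩ | ⟨_, h2⟩
    · linarith
    · exfalso; linarith
  have h2 : |T.trace.re| ^ 2 ≤ (Real.sqrt N * ‖T‖) ^ 2 := by
    rw [sq_abs, mul_pow, Real.sq_sqrt hNpos.le]; exact hkey
  exact (pow_le_pow_iff_left₀ (abs_nonneg _) (by positivity) two_ne_zero).1 h2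

end FrobeniusTrace

section ClipAlgebra

open scoped Matrix Matrix.Norms.Frobenius

variable {G : Type} [Group G] {N : ℕ} (ρ : G →* Matrix (Fin N) (Fin N) ℂ)

theorem re_trace_map_inv (hρu : ∀ g, ρ g ∈ Matrix.unitaryGroup (Fin N) ℂ) (k : G) :
    (ρ k⁻¹).trace.re = (ρ k).trace.re := by
  have h1 : ρ k * star (ρ k) = 1 := Matrix.mem_unitaryGroup_iff.1 (hρu k)
  have hinv : ρ k⁻¹ * ρ k = 1 := by rw [← map_mul, inv_mul_cancel, map_one]
  have h : ρ k⁻¹ = (ρ k)ᴴ := by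
    rw [← Matrix.star_eq_conjTranspose]
    calc ρ k⁻¹ = ρ k⁻¹ * (ρ k * star (ρ k)) := by rw [h1, mul_one]
      _ = star (ρ k) := by rw [← mul_assoc, hinv, one_mul]
  rw [h, Matrix.trace_conjTranspose, RCLike.star_def, Complex.conj_re]

theorem re_trace_map_conj (g k : G) : (ρ (g * k * g⁻¹)).trace.re = (ρ k).trace.re := by
  rw [map_mul, map_mul, Matrix.trace_mul_cycle, ← map_mul, inv_mul_cancel, map_one, one_mul]

theorem abs_re_trace_mul_conj_sub_le (hρu : ∀ g, ρ g ∈ Matrix.unitaryGroup (Fin N) ℂ) (hN : 1 ≤ N)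
    (H g k₀ : G) :
    |(ρ (H * (g * k₀⁻¹ * g⁻¹))).trace.re / N - (ρ k₀).trace.re / N| ≤ ‖ρ H - 1‖ / Real.sqrt N := by
  have hN0 : (0 : ℝ) < N := by exact_mod_cast hN
  have hsq : 0 < Real.sqrt N := Real.sqrt_pos.2 hN0
  set k' : G := g * k₀⁻¹ * g⁻¹ with hk'
  have hr : (ρ k').trace.re = (ρ k₀).trace.re := by
    rw [hk', re_trace_map_conj ρ, re_trace_map_inv ρ hρu]
  have hdiff : (ρ (H * k')).trace.re - (ρ k').trace.re = ((ρ H - 1) * ρ k').trace.re := by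
    rw [map_mul, sub_mul, one_mul, Matrix.trace_sub, Complex.sub_re]
  have hb : |((ρ H - 1) * ρ k').trace.re| ≤ Real.sqrt N * ‖ρ H - 1‖ := by
    refine (abs_re_trace_le_sqrt_mul_norm _).trans ?_
    rw [Matrix.frobenius_norm_mul_unitaryGroup _ ⟨ρ k', hρu k'⟩]
  rw [← sub_div, ← hr, hdiff, abs_div, abs_of_pos hN0, div_le_div_iff₀ hN0 hsq]
  calc |((ρ H - 1) * ρ k').trace.re| * Real.sqrt N ≤ Real.sqrt N * ‖ρ H - 1‖ * Real.sqrt N := by gcongr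
    _ = ‖ρ H - 1‖ * N := by rw [mul_comm (Real.sqrt N), mul_assoc, Real.mul_self_sqrt hN0.le]

theorem clip_le_neg_one_add {r : ℝ} (hr : r < 1) (t : ℝ) : clip r t ≤ -1 + 2 * |t - r| / (1 - r) := by
  have h1r : 0 < 1 - r := by linarith
  have habs : 0 ≤ 2 * |t - r| / (1 - r) := by positivity
  unfold clip
  refine max_le (by linarith) ((min_le_right _ _).trans ?_)
  have : 2 * (t - r) / (1 - r) ≤ 2 * |t - r| / (1 - r) := by
    gcongr; exact le_abs_self _
  linarith

theorem clip_re_trace_twisted_le (hρu : ∀ g, ρ g ∈ Matrix.unitaryGroup (Fin N) ℂ) (hN : 1 ≤ N) {k₀ : G}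
    (hr : (ρ k₀).trace.re / N < 1) (H g : G) :
    clip ((ρ k₀).trace.re / N) ((ρ (H * (g * k₀⁻¹ * g⁻¹))).trace.re / N) ≤
      -1 + 2 / ((1 - (ρ k₀).trace.re / N) * Real.sqrt N) * ‖ρ H - 1‖ := by
  have hN0 : (0 : ℝ) < N := by exact_mod_cast hN
  have hsq : 0 < Real.sqrt N := Real.sqrt_pos.2 hN0
  have h1r : 0 < 1 - (ρ k₀).trace.re / N := by linarith
  have hne : (N : ℝ) - (ρ k₀).trace.re ≠ 0 := by
    intro h0
    have : 1 - (ρ k₀).trace.re / N = ((N : ℝ) - (ρ k₀).trace.re) / N := by field_simp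
    rw [this, h0, zero_div] at h1r
    exact lt_irrefl _ h1r
  refine (clip_le_neg_one_add hr _).trans ?_
  have hdev := abs_re_trace_mul_conj_sub_le ρ hρu hN H g k₀
  have : 2 * |(ρ (H * (g * k₀⁻¹ * g⁻¹))).trace.re / N - (ρ k₀).trace.re / N| / (1 - (ρ k₀).trace.re / N) ≤
      2 / ((1 - (ρ k₀).trace.re / N) * Real.sqrt N) * ‖ρ H - 1‖ := by
    rw [div_le_iff₀ h1r]
    calc 2 * |(ρ (H * (g * k₀⁻¹ * g⁻¹))).trace.re / N - (ρ k₀).trace.re / N|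
        ≤ 2 * (‖ρ H - 1‖ / Real.sqrt N) := by gcongr
      _ = 2 / ((1 - (ρ k₀).trace.re / N) * Real.sqrt N) * ‖ρ H - 1‖ * (1 - (ρ k₀).trace.re / N) := by
          field_simp
  linarith

end ClipAlgebra

section YMSpecTail

open Literature.MathematicalPhysics.QuantumFieldTheory (haarProbability)

variable {G : Type} [Group G] [TopologicalSpace G] [IsTopologicalGroup G] [CompactSpace G]
  [SecondCountableTopology G] [MeasurableSpace G] [BorelSpace G]
  {d N : ℕ} (ρ : G →* Matrix (Fin N) (Fin N) ℂ)

omit [TopologicalSpace G] [IsTopologicalGroup G] [CompactSpace G] [SecondCountableTopology G] [MeasurableSpace G]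
  [BorelSpace G] in
theorem wilsonBoundaryAction_nonneg (hρu : ∀ g, ρ g ∈ Matrix.unitaryGroup (Fin N) ℂ) (Λ : Finset (ZdEdge d))
    (U : LGConfig d G) : 0 ≤ wilsonBoundaryAction ρ Λ U :=
  Finset.sum_nonneg fun p _ => by
    have := (abs_le.1 (abs_plaquetteObs_le_holds ρ hρu p.1 p.2.1.1 p.2.1.2 U)).2
    linarith

omit [TopologicalSpace G] [IsTopologicalGroup G] [CompactSpace G] [SecondCountableTopology G] [MeasurableSpace G]
  [BorelSpace G] in
theorem wilsonBoundaryAction_le_card (hρu : ∀ g, ρ g ∈ Matrix.unitaryGroup (Fin N) ℂ) (Λ : Finset (ZdEdge d))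
    (U : LGConfig d G) : wilsonBoundaryAction ρ Λ U ≤ 2 * N * (plaquettesTouching Λ).card := by
  unfold wilsonBoundaryAction
  have h : ∀ p ∈ plaquettesTouching Λ, ((N : ℝ) - plaquetteObs ρ p.1 p.2.1.1 p.2.1.2 U) ≤ 2 * N :=
    fun p _ => by
      have := (abs_le.1 (abs_plaquetteObs_le_holds ρ hρu p.1 p.2.1.1 p.2.1.2 U)).1
      linarith
  calc ∑ p ∈ plaquettesTouching Λ, ((N : ℝ) - plaquetteObs ρ p.1 p.2.1.1 p.2.1.2 U)
      ≤ ∑ _p ∈ plaquettesTouching Λ, (2 * (N : ℝ)) := Finset.sum_le_sum h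
    _ = 2 * N * (plaquettesTouching Λ).card := by rw [Finset.sum_const, nsmul_eq_mul]; ring

theorem ymSpecification_mean_action_le (hρ : Continuous ρ) (hρu : ∀ g, ρ g ∈ Matrix.unitaryGroup (Fin N) ℂ) {β : ℝ}
    (hβ : 0 < β) (Λ : Finset (ZdEdge d)) (η : LGConfig d G) {s t : ℝ} (hs0 : 0 ≤ s) (ht : 0 ≤ t)
    (hs : 0 < ((Measure.pi fun _ : ↥Λ => haarProbability G).map (glueWith Λ · η)).real
      {U | wilsonBoundaryAction ρ Λ U ≤ s}) :
    ∫ U, wilsonBoundaryAction ρ Λ U ∂(ymSpecification ρ β Λ η) ≤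
      s + (Real.log (1 / ((Measure.pi fun _ : ↥Λ => haarProbability G).map (glueWith Λ · η)).real
            {U | wilsonBoundaryAction ρ Λ U ≤ s}) + t) / β +
        2 * N * (plaquettesTouching Λ).card * Real.exp (-t) := by
  haveI : IsProbabilityMeasure ((Measure.pi fun _ : ↥Λ => haarProbability G).map (glueWith Λ · η)) :=
    Measure.isProbabilityMeasure_map (measurable_glueWith Λ η).aemeasurable
  have h := gibbsMean_le ((Measure.pi fun _ : ↥Λ => haarProbability G).map (glueWith Λ · η))
    (continuous_wilsonBoundaryAction ρ hρ Λ).measurable (wilsonBoundaryAction_nonneg ρ hρu Λ)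
    (wilsonBoundaryAction_le_card ρ hρu Λ) hβ hs0 ht hs
  have e : ymSpecification ρ β Λ η =
      ((Measure.pi fun _ : ↥Λ => haarProbability G).map (glueWith Λ · η)).tilted
        fun U => -(β * wilsonBoundaryAction ρ Λ U) := by
    simp only [ymSpecification, neg_mul]
  rw [e]
  exact h

end YMSpecTail

section RouteB

open scoped Matrix Matrix.Norms.Frobenius
open Literature.MathematicalPhysics.QuantumFieldTheory (wilsonMeasure GaugeConfig isProbabilityMeasure_wilsonMeasure)
open Summit.QuantumFields.YangMills.Theorems.TunedSequenceExists.Negative.Freezing (integrable_of_continuous)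

variable {G : Type} [Group G] [TopologicalSpace G] [IsTopologicalGroup G] [CompactSpace G]
  [SecondCountableTopology G] [MeasurableSpace G] [BorelSpace G]
  {N : ℕ} (ρ : G →* Matrix (Fin N) (Fin N) ℂ)

def topRun (b m : ℕ) (U : LGConfig 4 G) : G :=
  ((List.range m).map fun s : ℕ => U (site2 ((b : ℤ) + 1) s, 1)).prod

omit [TopologicalSpace G] [IsTopologicalGroup G] [CompactSpace G] [SecondCountableTopology G] [MeasurableSpace G]
  [BorelSpace G] in
theorem staple_eq_topRun_mul (b m : ℕ) (U : LGConfig 4 G) :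
    staple b m U = topRun b m U * (((((List.range (b + 1)).reverse).map fun t : ℕ => (U (site2 t m, 0))⁻¹).prod *
      ((((List.range m).reverse).map fun s : ℕ => (U (site2 0 s, 1))⁻¹).prod * U (site2 0 0, 0)))) := rfl

omit [TopologicalSpace G] [IsTopologicalGroup G] [CompactSpace G] [SecondCountableTopology G] [MeasurableSpace G]
  [BorelSpace G] in
theorem topTwist_site2_of_ne {b : ℕ} (k : Site 4 → G) (U : LGConfig 4 G) {t : ℤ} (ht : t ≠ (b : ℤ)) (s : ℤ)
    (i : Fin 4) : topTwist b k U (site2 t s, i) = U (site2 t s, i) :=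
  topTwist_apply_of_ne k U ht

omit [TopologicalSpace G] [IsTopologicalGroup G] [CompactSpace G] [SecondCountableTopology G] [MeasurableSpace G]
  [BorelSpace G] in
theorem topTwist_site2_height {b : ℕ} (k : Site 4 → G) (U : LGConfig 4 G) (s : ℤ) :
    topTwist b k U (site2 (b : ℤ) s, 0) = U (site2 (b : ℤ) s, 0) * (k (site2 ((b : ℤ) + 1) s))⁻¹ := by
  unfold topTwist
  rw [if_pos ⟨rfl, rfl⟩, site2_add_single_zero]

omit [TopologicalSpace G] [IsTopologicalGroup G] [CompactSpace G] [SecondCountableTopology G] [MeasurableSpace G]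
  [BorelSpace G] in
theorem staple_topTwist {b : ℕ} (hb : 1 ≤ b) (m : ℕ) (k : Site 4 → G) (U : LGConfig 4 G) :
    staple b m (topTwist b k U) =
      topRun b m U * k (site2 ((b : ℤ) + 1) m) * (topRun b m U)⁻¹ * staple b m U := by
  have hb0 : (0 : ℤ) ≠ (b : ℤ) := by
    have : (1 : ℤ) ≤ b := by exact_mod_cast hb
    omega
  have hb1 : (b : ℤ) + 1 ≠ (b : ℤ) := by omega
  have htop : topRun b m (topTwist b k U) = topRun b m U := by
    unfold topRun
    simp only [topTwist_site2_of_ne k U hb1]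
  have hrest : ((List.range b).reverse.map fun t : ℕ => (topTwist b k U (site2 t m, 0))⁻¹) =
      (List.range b).reverse.map fun t : ℕ => (U (site2 t m, 0))⁻¹ := by
    refine List.map_congr_left fun t ht => ?_
    have htb : (t : ℤ) ≠ (b : ℤ) := by
      have := List.mem_range.1 (List.mem_reverse.1 ht)
      omega
    rw [topTwist_site2_of_ne k U htb]
  have hdown : ((List.range (b + 1)).reverse.map fun t : ℕ => (topTwist b k U (site2 t m, 0))⁻¹).prod =
      k (site2 ((b : ℤ) + 1) m) * ((List.range (b + 1)).reverse.map fun t : ℕ => (U (site2 t m, 0))⁻¹).prod := by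
    rw [List.range_succ, List.reverse_append, List.reverse_singleton, List.singleton_append, List.map_cons,
      List.map_cons, List.prod_cons, List.prod_cons, hrest, topTwist_site2_height, mul_inv_rev, inv_inv, mul_assoc]
  have hbot : ((List.range m).reverse.map fun s : ℕ => (topTwist b k U (site2 0 s, 1))⁻¹) =
      (List.range m).reverse.map fun s : ℕ => (U (site2 0 s, 1))⁻¹ := by
    simp only [topTwist_site2_of_ne k U hb0]
  rw [staple_eq_topRun_mul, staple_eq_topRun_mul, htop, hdown, hbot, topTwist_site2_of_ne k U hb0]
  group

omit [TopologicalSpace G] [IsTopologicalGroup G] [CompactSpace G] [SecondCountableTopology G] [MeasurableSpace G]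
  [BorelSpace G] in
theorem col_mul_staple_eq_twisted {b : ℕ} (hb : 1 ≤ b) (R m : ℕ) (k₀ : G) (σ U : LGConfig 4 G) :
    ∃ g : G, col b U * staple b m σ =
      col b U * staple b m (topTwist b (comb b R k₀ σ) σ) * (g * k₀⁻¹ * g⁻¹) := by
  refine ⟨(staple b m (topTwist b (comb b R k₀ σ) σ))⁻¹ * topRun b m σ *
    (stair b R σ (site2 ((b : ℤ) + 1) m))⁻¹, ?_⟩
  rw [staple_topTwist hb m (comb b R k₀ σ) σ]
  simp only [comb]
  group

omit [TopologicalSpace G] [IsTopologicalGroup G] [CompactSpace G] [SecondCountableTopology G] [MeasurableSpace G]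
  [BorelSpace G] in
theorem clip_chargedTest_re_le (hρu : ∀ g, ρ g ∈ Matrix.unitaryGroup (Fin N) ℂ) (hN : 1 ≤ N) {k₀ : G}
    (hr : (ρ k₀).trace.re / N < 1) {b : ℕ} (hb : 1 ≤ b) (R m : ℕ) (σ U : LGConfig 4 G) :
    clip ((ρ k₀).trace.re / N) (chargedTest ρ b m σ U).re ≤
      -1 + 2 / ((1 - (ρ k₀).trace.re / N) * Real.sqrt N) *
        ‖ρ (col b U * staple b m (topTwist b (comb b R k₀ σ) σ)) - 1‖ := by
  obtain ⟨g, hg⟩ := col_mul_staple_eq_twisted hb R m k₀ σ U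
  have hre : (chargedTest ρ b m σ U).re =
      (ρ (col b U * staple b m (topTwist b (comb b R k₀ σ) σ) * (g * k₀⁻¹ * g⁻¹))).trace.re / N := by
    rw [chargedTest, hg, Complex.div_natCast_re]
  rw [hre]
  exact clip_re_trace_twisted_le ρ hρu hN hr _ g

def twistDefect (β : ℝ) (b n : ℕ) (k₀ : G) (V : GaugeConfig 4 (2 * ((2 * n + 2) * b + 1) + 1) G) : ℝ :=
  ∫ U, ‖ρ (col b U * staple b ((2 * n + 1) * b)
      (twistΦ b (comb b ((2 * n + 2) * b + 1) k₀) (torusLift (2 * ((2 * n + 2) * b + 1) + 1) V))) - 1‖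
    ∂(ymSpecification ρ β (rowRegion b n)
        (twistΦ b (comb b ((2 * n + 2) * b + 1) k₀) (torusLift (2 * ((2 * n + 2) * b + 1) + 1) V)))

theorem twistedMeanObs_clip_le (hρ : Continuous ρ) (hρu : ∀ g, ρ g ∈ Matrix.unitaryGroup (Fin N) ℂ) (hN : 1 ≤ N)
    {k₀ : G} (hr : (ρ k₀).trace.re / N < 1) {b : ℕ} (hb : 1 ≤ b) (n : ℕ) (β : ℝ)
    (V : GaugeConfig 4 (2 * ((2 * n + 2) * b + 1) + 1) G) :
    twistedMeanObs ρ β b n (comb b ((2 * n + 2) * b + 1) k₀) (clip ((ρ k₀).trace.re / N)) V ≤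
      -1 + 2 / ((1 - (ρ k₀).trace.re / N) * Real.sqrt N) * twistDefect ρ β b n k₀ V := by
  unfold twistedMeanObs twistDefect
  set m : ℕ := (2 * n + 1) * b with hm
  set σ : LGConfig 4 G := torusLift (2 * ((2 * n + 2) * b + 1) + 1) V with hσ
  set σ' : LGConfig 4 G := twistΦ b (comb b ((2 * n + 2) * b + 1) k₀) σ with hσ'
  set γ := ymSpecification ρ β (rowRegion b n) σ' with hγ
  set C : ℝ := 2 / ((1 - (ρ k₀).trace.re / N) * Real.sqrt N) with hC
  haveI : IsProbabilityMeasure γ := isProbabilityMeasure_ymSpecification ρ hρ β _ _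
  have hint1 : Integrable (fun U => clip ((ρ k₀).trace.re / N) (chargedTest ρ b m σ U).re) γ :=
    integrable_of_continuous γ
      ((continuous_clip _).comp (Complex.continuous_re.comp (continuous_chargedTest ρ hρ _ _ σ)))
  have hcontD : Continuous fun U : LGConfig 4 G => ‖ρ (col b U * staple b m σ') - 1‖ :=
    ((hρ.comp ((continuous_col b).mul continuous_const)).sub continuous_const).norm
  have hintD : Integrable (fun U : LGConfig 4 G => ‖ρ (col b U * staple b m σ') - 1‖) γ :=
    integrable_of_continuous γ hcontD
  have hint2 : Integrable (fun U : LGConfig 4 G => -1 + C * ‖ρ (col b U * staple b m σ') - 1‖) γ :=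
    (integrable_const _).add (hintD.const_mul C)
  have hpt : ∀ U : LGConfig 4 G,
      clip ((ρ k₀).trace.re / N) (chargedTest ρ b m σ U).re ≤ -1 + C * ‖ρ (col b U * staple b m σ') - 1‖ :=
    fun U => clip_chargedTest_re_le ρ hρu hN hr hb ((2 * n + 2) * b + 1) m σ U
  calc ∫ U, clip ((ρ k₀).trace.re / N) (chargedTest ρ b m σ U).re ∂γ
      ≤ ∫ U, (-1 + C * ‖ρ (col b U * staple b m σ') - 1‖) ∂γ := integral_mono hint1 hint2 hpt
    _ = -1 + C * ∫ U, ‖ρ (col b U * staple b m σ') - 1‖ ∂γ := by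
        rw [integral_add (integrable_const _) (hintD.const_mul C), integral_const, integral_const_mul, smul_eq_mul]
        simp

def KernelDefectPoly (n : ℕ) (k₀ : G) (θ : ℝ) : Prop :=
  ∀ η : ℝ, 0 < η → ∃ c : ℝ, 0 < c ∧ ∃ β₀ : ℝ, polyRegime θ c β₀ fun β b =>
    (wilsonMeasure (d := 4) (L := 2 * ((2 * n + 2) * b + 1) + 1) ρ β)
        {V | η < twistDefect ρ β b n k₀ V} ≤ ENNReal.ofReal η

theorem frameValuePoly_of_kernelDefectPoly (hρ : Continuous ρ) (hρu : ∀ g, ρ g ∈ Matrix.unitaryGroup (Fin N) ℂ)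
    (hN : 1 ≤ N) {k₀ : G} (hr : (ρ k₀).trace.re / N < 1) {n : ℕ} {θ : ℝ}
    (h : KernelDefectPoly ρ n k₀ θ) : FrameValuePoly ρ n k₀ θ := by
  intro η hη
  have hN0 : (0 : ℝ) < N := by exact_mod_cast hN
  have h1r : 0 < 1 - (ρ k₀).trace.re / N := by linarith
  set C : ℝ := 2 / ((1 - (ρ k₀).trace.re / N) * Real.sqrt N) with hC
  have hCpos : 0 < C := div_pos two_pos (mul_pos h1r (Real.sqrt_pos.2 hN0))
  set η₁ : ℝ := min η (η / C) with hη₁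
  have hη₁pos : 0 < η₁ := lt_min hη (div_pos hη hCpos)
  obtain ⟨c, hc, β₀, hreg⟩ := h η₁ hη₁pos
  refine ⟨c, hc, β₀, fun β hβ b hb hbc => ?_⟩
  have hK := hreg β hβ b hb hbc
  refine le_trans (measure_mono fun V hV => ?_) (hK.trans (ENNReal.ofReal_le_ofReal (min_le_left _ _)))
  simp only [Set.mem_setOf_eq] at hV ⊢
  have hle := twistedMeanObs_clip_le ρ hρ hρu hN hr hb n β V
  have h1 : η < C * twistDefect ρ β b n k₀ V := by linarith
  have h2 : η / C < twistDefect ρ β b n k₀ V := by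
    rw [div_lt_iff₀ hCpos]; linarith
  exact lt_of_le_of_lt (min_le_right _ _) h2

end RouteB

section Markov

open scoped Matrix Matrix.Norms.Frobenius
open Literature.MathematicalPhysics.QuantumFieldTheory (wilsonMeasure GaugeConfig isProbabilityMeasure_wilsonMeasure)
open Summit.QuantumFields.YangMills.Theorems.TunedSequenceExists.Negative.Freezing (re_trace_le_of_mem_unitaryGroup)

variable {G : Type} [Group G] [TopologicalSpace G] [IsTopologicalGroup G] [CompactSpace G]
  [SecondCountableTopology G] [MeasurableSpace G] [BorelSpace G]
  {N : ℕ} (ρ : G →* Matrix (Fin N) (Fin N) ℂ)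

omit [TopologicalSpace G] [IsTopologicalGroup G] [CompactSpace G] [SecondCountableTopology G] [MeasurableSpace G]
  [BorelSpace G] in
theorem norm_map_sub_one_le (hρu : ∀ g, ρ g ∈ Matrix.unitaryGroup (Fin N) ℂ) (g : G) :
    ‖ρ g - 1‖ ≤ 2 * Real.sqrt N := by
  have hneg : -(ρ g) ∈ Matrix.unitaryGroup (Fin N) ℂ := by
    have h := SetLike.coe_mem (-(⟨ρ g, hρu g⟩ : Matrix.unitaryGroup (Fin N) ℂ))
    rw [Unitary.coe_neg] at h
    exact h
  have h2 : -(ρ g).trace.re ≤ N := by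
    have := re_trace_le_of_mem_unitaryGroup hneg
    simpa [Matrix.trace_neg] using this
  have h1 := sub_re_trace_eq_norm_sq ρ hρu g
  have h3 : ‖ρ g - 1‖ ^ 2 ≤ (2 * Real.sqrt N) ^ 2 := by
    rw [mul_pow, Real.sq_sqrt (Nat.cast_nonneg _)]
    nlinarith
  calc ‖ρ g - 1‖ = Real.sqrt (‖ρ g - 1‖ ^ 2) := (Real.sqrt_sq (norm_nonneg _)).symm
    _ ≤ Real.sqrt ((2 * Real.sqrt N) ^ 2) := Real.sqrt_le_sqrt h3
    _ = 2 * Real.sqrt N := Real.sqrt_sq (by positivity)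

omit [SecondCountableTopology G] in
theorem twistDefect_nonneg (β : ℝ) (b n : ℕ) (k₀ : G) (V : GaugeConfig 4 (2 * ((2 * n + 2) * b + 1) + 1) G) :
    0 ≤ twistDefect ρ β b n k₀ V :=
  integral_nonneg fun _ => norm_nonneg _

theorem twistDefect_le (hρ : Continuous ρ) (hρu : ∀ g, ρ g ∈ Matrix.unitaryGroup (Fin N) ℂ) (β : ℝ) (b n : ℕ)
    (k₀ : G) (V : GaugeConfig 4 (2 * ((2 * n + 2) * b + 1) + 1) G) :
    twistDefect ρ β b n k₀ V ≤ 2 * Real.sqrt N := by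
  unfold twistDefect
  haveI := isProbabilityMeasure_ymSpecification ρ hρ β (rowRegion b n)
    (twistΦ b (comb b ((2 * n + 2) * b + 1) k₀) (torusLift (2 * ((2 * n + 2) * b + 1) + 1) V))
  refine (integral_mono_of_nonneg (ae_of_all _ fun _ => norm_nonneg _) (integrable_const (2 * Real.sqrt N))
    (ae_of_all _ fun U => norm_map_sub_one_le ρ hρu _)).trans ?_
  simp

theorem kernelDefectPoly_of_mean (hρ : Continuous ρ) (hρu : ∀ g, ρ g ∈ Matrix.unitaryGroup (Fin N) ℂ) {n : ℕ}
    {k₀ : G} (hmeas : ∀ (β : ℝ) (b : ℕ), Measurable (twistDefect ρ β b n k₀))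
    (hmean : ∃ C : ℝ, 0 < C ∧ ∃ β₁ : ℝ, ∀ β : ℝ, β₁ ≤ β → ∀ b : ℕ, 1 ≤ b →
      ∫ V, twistDefect ρ β b n k₀ V ∂(wilsonMeasure (d := 4) (L := 2 * ((2 * n + 2) * b + 1) + 1) ρ β) ≤
        C * (b : ℝ) ^ (7 / 2 : ℝ) * Real.sqrt (Real.log β / β)) :
    KernelDefectPoly ρ n k₀ (1 / 7) := by
  intro η hη
  obtain ⟨C, hC, β₁, hmean⟩ := hmean
  have hq0 : 0 ≤ η ^ 2 / C := div_nonneg (sq_nonneg _) hC.le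
  refine ⟨(η ^ 2 / C) ^ (2 / 7 : ℝ), Real.rpow_pos_of_pos (div_pos (pow_pos hη 2) hC) _, max β₁ 3,
    fun β hβ b hb hbc => ?_⟩
  set c : ℝ := (η ^ 2 / C) ^ (2 / 7 : ℝ) with hc
  set μ := wilsonMeasure (d := 4) (L := 2 * ((2 * n + 2) * b + 1) + 1) ρ β with hμ
  haveI : IsProbabilityMeasure μ := isProbabilityMeasure_wilsonMeasure ρ hρ β
  have hβ1 : β₁ ≤ β := (le_max_left _ _).trans hβ
  have hβ3 : (3 : ℝ) ≤ β := (le_max_right _ _).trans hβ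
  have hβ0 : (0 : ℝ) < β := by linarith
  have hlog : 0 < Real.log β := Real.log_pos (by linarith)
  have hX0 : 0 ≤ β / Real.log β := by positivity
  have hc0 : 0 ≤ c := Real.rpow_nonneg hq0 _
  have h1 : (b : ℝ) ^ (7 / 2 : ℝ) ≤ (c * (β / Real.log β) ^ (1 / 7 : ℝ)) ^ (7 / 2 : ℝ) :=
    Real.rpow_le_rpow (Nat.cast_nonneg _) hbc (by norm_num)
  have h2 : (c * (β / Real.log β) ^ (1 / 7 : ℝ)) ^ (7 / 2 : ℝ) =
      c ^ (7 / 2 : ℝ) * Real.sqrt (β / Real.log β) := by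
    rw [Real.mul_rpow hc0 (Real.rpow_nonneg hX0 _), ← Real.rpow_mul hX0, Real.sqrt_eq_rpow]
    norm_num
  have h3 : c ^ (7 / 2 : ℝ) = η ^ 2 / C := by
    rw [hc, ← Real.rpow_mul hq0]
    norm_num
  have h4 : Real.sqrt (β / Real.log β) * Real.sqrt (Real.log β / β) = 1 := by
    rw [← Real.sqrt_mul hX0, show β / Real.log β * (Real.log β / β) = 1 by field_simp, Real.sqrt_one]
  have key : C * (b : ℝ) ^ (7 / 2 : ℝ) * Real.sqrt (Real.log β / β) ≤ η ^ 2 := by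
    have hs0 : 0 ≤ Real.sqrt (Real.log β / β) := Real.sqrt_nonneg _
    calc C * (b : ℝ) ^ (7 / 2 : ℝ) * Real.sqrt (Real.log β / β)
        ≤ C * (c ^ (7 / 2 : ℝ) * Real.sqrt (β / Real.log β)) * Real.sqrt (Real.log β / β) := by
          rw [← h2]; gcongr
      _ = C * c ^ (7 / 2 : ℝ) * (Real.sqrt (β / Real.log β) * Real.sqrt (Real.log β / β)) := by ring
      _ = η ^ 2 := by rw [h4, h3, mul_one]; field_simp
  have hint : Integrable (twistDefect ρ β b n k₀) μ :=
    Integrable.of_bound (hmeas β b).aestronglyMeasurable (2 * Real.sqrt N) (ae_of_all _ fun V => by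
      rw [Real.norm_eq_abs, abs_of_nonneg (twistDefect_nonneg ρ β b n k₀ V)]
      exact twistDefect_le ρ hρ hρu β b n k₀ V)
  have hmarkov := mul_meas_ge_le_integral_of_nonneg (ae_of_all _ fun V => twistDefect_nonneg ρ β b n k₀ V) hint η
  have hm := hmean β hβ1 b hb
  have hreal : μ.real {V | η < twistDefect ρ β b n k₀ V} ≤ η := by
    have hsub : {V | η < twistDefect ρ β b n k₀ V} ⊆ {V | η ≤ twistDefect ρ β b n k₀ V} := fun V hV => by
      simp only [Set.mem_setOf_eq] at hV ⊢
      exact hV.le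
    refine (measureReal_mono hsub).trans ?_
    have hle : η * μ.real {V | η ≤ twistDefect ρ β b n k₀ V} ≤ η ^ 2 := hmarkov.trans (hm.trans key)
    by_contra hcon
    push Not at hcon
    nlinarith [hη, hcon, hle]
  calc μ {V | η < twistDefect ρ β b n k₀ V} = ENNReal.ofReal (μ.real {V | η < twistDefect ρ β b n k₀ V}) :=
        (ofReal_measureReal (measure_ne_top μ _)).symm
    _ ≤ ENNReal.ofReal η := ENNReal.ofReal_le_ofReal hreal

end Markov

section K0

open scoped Matrix Matrix.Norms.Frobenius
open Literature.MathematicalPhysics.QuantumFieldTheory (wilsonMeasure GaugeConfig isProbabilityMeasure_wilsonMeasure)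

variable {G : Type} [Group G] [TopologicalSpace G] [IsTopologicalGroup G] [CompactSpace G]
  [SecondCountableTopology G] [MeasurableSpace G] [BorelSpace G]
  {N : ℕ} (ρ : G →* Matrix (Fin N) (Fin N) ℂ)

theorem integral_kernel_staple_boundary (hρ : Continuous ρ) (β : ℝ) {b n m : ℕ}
    (hm : (m : ℤ) = (2 * (n : ℤ) + 1) * b) (η : LGConfig 4 G) :
    ∫ U, ‖ρ (col b U * staple b m η) - 1‖ ∂(ymSpecification ρ β (rowRegion b n) η) =
      ∫ U, ‖ρ (col b U * staple b m U) - 1‖ ∂(ymSpecification ρ β (rowRegion b n) η) := by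
  have hF1 : Continuous fun U : LGConfig 4 G => ‖ρ (col b U * staple b m η) - 1‖ :=
    ((hρ.comp ((continuous_col b).mul continuous_const)).sub continuous_const).norm
  have hF2 : Continuous fun U : LGConfig 4 G => ‖ρ (col b U * staple b m U) - 1‖ :=
    ((hρ.comp ((continuous_col b).mul (continuous_staple b _))).sub continuous_const).norm
  rw [integral_ymSpecification ρ hρ β (rowRegion b n) hF1.measurable,
    integral_ymSpecification ρ hρ β (rowRegion b n) hF2.measurable]
  refine congrArg (· / _) (integral_congr_ae (ae_of_all _ fun ζ => ?_))
  have hst : staple b m (glueWith (rowRegion b n) ζ η) = staple b m η :=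
    staple_eq_of_eq_off_row hm fun e he => glueWith_apply_not_mem (rowRegion b n) ζ η he
  simp only [hst]

theorem twistDefect_eq_integral_self (hρ : Continuous ρ) (β : ℝ) (b n : ℕ) (k₀ : G)
    (V : GaugeConfig 4 (2 * ((2 * n + 2) * b + 1) + 1) G) :
    twistDefect ρ β b n k₀ V =
      ∫ U, ‖ρ (col b U * staple b ((2 * n + 1) * b) U) - 1‖
        ∂(ymSpecification ρ β (rowRegion b n)
          (twistΦ b (comb b ((2 * n + 2) * b + 1) k₀) (torusLift (2 * ((2 * n + 2) * b + 1) + 1) V))) := by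
  have hm : (((2 * n + 1) * b : ℕ) : ℤ) = (2 * (n : ℤ) + 1) * b := by push_cast; ring
  exact integral_kernel_staple_boundary ρ hρ β hm _

theorem continuous_twistDefect (hρ : Continuous ρ) (hρu : ∀ g, ρ g ∈ Matrix.unitaryGroup (Fin N) ℂ) (β : ℝ)
    (b n : ℕ) (k₀ : G) : Continuous (twistDefect ρ β b n k₀) := by
  have hF2 : Continuous fun U : LGConfig 4 G => ‖ρ (col b U * staple b ((2 * n + 1) * b) U) - 1‖ :=
    ((hρ.comp ((continuous_col b).mul (continuous_staple b _))).sub continuous_const).norm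
  have hker := continuous_integral_ymSpecification ρ hρ β (rowRegion b n) hF2 (C := 2 * Real.sqrt N)
    (fun U => by rw [abs_of_nonneg (norm_nonneg _)]; exact norm_map_sub_one_le ρ hρu _)
  have hbd : Continuous fun V : GaugeConfig 4 (2 * ((2 * n + 2) * b + 1) + 1) G =>
      twistΦ b (comb b ((2 * n + 2) * b + 1) k₀) (torusLift (2 * ((2 * n + 2) * b + 1) + 1) V) :=
    (continuous_twist_comb b _ k₀).comp (continuous_torusLift _)
  have h := hker.comp hbd
  refine h.congr fun V => ?_
  simp only [Function.comp]
  exact (twistDefect_eq_integral_self ρ hρ β b n k₀ V).symm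

theorem measurable_twistDefect (hρ : Continuous ρ) (hρu : ∀ g, ρ g ∈ Matrix.unitaryGroup (Fin N) ℂ) (β : ℝ)
    (b n : ℕ) (k₀ : G) : Measurable (twistDefect ρ β b n k₀) :=
  (continuous_twistDefect ρ hρ hρu β b n k₀).measurable

end K0

section PlaqDefect

open scoped Matrix Matrix.Norms.Frobenius
open Literature.MathematicalPhysics.QuantumFieldTheory (wilsonMeasure GaugeConfig isProbabilityMeasure_wilsonMeasure)
open Summit.QuantumFields.YangMills.Theorems.TunedSequenceExists.Negative.Freezing (integrable_of_continuous)

variable {G : Type} [Group G] [TopologicalSpace G] [IsTopologicalGroup G] [CompactSpace G]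
  [SecondCountableTopology G] [MeasurableSpace G] [BorelSpace G]
  {N : ℕ} (ρ : G →* Matrix (Fin N) (Fin N) ℂ)

def plaqDefectSum (b m : ℕ) (U : LGConfig 4 G) : ℝ :=
  ∑ s ∈ Finset.range m, ∑ t ∈ Finset.range (b + 1), ‖ρ (plaq U t s) - 1‖

omit [CompactSpace G] [SecondCountableTopology G] [MeasurableSpace G] [BorelSpace G] in
theorem continuous_plaq (t s : ℤ) : Continuous fun U : LGConfig 4 G => plaq U t s := by
  unfold plaq plaquetteHolonomyZd
  have h : ∀ e : ZdEdge 4, Continuous fun U : LGConfig 4 G => U e := fun e => continuous_apply e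
  exact (((h _).mul (h _)).mul (h _).inv).mul (h _).inv

omit [CompactSpace G] [SecondCountableTopology G] [MeasurableSpace G] [BorelSpace G] in
theorem continuous_plaqDefectSum (hρ : Continuous ρ) (b m : ℕ) : Continuous (plaqDefectSum ρ b m) := by
  unfold plaqDefectSum
  exact continuous_finsetSum _ fun s _ => continuous_finsetSum _ fun t _ =>
    ((hρ.comp (continuous_plaq _ _)).sub continuous_const).norm

omit [TopologicalSpace G] [IsTopologicalGroup G] [CompactSpace G] [SecondCountableTopology G] [MeasurableSpace G]
  [BorelSpace G] in
theorem plaqDefectSum_nonneg (b m : ℕ) (U : LGConfig 4 G) : 0 ≤ plaqDefectSum ρ b m U :=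
  Finset.sum_nonneg fun _ _ => Finset.sum_nonneg fun _ _ => norm_nonneg _

omit [TopologicalSpace G] [IsTopologicalGroup G] [CompactSpace G] [SecondCountableTopology G] [MeasurableSpace G]
  [BorelSpace G] in
theorem plaqDefectSum_le (hρu : ∀ g, ρ g ∈ Matrix.unitaryGroup (Fin N) ℂ) (b m : ℕ) (U : LGConfig 4 G) :
    plaqDefectSum ρ b m U ≤ m * ((b + 1) * (2 * Real.sqrt N)) := by
  unfold plaqDefectSum
  have h1 : ∀ s ∈ Finset.range m, ∑ t ∈ Finset.range (b + 1), ‖ρ (plaq U t s) - 1‖ ≤ (b + 1) * (2 * Real.sqrt N) := by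
    intro s _
    have h := Finset.sum_le_card_nsmul (Finset.range (b + 1)) (fun t => ‖ρ (plaq U (t : ℤ) s) - 1‖)
      (2 * Real.sqrt N) fun t _ => norm_map_sub_one_le ρ hρu _
    simpa [Finset.card_range, nsmul_eq_mul] using h
  have h2 := Finset.sum_le_card_nsmul (Finset.range m)
    (fun s => ∑ t ∈ Finset.range (b + 1), ‖ρ (plaq U t s) - 1‖) ((b + 1) * (2 * Real.sqrt N)) h1
  simpa [Finset.card_range, nsmul_eq_mul] using h2

omit [TopologicalSpace G] [IsTopologicalGroup G] [CompactSpace G] [SecondCountableTopology G] [MeasurableSpace G]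
  [BorelSpace G] in
theorem norm_col_mul_staple_sub_one_le (hρu : ∀ g, ρ g ∈ Matrix.unitaryGroup (Fin N) ℂ) {b : ℕ} (hb : 1 ≤ b)
    (m : ℕ) (U : LGConfig 4 G) : ‖ρ (col b U * staple b m U) - 1‖ ≤ plaqDefectSum ρ b m U := by
  have hconj : ‖ρ (col b U * staple b m U) - 1‖ = ‖ρ (rectHol U (b + 1) m) - 1‖ := by
    rw [col_mul_staple_eq_conj_rectHol hb m U]
    have := norm_map_conj_sub_one ρ hρu (U (site2 0 0, 0))⁻¹ (rectHol U (b + 1) m)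
    rwa [inv_inv] at this
  rw [hconj]
  exact norm_rectHol_sub_one_le ρ hρu U (b + 1) m

def kernelPlaqDefect (β : ℝ) (b n : ℕ) (k₀ : G) (V : GaugeConfig 4 (2 * ((2 * n + 2) * b + 1) + 1) G) : ℝ :=
  ∫ U, plaqDefectSum ρ b ((2 * n + 1) * b) U
    ∂(ymSpecification ρ β (rowRegion b n)
      (twistΦ b (comb b ((2 * n + 2) * b + 1) k₀) (torusLift (2 * ((2 * n + 2) * b + 1) + 1) V)))

theorem twistDefect_le_kernelPlaqDefect (hρ : Continuous ρ) (hρu : ∀ g, ρ g ∈ Matrix.unitaryGroup (Fin N) ℂ)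
    (β : ℝ) {b : ℕ} (hb : 1 ≤ b) (n : ℕ) (k₀ : G) (V : GaugeConfig 4 (2 * ((2 * n + 2) * b + 1) + 1) G) :
    twistDefect ρ β b n k₀ V ≤ kernelPlaqDefect ρ β b n k₀ V := by
  rw [twistDefect_eq_integral_self ρ hρ β b n k₀ V]
  unfold kernelPlaqDefect
  set γ := ymSpecification ρ β (rowRegion b n)
    (twistΦ b (comb b ((2 * n + 2) * b + 1) k₀) (torusLift (2 * ((2 * n + 2) * b + 1) + 1) V)) with hγ
  haveI : IsProbabilityMeasure γ := isProbabilityMeasure_ymSpecification ρ hρ β _ _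
  have hF2 : Continuous fun U : LGConfig 4 G => ‖ρ (col b U * staple b ((2 * n + 1) * b) U) - 1‖ :=
    ((hρ.comp ((continuous_col b).mul (continuous_staple b _))).sub continuous_const).norm
  exact integral_mono (integrable_of_continuous γ hF2) (integrable_of_continuous γ (continuous_plaqDefectSum ρ hρ _ _))
    fun U => norm_col_mul_staple_sub_one_le ρ hρu hb _ U

theorem continuous_kernelPlaqDefect (hρ : Continuous ρ) (hρu : ∀ g, ρ g ∈ Matrix.unitaryGroup (Fin N) ℂ) (β : ℝ)
    (b n : ℕ) (k₀ : G) : Continuous (kernelPlaqDefect ρ β b n k₀) := by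
  have hker := continuous_integral_ymSpecification ρ hρ β (rowRegion b n)
    (continuous_plaqDefectSum ρ hρ b ((2 * n + 1) * b))
    (C := ((2 * n + 1) * b : ℕ) * ((b + 1) * (2 * Real.sqrt N)))
    (fun U => by rw [abs_of_nonneg (plaqDefectSum_nonneg ρ _ _ U)]; exact plaqDefectSum_le ρ hρu _ _ U)
  have hbd : Continuous fun V : GaugeConfig 4 (2 * ((2 * n + 2) * b + 1) + 1) G =>
      twistΦ b (comb b ((2 * n + 2) * b + 1) k₀) (torusLift (2 * ((2 * n + 2) * b + 1) + 1) V) :=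
    (continuous_twist_comb b _ k₀).comp (continuous_torusLift _)
  exact hker.comp hbd

theorem integral_twistDefect_le_of_kernelPlaqDefect (hρ : Continuous ρ)
    (hρu : ∀ g, ρ g ∈ Matrix.unitaryGroup (Fin N) ℂ) {n : ℕ} {k₀ : G}
    (h : ∃ C : ℝ, 0 < C ∧ ∃ β₁ : ℝ, ∀ β : ℝ, β₁ ≤ β → ∀ b : ℕ, 1 ≤ b →
      ∫ V, kernelPlaqDefect ρ β b n k₀ V ∂(wilsonMeasure (d := 4) (L := 2 * ((2 * n + 2) * b + 1) + 1) ρ β) ≤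
        C * (b : ℝ) ^ (7 / 2 : ℝ) * Real.sqrt (Real.log β / β)) :
    ∃ C : ℝ, 0 < C ∧ ∃ β₁ : ℝ, ∀ β : ℝ, β₁ ≤ β → ∀ b : ℕ, 1 ≤ b →
      ∫ V, twistDefect ρ β b n k₀ V ∂(wilsonMeasure (d := 4) (L := 2 * ((2 * n + 2) * b + 1) + 1) ρ β) ≤
        C * (b : ℝ) ^ (7 / 2 : ℝ) * Real.sqrt (Real.log β / β) := by
  obtain ⟨C, hC, β₁, h⟩ := h
  refine ⟨C, hC, β₁, fun β hβ b hb => ?_⟩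
  set μ := wilsonMeasure (d := 4) (L := 2 * ((2 * n + 2) * b + 1) + 1) ρ β with hμ
  haveI : IsProbabilityMeasure μ := isProbabilityMeasure_wilsonMeasure ρ hρ β
  refine (integral_mono (integrable_of_continuous μ (continuous_twistDefect ρ hρ hρu β b n k₀))
    (integrable_of_continuous μ (continuous_kernelPlaqDefect ρ hρ hρu β b n k₀))
    fun V => twistDefect_le_kernelPlaqDefect ρ hρ hρu β hb n k₀ V).trans (h β hβ b hb)

end PlaqDefect

section PlaqEnergy

open scoped Matrix Matrix.Norms.Frobenius
open Literature.MathematicalPhysics.QuantumFieldTheory (wilsonMeasure GaugeConfig isProbabilityMeasure_wilsonMeasure)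
open Summit.QuantumFields.YangMills.Theorems.TunedSequenceExists.Negative.Freezing (integrable_of_continuous)

theorem integral_sqrt_le_sqrt_integral {X : Type*} [MeasurableSpace X] (μ : Measure X) [IsProbabilityMeasure μ]
    {f : X → ℝ} (hf : ∀ x, 0 ≤ f x) (hfi : Integrable f μ) :
    ∫ x, Real.sqrt (f x) ∂μ ≤ Real.sqrt (∫ x, f x ∂μ) := by
  set I := ∫ x, f x ∂μ with hI
  have hamgm : ∀ t : ℝ, 0 < t → ∫ x, Real.sqrt (f x) ∂μ ≤ I / (2 * t) + t / 2 := by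
    intro t ht
    have ht0 : t ≠ 0 := ht.ne'
    have hpt : ∀ x, Real.sqrt (f x) ≤ f x / (2 * t) + t / 2 := by
      intro x
      obtain ⟨s, hs0, hfx⟩ : ∃ s : ℝ, 0 ≤ s ∧ f x = s ^ 2 :=
        ⟨Real.sqrt (f x), Real.sqrt_nonneg _, (Real.sq_sqrt (hf x)).symm⟩
      rw [hfx, Real.sqrt_sq hs0]
      have hid : s ^ 2 / (2 * t) + t / 2 = s + (s - t) ^ 2 / (2 * t) := by
        field_simp
        ring
      rw [hid]
      exact le_add_of_nonneg_right (div_nonneg (sq_nonneg _) (by positivity))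
    have hint2 : Integrable (fun x => f x / (2 * t) + t / 2) μ := (hfi.div_const _).add (integrable_const _)
    calc ∫ x, Real.sqrt (f x) ∂μ ≤ ∫ x, (f x / (2 * t) + t / 2) ∂μ :=
          integral_mono_of_nonneg (ae_of_all _ fun x => Real.sqrt_nonneg _) hint2 (ae_of_all _ hpt)
      _ = I / (2 * t) + t / 2 := by
          rw [integral_add (hfi.div_const _) (integrable_const _), integral_div, integral_const, hI]
          simp
  by_cases hIpos : 0 < I
  · set s := Real.sqrt I with hs
    have hs0 : 0 < s := Real.sqrt_pos.2 hIpos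
    have hss : s * s = I := Real.mul_self_sqrt hIpos.le
    have h := hamgm s hs0
    have hid : I / (2 * s) + s / 2 = s := by
      rw [← hss]
      field_simp
      ring
    linarith [h, hid]
  · push Not at hIpos
    have hle : ∫ x, Real.sqrt (f x) ∂μ ≤ 0 := by
      by_contra hcon
      push Not at hcon
      have h := hamgm _ hcon
      have hdiv : I / (2 * ∫ x, Real.sqrt (f x) ∂μ) ≤ 0 :=
        div_nonpos_iff.2 (Or.inr ⟨hIpos, by positivity⟩)
      linarith
    exact hle.trans (Real.sqrt_nonneg _)

variable {G : Type} [Group G] [TopologicalSpace G] [IsTopologicalGroup G] [CompactSpace G]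
  [SecondCountableTopology G] [MeasurableSpace G] [BorelSpace G]
  {N : ℕ} (ρ : G →* Matrix (Fin N) (Fin N) ℂ)

def plaqDefectSqSum (b m : ℕ) (U : LGConfig 4 G) : ℝ :=
  ∑ s ∈ Finset.range m, ∑ t ∈ Finset.range (b + 1), ‖ρ (plaq U t s) - 1‖ ^ 2

omit [TopologicalSpace G] [IsTopologicalGroup G] [CompactSpace G] [SecondCountableTopology G] [MeasurableSpace G]
  [BorelSpace G] in
theorem plaqDefectSqSum_eq_two_mul_sum_cost (hρu : ∀ g, ρ g ∈ Matrix.unitaryGroup (Fin N) ℂ) (b m : ℕ)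
    (U : LGConfig 4 G) : plaqDefectSqSum ρ b m U =
      2 * ∑ s ∈ Finset.range m, ∑ t ∈ Finset.range (b + 1), ((N : ℝ) - (ρ (plaq U t s)).trace.re) := by
  unfold plaqDefectSqSum
  rw [Finset.mul_sum]
  refine Finset.sum_congr rfl fun s _ => ?_
  rw [Finset.mul_sum]
  refine Finset.sum_congr rfl fun t _ => ?_
  rw [sub_re_trace_eq_norm_sq ρ hρu]
  ring

omit [CompactSpace G] [SecondCountableTopology G] [MeasurableSpace G] [BorelSpace G] in
theorem continuous_plaqDefectSqSum (hρ : Continuous ρ) (b m : ℕ) : Continuous (plaqDefectSqSum ρ b m) := by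
  unfold plaqDefectSqSum
  exact continuous_finsetSum _ fun s _ => continuous_finsetSum _ fun t _ =>
    (((hρ.comp (continuous_plaq _ _)).sub continuous_const).norm.pow 2)

omit [TopologicalSpace G] [IsTopologicalGroup G] [CompactSpace G] [SecondCountableTopology G] [MeasurableSpace G]
  [BorelSpace G] in
theorem plaqDefectSqSum_nonneg (b m : ℕ) (U : LGConfig 4 G) : 0 ≤ plaqDefectSqSum ρ b m U :=
  Finset.sum_nonneg fun _ _ => Finset.sum_nonneg fun _ _ => sq_nonneg _

omit [TopologicalSpace G] [IsTopologicalGroup G] [CompactSpace G] [SecondCountableTopology G] [MeasurableSpace G]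
  [BorelSpace G] in
theorem plaqDefectSqSum_le (hρu : ∀ g, ρ g ∈ Matrix.unitaryGroup (Fin N) ℂ) (b m : ℕ) (U : LGConfig 4 G) :
    plaqDefectSqSum ρ b m U ≤ m * ((b + 1) * (2 * Real.sqrt N) ^ 2) := by
  unfold plaqDefectSqSum
  have h1 : ∀ s ∈ Finset.range m, ∑ t ∈ Finset.range (b + 1), ‖ρ (plaq U t s) - 1‖ ^ 2 ≤
      (b + 1) * (2 * Real.sqrt N) ^ 2 := by
    intro s _
    have h := Finset.sum_le_card_nsmul (Finset.range (b + 1)) (fun t => ‖ρ (plaq U (t : ℤ) s) - 1‖ ^ 2)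
      ((2 * Real.sqrt N) ^ 2) fun t _ => pow_le_pow_left₀ (norm_nonneg _) (norm_map_sub_one_le ρ hρu _) 2
    simpa [Finset.card_range, nsmul_eq_mul] using h
  have h2 := Finset.sum_le_card_nsmul (Finset.range m)
    (fun s => ∑ t ∈ Finset.range (b + 1), ‖ρ (plaq U t s) - 1‖ ^ 2) ((b + 1) * (2 * Real.sqrt N) ^ 2) h1
  simpa [Finset.card_range, nsmul_eq_mul] using h2

omit [TopologicalSpace G] [IsTopologicalGroup G] [CompactSpace G] [SecondCountableTopology G] [MeasurableSpace G]
  [BorelSpace G] in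
theorem plaqDefectSum_sq_le (b m : ℕ) (U : LGConfig 4 G) :
    plaqDefectSum ρ b m U ^ 2 ≤ ((b + 1 : ℕ) * m : ℝ) * plaqDefectSqSum ρ b m U := by
  unfold plaqDefectSum plaqDefectSqSum
  have h := sq_sum_le_card_mul_sum_sq (s := Finset.range m ×ˢ Finset.range (b + 1))
    (f := fun p : ℕ × ℕ => ‖ρ (plaq U p.2 p.1) - 1‖)
  rw [Finset.sum_product, Finset.sum_product, Finset.card_product, Finset.card_range,
    Finset.card_range] at h
  push_cast at h ⊢
  linarith

omit [TopologicalSpace G] [IsTopologicalGroup G] [CompactSpace G] [SecondCountableTopology G] [MeasurableSpace G]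
  [BorelSpace G] in
theorem plaqDefectSum_le_sqrt (b m : ℕ) (U : LGConfig 4 G) :
    plaqDefectSum ρ b m U ≤ Real.sqrt (((b + 1 : ℕ) * m : ℝ) * plaqDefectSqSum ρ b m U) :=
  (le_abs_self _).trans (Real.abs_le_sqrt (plaqDefectSum_sq_le ρ b m U))

def kernelPlaqDefectSq (β : ℝ) (b n : ℕ) (k₀ : G) (V : GaugeConfig 4 (2 * ((2 * n + 2) * b + 1) + 1) G) : ℝ :=
  ∫ U, plaqDefectSqSum ρ b ((2 * n + 1) * b) U
    ∂(ymSpecification ρ β (rowRegion b n)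
      (twistΦ b (comb b ((2 * n + 2) * b + 1) k₀) (torusLift (2 * ((2 * n + 2) * b + 1) + 1) V)))

omit [SecondCountableTopology G] in
theorem kernelPlaqDefectSq_nonneg (β : ℝ) (b n : ℕ) (k₀ : G) (V : GaugeConfig 4 (2 * ((2 * n + 2) * b + 1) + 1) G) :
    0 ≤ kernelPlaqDefectSq ρ β b n k₀ V :=
  integral_nonneg fun U => plaqDefectSqSum_nonneg ρ _ _ U

theorem continuous_kernelPlaqDefectSq (hρ : Continuous ρ) (hρu : ∀ g, ρ g ∈ Matrix.unitaryGroup (Fin N) ℂ) (β : ℝ)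
    (b n : ℕ) (k₀ : G) : Continuous (kernelPlaqDefectSq ρ β b n k₀) := by
  have hker := continuous_integral_ymSpecification ρ hρ β (rowRegion b n)
    (continuous_plaqDefectSqSum ρ hρ b ((2 * n + 1) * b))
    (C := ((2 * n + 1) * b : ℕ) * ((b + 1) * (2 * Real.sqrt N) ^ 2))
    (fun U => by rw [abs_of_nonneg (plaqDefectSqSum_nonneg ρ _ _ U)]; exact plaqDefectSqSum_le ρ hρu _ _ U)
  have hbd : Continuous fun V : GaugeConfig 4 (2 * ((2 * n + 2) * b + 1) + 1) G =>
      twistΦ b (comb b ((2 * n + 2) * b + 1) k₀) (torusLift (2 * ((2 * n + 2) * b + 1) + 1) V) :=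
    (continuous_twist_comb b _ k₀).comp (continuous_torusLift _)
  exact hker.comp hbd

theorem kernelPlaqDefect_le_sqrt (hρ : Continuous ρ) (β : ℝ)
    (b n : ℕ) (k₀ : G) (V : GaugeConfig 4 (2 * ((2 * n + 2) * b + 1) + 1) G) :
    kernelPlaqDefect ρ β b n k₀ V ≤
      Real.sqrt (((b + 1 : ℕ) * ((2 * n + 1) * b : ℕ) : ℝ) * kernelPlaqDefectSq ρ β b n k₀ V) := by
  unfold kernelPlaqDefect kernelPlaqDefectSq
  set γ := ymSpecification ρ β (rowRegion b n)
    (twistΦ b (comb b ((2 * n + 2) * b + 1) k₀) (torusLift (2 * ((2 * n + 2) * b + 1) + 1) V)) with hγ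
  haveI : IsProbabilityMeasure γ := isProbabilityMeasure_ymSpecification ρ hρ β _ _
  set M : ℝ := ((b + 1 : ℕ) * ((2 * n + 1) * b : ℕ) : ℝ) with hM
  have hM0 : 0 ≤ M := by positivity
  have hc2 := continuous_plaqDefectSqSum ρ hρ b ((2 * n + 1) * b)
  calc ∫ U, plaqDefectSum ρ b ((2 * n + 1) * b) U ∂γ
      ≤ ∫ U, Real.sqrt (M * plaqDefectSqSum ρ b ((2 * n + 1) * b) U) ∂γ :=
        integral_mono (integrable_of_continuous γ (continuous_plaqDefectSum ρ hρ _ _))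
          (integrable_of_continuous γ (Real.continuous_sqrt.comp (continuous_const.mul hc2)))
          fun U => plaqDefectSum_le_sqrt ρ _ _ U
    _ ≤ Real.sqrt (∫ U, M * plaqDefectSqSum ρ b ((2 * n + 1) * b) U ∂γ) :=
        integral_sqrt_le_sqrt_integral γ (fun U => mul_nonneg hM0 (plaqDefectSqSum_nonneg ρ _ _ U))
          (integrable_of_continuous γ (continuous_const.mul hc2))
    _ = Real.sqrt (M * ∫ U, plaqDefectSqSum ρ b ((2 * n + 1) * b) U ∂γ) := by rw [integral_const_mul]

theorem integral_kernelPlaqDefect_le_sqrt (hρ : Continuous ρ) (hρu : ∀ g, ρ g ∈ Matrix.unitaryGroup (Fin N) ℂ)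
    (β : ℝ) (b n : ℕ) (k₀ : G) :
    ∫ V, kernelPlaqDefect ρ β b n k₀ V ∂(wilsonMeasure (d := 4) (L := 2 * ((2 * n + 2) * b + 1) + 1) ρ β) ≤
      Real.sqrt (((b + 1 : ℕ) * ((2 * n + 1) * b : ℕ) : ℝ) *
        ∫ V, kernelPlaqDefectSq ρ β b n k₀ V ∂(wilsonMeasure (d := 4) (L := 2 * ((2 * n + 2) * b + 1) + 1) ρ β)) := by
  set μ := wilsonMeasure (d := 4) (L := 2 * ((2 * n + 2) * b + 1) + 1) ρ β with hμ
  haveI : IsProbabilityMeasure μ := isProbabilityMeasure_wilsonMeasure ρ hρ β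
  set M : ℝ := ((b + 1 : ℕ) * ((2 * n + 1) * b : ℕ) : ℝ) with hM
  have hM0 : 0 ≤ M := by positivity
  have hc1 := continuous_kernelPlaqDefect ρ hρ hρu β b n k₀
  have hc2 := continuous_kernelPlaqDefectSq ρ hρ hρu β b n k₀
  calc ∫ V, kernelPlaqDefect ρ β b n k₀ V ∂μ ≤ ∫ V, Real.sqrt (M * kernelPlaqDefectSq ρ β b n k₀ V) ∂μ :=
        integral_mono (integrable_of_continuous μ hc1)
          (integrable_of_continuous μ (Real.continuous_sqrt.comp (continuous_const.mul hc2)))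
          fun V => kernelPlaqDefect_le_sqrt ρ hρ β b n k₀ V
    _ ≤ Real.sqrt (∫ V, M * kernelPlaqDefectSq ρ β b n k₀ V ∂μ) :=
        integral_sqrt_le_sqrt_integral μ (fun V => mul_nonneg hM0 (kernelPlaqDefectSq_nonneg ρ β b n k₀ V))
          (integrable_of_continuous μ (continuous_const.mul hc2))
    _ = Real.sqrt (M * ∫ V, kernelPlaqDefectSq ρ β b n k₀ V ∂μ) := by rw [integral_const_mul]

theorem integral_kernelPlaqDefect_le_of_sq (hρ : Continuous ρ) (hρu : ∀ g, ρ g ∈ Matrix.unitaryGroup (Fin N) ℂ)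
    {n : ℕ} {k₀ : G}
    (h : ∃ C : ℝ, 0 < C ∧ ∃ β₁ : ℝ, ∀ β : ℝ, β₁ ≤ β → ∀ b : ℕ, 1 ≤ b →
      ∫ V, kernelPlaqDefectSq ρ β b n k₀ V ∂(wilsonMeasure (d := 4) (L := 2 * ((2 * n + 2) * b + 1) + 1) ρ β) ≤
        C * (b : ℝ) ^ 5 * (Real.log β / β)) :
    ∃ C : ℝ, 0 < C ∧ ∃ β₁ : ℝ, ∀ β : ℝ, β₁ ≤ β → ∀ b : ℕ, 1 ≤ b →
      ∫ V, kernelPlaqDefect ρ β b n k₀ V ∂(wilsonMeasure (d := 4) (L := 2 * ((2 * n + 2) * b + 1) + 1) ρ β) ≤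
        C * (b : ℝ) ^ (7 / 2 : ℝ) * Real.sqrt (Real.log β / β) := by
  obtain ⟨C, hC, β₁, h⟩ := h
  have h2C : 0 < 2 * (2 * (n : ℝ) + 1) * C := by positivity
  set K : ℝ := Real.sqrt (2 * (2 * (n : ℝ) + 1) * C) with hK
  have hK0 : 0 < K := Real.sqrt_pos.2 h2C
  refine ⟨K, hK0, max β₁ 1, fun β hβ b hb => ?_⟩
  have hβ1 : β₁ ≤ β := (le_max_left _ _).trans hβ
  have hβone : (1 : ℝ) ≤ β := (le_max_right _ _).trans hβ
  have hL0 : 0 ≤ Real.log β / β := div_nonneg (Real.log_nonneg hβone) (by linarith)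
  have hb0 : (0 : ℝ) ≤ b := Nat.cast_nonneg _
  have hb1 : (1 : ℝ) ≤ b := by exact_mod_cast hb
  set μ := wilsonMeasure (d := 4) (L := 2 * ((2 * n + 2) * b + 1) + 1) ρ β with hμ
  set X := ∫ V, kernelPlaqDefectSq ρ β b n k₀ V ∂μ with hX
  have hXle : X ≤ C * (b : ℝ) ^ 5 * (Real.log β / β) := h β hβ1 b hb
  have hX0 : 0 ≤ X := integral_nonneg fun V => kernelPlaqDefectSq_nonneg ρ β b n k₀ V
  set M : ℝ := ((b + 1 : ℕ) * ((2 * n + 1) * b : ℕ) : ℝ) with hM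
  have hMle : M ≤ 2 * (2 * (n : ℝ) + 1) * (b : ℝ) ^ 2 := by
    rw [hM]; push_cast
    nlinarith [mul_nonneg (show (0 : ℝ) ≤ 2 * n + 1 by positivity) hb0, hb1]
  have hstep : ∫ V, kernelPlaqDefect ρ β b n k₀ V ∂μ ≤ Real.sqrt (M * X) :=
    integral_kernelPlaqDefect_le_sqrt ρ hρ hρu β b n k₀
  have h7 : ((b : ℝ) ^ (7 / 2 : ℝ)) ^ 2 = (b : ℝ) ^ 7 := by
    rw [← Real.rpow_natCast _ 2, ← Real.rpow_natCast _ 7, ← Real.rpow_mul hb0]; norm_num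
  have hKsq : K ^ 2 = 2 * (2 * (n : ℝ) + 1) * C := Real.sq_sqrt h2C.le
  have hprod : M * X ≤ (K * (b : ℝ) ^ (7 / 2 : ℝ)) ^ 2 * (Real.log β / β) := by
    calc M * X ≤ (2 * (2 * (n : ℝ) + 1) * (b : ℝ) ^ 2) * (C * (b : ℝ) ^ 5 * (Real.log β / β)) :=
          mul_le_mul hMle hXle hX0 (by positivity)
      _ = (K * (b : ℝ) ^ (7 / 2 : ℝ)) ^ 2 * (Real.log β / β) := by rw [mul_pow, hKsq, h7]; ring
  have hKb : 0 ≤ K * (b : ℝ) ^ (7 / 2 : ℝ) := mul_nonneg hK0.le (Real.rpow_nonneg hb0 _)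
  calc ∫ V, kernelPlaqDefect ρ β b n k₀ V ∂μ ≤ Real.sqrt (M * X) := hstep
    _ ≤ Real.sqrt ((K * (b : ℝ) ^ (7 / 2 : ℝ)) ^ 2 * (Real.log β / β)) := Real.sqrt_le_sqrt hprod
    _ = K * (b : ℝ) ^ (7 / 2 : ℝ) * Real.sqrt (Real.log β / β) := by
        rw [Real.sqrt_mul (sq_nonneg _), Real.sqrt_sq hKb]

end PlaqEnergy

section Action

open scoped Matrix Matrix.Norms.Frobenius
open Literature.MathematicalPhysics.QuantumFieldTheory (wilsonMeasure GaugeConfig isProbabilityMeasure_wilsonMeasure)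
open Summit.QuantumFields.YangMills.Theorems.TunedSequenceExists.Negative.Freezing (integrable_of_continuous)

variable {G : Type} [Group G] [TopologicalSpace G] [IsTopologicalGroup G] [CompactSpace G]
  [SecondCountableTopology G] [MeasurableSpace G] [BorelSpace G]
  {N : ℕ} (ρ : G →* Matrix (Fin N) (Fin N) ℂ)

def sigmaPlaq (t s : ℤ) : ZdPlaquette 4 := (site2 t s, ⟨((0 : Fin 4), (1 : Fin 4)), by decide⟩)

theorem sigmaPlaq_inj {t s t' s' : ℤ} (h : sigmaPlaq t s = sigmaPlaq t' s') : t = t' ∧ s = s' := by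
  have h1 := congrArg (fun p : ZdPlaquette 4 => p.1 0) h
  have h2 := congrArg (fun p : ZdPlaquette 4 => p.1 1) h
  simp only [sigmaPlaq, site2_zero, site2_one] at h1 h2
  exact ⟨h1, h2⟩

theorem edge_mem_rowRegion {b n : ℕ} (hb : 1 ≤ b) {t : ℤ} (ht : 1 ≤ t ∧ t ≤ b) {s : ℤ}
    (hs : 0 ≤ s ∧ s < (2 * n + 1) * (b : ℤ)) (i : Fin 4) : (site2 t s, i) ∈ rowRegion b n := by
  have hb0 : (0 : ℤ) < b := by exact_mod_cast hb
  set q : ℤ := s / b with hq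
  have hdiv := Int.mul_ediv_add_emod s b
  have hr0 := Int.emod_nonneg s hb0.ne'
  have hrb := Int.emod_lt_of_pos s hb0
  have hq0 : 0 ≤ q := Int.ediv_nonneg hs.1 hb0.le
  have hqn : q < 2 * n + 1 := (Int.ediv_lt_iff_lt_mul hb0).2 (by linarith [hs.2])
  let y : Fin 4 → ℤ := fun k => if k = 1 then q else 0
  unfold rowRegion regionEdges
  rw [Finset.mem_biUnion]
  refine ⟨y, ?_, ?_⟩
  · refine Finset.mem_filter.2 ⟨?_, by simp [y]⟩
    rw [windowCells, Fintype.mem_piFinset]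
    intro k
    rw [Finset.mem_Icc]
    fin_cases k <;> simp [y]
    all_goals omega
  · rw [cellEdges, Finset.mem_product]
    refine ⟨?_, Finset.mem_univ _⟩
    rw [Fintype.mem_piFinset]
    intro k
    rw [Finset.mem_Ico]
    fin_cases k <;> simp [y, site2, stdFrame] <;> (try constructor) <;>
      nlinarith [hdiv, hr0, hrb, hq0, hqn, ht.1, ht.2, hb0]

theorem site2_zero_add_single (s : ℤ) : site2 0 s + Pi.single (0 : Fin 4) (1 : ℤ) = site2 1 s := by
  funext k
  fin_cases k <;> simp [site2]

theorem sigmaPlaq_mem_touching {b n : ℕ} (hb : 1 ≤ b) {t s : ℕ} (ht : t ≤ b) (hs : s < (2 * n + 1) * b) :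
    sigmaPlaq t s ∈ plaquettesTouching (rowRegion b n) := by
  rw [mem_plaquettesTouching_iff]
  have hs' : (0 : ℤ) ≤ (s : ℤ) ∧ (s : ℤ) < (2 * n + 1) * (b : ℤ) := ⟨by positivity, by exact_mod_cast hs⟩
  rcases Nat.eq_zero_or_pos t with rfl | htpos
  · refine ⟨(site2 1 s, (1 : Fin 4)), Finset.mem_inter.2 ⟨?_, ?_⟩⟩
    · simp only [plaquetteEdges, sigmaPlaq, Finset.mem_insert, Finset.mem_singleton, Nat.cast_zero]
      right; left
      rw [site2_zero_add_single]
    · exact edge_mem_rowRegion hb ⟨le_rfl, by exact_mod_cast hb⟩ hs' 1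
  · refine ⟨(site2 t s, (1 : Fin 4)), Finset.mem_inter.2 ⟨?_, ?_⟩⟩
    · simp [plaquetteEdges, sigmaPlaq]
    · exact edge_mem_rowRegion hb ⟨by exact_mod_cast htpos, by exact_mod_cast ht⟩ hs' 1

omit [TopologicalSpace G] [IsTopologicalGroup G] [CompactSpace G] [SecondCountableTopology G] [MeasurableSpace G]
  [BorelSpace G] in
theorem plaqDefectSqSum_le_two_mul_action (hρu : ∀ g, ρ g ∈ Matrix.unitaryGroup (Fin N) ℂ) {b : ℕ} (hb : 1 ≤ b)
    (n : ℕ) (U : LGConfig 4 G) :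
    plaqDefectSqSum ρ b ((2 * n + 1) * b) U ≤ 2 * wilsonBoundaryAction ρ (rowRegion b n) U := by
  rw [plaqDefectSqSum_eq_two_mul_sum_cost ρ hρu]
  refine mul_le_mul_of_nonneg_left ?_ (by norm_num)
  unfold wilsonBoundaryAction
  set S := Finset.range ((2 * n + 1) * b) ×ˢ Finset.range (b + 1) with hS
  let g : ℕ × ℕ → ZdPlaquette 4 := fun q => sigmaPlaq q.2 q.1
  have hsub : S.image g ⊆ plaquettesTouching (rowRegion b n) := by
    refine Finset.image_subset_iff.2 fun q hq => ?_
    obtain ⟨hq1, hq2⟩ := Finset.mem_product.1 hq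
    exact sigmaPlaq_mem_touching hb (Nat.lt_succ_iff.1 (Finset.mem_range.1 hq2)) (Finset.mem_range.1 hq1)
  have hnn : ∀ p ∈ plaquettesTouching (rowRegion b n), p ∉ S.image g →
      0 ≤ (N : ℝ) - plaquetteObs ρ p.1 p.2.1.1 p.2.1.2 U := fun p _ _ => by
    have := (abs_le.1 (abs_plaquetteObs_le_holds ρ hρu p.1 p.2.1.1 p.2.1.2 U)).2
    linarith
  have himg : ∑ p ∈ S.image g, ((N : ℝ) - plaquetteObs ρ p.1 p.2.1.1 p.2.1.2 U) =
      ∑ q ∈ S, ((N : ℝ) - plaquetteObs ρ (g q).1 (g q).2.1.1 (g q).2.1.2 U) := by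
    refine Finset.sum_image ?_
    intro q _ q' _ hqq
    obtain ⟨h1, h2⟩ := sigmaPlaq_inj hqq
    exact Prod.ext (by exact_mod_cast h2) (by exact_mod_cast h1)
  calc ∑ s ∈ Finset.range ((2 * n + 1) * b), ∑ t ∈ Finset.range (b + 1), ((N : ℝ) - (ρ (plaq U t s)).trace.re)
      = ∑ q ∈ S, ((N : ℝ) - plaquetteObs ρ (g q).1 (g q).2.1.1 (g q).2.1.2 U) := by
        rw [hS, Finset.sum_product]
        rfl
    _ = ∑ p ∈ S.image g, ((N : ℝ) - plaquetteObs ρ p.1 p.2.1.1 p.2.1.2 U) := himg.symm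
    _ ≤ ∑ p ∈ plaquettesTouching (rowRegion b n), ((N : ℝ) - plaquetteObs ρ p.1 p.2.1.1 p.2.1.2 U) :=
        Finset.sum_le_sum_of_subset_of_nonneg hsub hnn

def kernelAction (β : ℝ) (b n : ℕ) (k₀ : G) (V : GaugeConfig 4 (2 * ((2 * n + 2) * b + 1) + 1) G) : ℝ :=
  ∫ U, wilsonBoundaryAction ρ (rowRegion b n) U
    ∂(ymSpecification ρ β (rowRegion b n)
      (twistΦ b (comb b ((2 * n + 2) * b + 1) k₀) (torusLift (2 * ((2 * n + 2) * b + 1) + 1) V)))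

theorem continuous_kernelAction (hρ : Continuous ρ) (hρu : ∀ g, ρ g ∈ Matrix.unitaryGroup (Fin N) ℂ) (β : ℝ)
    (b n : ℕ) (k₀ : G) : Continuous (kernelAction ρ β b n k₀) := by
  have hker := continuous_integral_ymSpecification ρ hρ β (rowRegion b n)
    (continuous_wilsonBoundaryAction ρ hρ (rowRegion b n))
    (C := 2 * N * (plaquettesTouching (rowRegion b n)).card)
    (fun U => by
      rw [abs_of_nonneg (wilsonBoundaryAction_nonneg ρ hρu _ U)]
      exact wilsonBoundaryAction_le_card ρ hρu _ U)
  have hbd : Continuous fun V : GaugeConfig 4 (2 * ((2 * n + 2) * b + 1) + 1) G =>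
      twistΦ b (comb b ((2 * n + 2) * b + 1) k₀) (torusLift (2 * ((2 * n + 2) * b + 1) + 1) V) :=
    (continuous_twist_comb b _ k₀).comp (continuous_torusLift _)
  exact hker.comp hbd

theorem kernelPlaqDefectSq_le_kernelAction (hρ : Continuous ρ) (hρu : ∀ g, ρ g ∈ Matrix.unitaryGroup (Fin N) ℂ)
    (β : ℝ) {b : ℕ} (hb : 1 ≤ b) (n : ℕ) (k₀ : G) (V : GaugeConfig 4 (2 * ((2 * n + 2) * b + 1) + 1) G) :
    kernelPlaqDefectSq ρ β b n k₀ V ≤ 2 * kernelAction ρ β b n k₀ V := by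
  unfold kernelPlaqDefectSq kernelAction
  set γ := ymSpecification ρ β (rowRegion b n)
    (twistΦ b (comb b ((2 * n + 2) * b + 1) k₀) (torusLift (2 * ((2 * n + 2) * b + 1) + 1) V)) with hγ
  haveI : IsProbabilityMeasure γ := isProbabilityMeasure_ymSpecification ρ hρ β _ _
  rw [← integral_const_mul]
  exact integral_mono (integrable_of_continuous γ (continuous_plaqDefectSqSum ρ hρ _ _))
    ((integrable_of_continuous γ (continuous_wilsonBoundaryAction ρ hρ _)).const_mul 2)
    fun U => plaqDefectSqSum_le_two_mul_action ρ hρu hb n U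

theorem integral_kernelPlaqDefectSq_le_of_action (hρ : Continuous ρ) (hρu : ∀ g, ρ g ∈ Matrix.unitaryGroup (Fin N) ℂ)
    {n : ℕ} {k₀ : G}
    (h : ∃ C : ℝ, 0 < C ∧ ∃ β₁ : ℝ, ∀ β : ℝ, β₁ ≤ β → ∀ b : ℕ, 1 ≤ b →
      ∫ V, kernelAction ρ β b n k₀ V ∂(wilsonMeasure (d := 4) (L := 2 * ((2 * n + 2) * b + 1) + 1) ρ β) ≤
        C * (b : ℝ) ^ 5 * (Real.log β / β)) :
    ∃ C : ℝ, 0 < C ∧ ∃ β₁ : ℝ, ∀ β : ℝ, β₁ ≤ β → ∀ b : ℕ, 1 ≤ b →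
      ∫ V, kernelPlaqDefectSq ρ β b n k₀ V ∂(wilsonMeasure (d := 4) (L := 2 * ((2 * n + 2) * b + 1) + 1) ρ β) ≤
        C * (b : ℝ) ^ 5 * (Real.log β / β) := by
  obtain ⟨C, hC, β₁, h⟩ := h
  refine ⟨2 * C, by positivity, β₁, fun β hβ b hb => ?_⟩
  set μ := wilsonMeasure (d := 4) (L := 2 * ((2 * n + 2) * b + 1) + 1) ρ β with hμ
  haveI : IsProbabilityMeasure μ := isProbabilityMeasure_wilsonMeasure ρ hρ β
  calc ∫ V, kernelPlaqDefectSq ρ β b n k₀ V ∂μ ≤ ∫ V, 2 * kernelAction ρ β b n k₀ V ∂μ :=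
        integral_mono (integrable_of_continuous μ (continuous_kernelPlaqDefectSq ρ hρ hρu β b n k₀))
          ((integrable_of_continuous μ (continuous_kernelAction ρ hρ hρu β b n k₀)).const_mul 2)
          fun V => kernelPlaqDefectSq_le_kernelAction ρ hρ hρu β hb n k₀ V
    _ = 2 * ∫ V, kernelAction ρ β b n k₀ V ∂μ := integral_const_mul _ _
    _ ≤ 2 * (C * (b : ℝ) ^ 5 * (Real.log β / β)) := mul_le_mul_of_nonneg_left (h β hβ b hb) (by norm_num)
    _ = 2 * C * (b : ℝ) ^ 5 * (Real.log β / β) := by ring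

end Action

section Lipschitz

open scoped Matrix Matrix.Norms.Frobenius

variable {G : Type} [Group G] {d N : ℕ} (ρ : G →* Matrix (Fin N) (Fin N) ℂ)

theorem norm_map_mul_sub_map_mul_le (hρu : ∀ g, ρ g ∈ Matrix.unitaryGroup (Fin N) ℂ) (g h g' h' : G) :
    ‖ρ (g * h) - ρ (g' * h')‖ ≤ ‖ρ g - ρ g'‖ + ‖ρ h - ρ h'‖ := by
  have hsplit : ρ (g * h) - ρ (g' * h') = ρ g * (ρ h - ρ h') + (ρ g - ρ g') * ρ h' := by
    rw [map_mul, map_mul]; noncomm_ring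
  rw [hsplit]
  refine (norm_add_le _ _).trans ?_
  rw [Matrix.frobenius_norm_unitaryGroup_mul ⟨ρ g, hρu g⟩, Matrix.frobenius_norm_mul_unitaryGroup _ ⟨ρ h', hρu h'⟩]
  linarith

theorem norm_map_inv_sub_map_inv (hρu : ∀ g, ρ g ∈ Matrix.unitaryGroup (Fin N) ℂ) (g g' : G) :
    ‖ρ g⁻¹ - ρ g'⁻¹‖ = ‖ρ g - ρ g'‖ := by
  have e1 : ρ g⁻¹ * ρ g' * ρ g'⁻¹ = ρ g⁻¹ := by rw [mul_assoc, ← map_mul, mul_inv_cancel, map_one, mul_one]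
  have e2 : ρ g⁻¹ * ρ g * ρ g'⁻¹ = ρ g'⁻¹ := by rw [← map_mul, inv_mul_cancel, map_one, one_mul]
  have h : ρ g⁻¹ - ρ g'⁻¹ = ρ g⁻¹ * (ρ g' - ρ g) * ρ g'⁻¹ := by rw [mul_sub, sub_mul, e1, e2]
  rw [h, Matrix.frobenius_norm_mul_unitaryGroup _ ⟨ρ g'⁻¹, hρu g'⁻¹⟩,
    Matrix.frobenius_norm_unitaryGroup_mul ⟨ρ g⁻¹, hρu g⁻¹⟩, norm_sub_rev]

def plaqEdgeDev (U U' : LGConfig d G) (x : Site d) (i j : Fin d) : ℝ :=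
  ‖ρ (U (x, i)) - ρ (U' (x, i))‖ + ‖ρ (U (x + Pi.single i 1, j)) - ρ (U' (x + Pi.single i 1, j))‖ +
    ‖ρ (U (x + Pi.single j 1, i)) - ρ (U' (x + Pi.single j 1, i))‖ + ‖ρ (U (x, j)) - ρ (U' (x, j))‖

theorem norm_map_plaquetteHolonomy_sub_le (hρu : ∀ g, ρ g ∈ Matrix.unitaryGroup (Fin N) ℂ) (U U' : LGConfig d G)
    (x : Site d) (i j : Fin d) :
    ‖ρ (plaquetteHolonomyZd U x i j) - ρ (plaquetteHolonomyZd U' x i j)‖ ≤ plaqEdgeDev ρ U U' x i j := by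
  unfold plaquetteHolonomyZd plaqEdgeDev
  calc ‖ρ (U (x, i) * U (x + Pi.single i 1, j) * (U (x + Pi.single j 1, i))⁻¹ * (U (x, j))⁻¹) -
        ρ (U' (x, i) * U' (x + Pi.single i 1, j) * (U' (x + Pi.single j 1, i))⁻¹ * (U' (x, j))⁻¹)‖
      ≤ ‖ρ (U (x, i) * U (x + Pi.single i 1, j) * (U (x + Pi.single j 1, i))⁻¹) -
          ρ (U' (x, i) * U' (x + Pi.single i 1, j) * (U' (x + Pi.single j 1, i))⁻¹)‖ +
          ‖ρ (U (x, j))⁻¹ - ρ (U' (x, j))⁻¹‖ := norm_map_mul_sub_map_mul_le ρ hρu _ _ _ _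
    _ ≤ (‖ρ (U (x, i) * U (x + Pi.single i 1, j)) - ρ (U' (x, i) * U' (x + Pi.single i 1, j))‖ +
          ‖ρ (U (x + Pi.single j 1, i))⁻¹ - ρ (U' (x + Pi.single j 1, i))⁻¹‖) +
          ‖ρ (U (x, j))⁻¹ - ρ (U' (x, j))⁻¹‖ := by
        gcongr; exact norm_map_mul_sub_map_mul_le ρ hρu _ _ _ _
    _ ≤ ((‖ρ (U (x, i)) - ρ (U' (x, i))‖ + ‖ρ (U (x + Pi.single i 1, j)) - ρ (U' (x + Pi.single i 1, j))‖) +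
          ‖ρ (U (x + Pi.single j 1, i))⁻¹ - ρ (U' (x + Pi.single j 1, i))⁻¹‖) +
          ‖ρ (U (x, j))⁻¹ - ρ (U' (x, j))⁻¹‖ := by
        gcongr; exact norm_map_mul_sub_map_mul_le ρ hρu _ _ _ _
    _ = _ := by rw [norm_map_inv_sub_map_inv ρ hρu, norm_map_inv_sub_map_inv ρ hρu]

theorem abs_plaquetteObs_sub_le (hρu : ∀ g, ρ g ∈ Matrix.unitaryGroup (Fin N) ℂ) (U U' : LGConfig d G)
    (x : Site d) (i j : Fin d) :
    |plaquetteObs ρ x i j U - plaquetteObs ρ x i j U'| ≤ Real.sqrt N * plaqEdgeDev ρ U U' x i j := by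
  unfold plaquetteObs
  rw [← Complex.sub_re, ← Matrix.trace_sub]
  exact (abs_re_trace_le_sqrt_mul_norm _).trans
    (mul_le_mul_of_nonneg_left (norm_map_plaquetteHolonomy_sub_le ρ hρu U U' x i j) (Real.sqrt_nonneg _))

theorem wilsonBoundaryAction_le_add_dev (hρu : ∀ g, ρ g ∈ Matrix.unitaryGroup (Fin N) ℂ) (Λ : Finset (ZdEdge d))
    (U U' : LGConfig d G) :
    wilsonBoundaryAction ρ Λ U ≤ wilsonBoundaryAction ρ Λ U' +
      Real.sqrt N * ∑ p ∈ plaquettesTouching Λ, plaqEdgeDev ρ U U' p.1 p.2.1.1 p.2.1.2 := by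
  unfold wilsonBoundaryAction
  rw [Finset.mul_sum, ← Finset.sum_add_distrib]
  refine Finset.sum_le_sum fun p _ => ?_
  have h := (abs_le.1 (abs_plaquetteObs_sub_le ρ hρu U' U p.1 p.2.1.1 p.2.1.2)).2
  have hsym : plaqEdgeDev ρ U' U p.1 p.2.1.1 p.2.1.2 = plaqEdgeDev ρ U U' p.1 p.2.1.1 p.2.1.2 := by
    unfold plaqEdgeDev; simp only [norm_sub_rev]
  rw [hsym] at h
  linarith

theorem wilsonBoundaryAction_le_of_ball (hρu : ∀ g, ρ g ∈ Matrix.unitaryGroup (Fin N) ℂ) (Λ : Finset (ZdEdge d))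
    {U U' : LGConfig d G} {r : ℝ} (hr : 0 ≤ r) (hin : ∀ e ∈ Λ, ‖ρ (U e) - ρ (U' e)‖ ≤ r)
    (hout : ∀ e, e ∉ Λ → U e = U' e) :
    wilsonBoundaryAction ρ Λ U ≤ wilsonBoundaryAction ρ Λ U' + 4 * Real.sqrt N * (plaquettesTouching Λ).card * r := by
  have hdev : ∀ e, ‖ρ (U e) - ρ (U' e)‖ ≤ r := fun e => by
    by_cases he : e ∈ Λ
    · exact hin e he
    · rw [hout e he, sub_self, norm_zero]; exact hr
  have hp : ∀ p ∈ plaquettesTouching Λ, plaqEdgeDev ρ U U' p.1 p.2.1.1 p.2.1.2 ≤ 4 * r := fun p _ => by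
    unfold plaqEdgeDev; linarith [hdev (p.1, p.2.1.1), hdev (p.1 + Pi.single p.2.1.1 1, p.2.1.2),
      hdev (p.1 + Pi.single p.2.1.2 1, p.2.1.1), hdev (p.1, p.2.1.2)]
  have hsum : ∑ p ∈ plaquettesTouching Λ, plaqEdgeDev ρ U U' p.1 p.2.1.1 p.2.1.2 ≤
      (plaquettesTouching Λ).card * (4 * r) := by
    have := Finset.sum_le_sum hp
    rwa [Finset.sum_const, nsmul_eq_mul] at this
  have hN : 0 ≤ Real.sqrt N := Real.sqrt_nonneg _
  calc wilsonBoundaryAction ρ Λ U ≤ wilsonBoundaryAction ρ Λ U' +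
        Real.sqrt N * ∑ p ∈ plaquettesTouching Λ, plaqEdgeDev ρ U U' p.1 p.2.1.1 p.2.1.2 :=
        wilsonBoundaryAction_le_add_dev ρ hρu Λ U U'
    _ ≤ wilsonBoundaryAction ρ Λ U' + Real.sqrt N * ((plaquettesTouching Λ).card * (4 * r)) := by gcongr
    _ = wilsonBoundaryAction ρ Λ U' + 4 * Real.sqrt N * (plaquettesTouching Λ).card * r := by ring

end Lipschitz

section Ref

open scoped Matrix Matrix.Norms.Frobenius
open Literature.MathematicalPhysics.QuantumFieldTheory (haarProbability)

variable {G : Type} [Group G] [TopologicalSpace G] [IsTopologicalGroup G] [CompactSpace G]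
  [SecondCountableTopology G] [MeasurableSpace G] [BorelSpace G]
  {d N : ℕ} (ρ : G →* Matrix (Fin N) (Fin N) ℂ)

omit [SecondCountableTopology G] in
theorem pi_real_ball_ge (Λ : Finset (ZdEdge d)) (ζ₀ : ↥Λ → G)
    {r m₀ : ℝ} (hm₀ : 0 ≤ m₀) (hball : ∀ h : G, m₀ ≤ (haarProbability G).real {g | ‖ρ g - ρ h‖ ≤ r}) :
    m₀ ^ Λ.card ≤ (Measure.pi fun _ : ↥Λ => haarProbability G).real
      (Set.pi Set.univ fun e : ↥Λ => {g | ‖ρ g - ρ (ζ₀ e)‖ ≤ r}) := by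
  rw [measureReal_def, Measure.pi_pi, ENNReal.toReal_prod]
  calc m₀ ^ Λ.card = ∏ _e : ↥Λ, m₀ := by rw [Finset.prod_const, Finset.card_univ, Fintype.card_coe]
    _ ≤ ∏ e : ↥Λ, ((haarProbability G) {g | ‖ρ g - ρ (ζ₀ e)‖ ≤ r}).toReal :=
        Finset.prod_le_prod (fun _ _ => hm₀) fun e _ => by rw [← measureReal_def]; exact hball (ζ₀ e)

theorem ymSpecification_mean_action_le_ref (hρ : Continuous ρ)
    (hρu : ∀ g, ρ g ∈ Matrix.unitaryGroup (Fin N) ℂ) {β : ℝ} (hβ : 0 < β)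
    (Λ : Finset (ZdEdge d)) (η : LGConfig d G) (ζ₀ : ↥Λ → G) {r m₀ t : ℝ} (hr : 0 ≤ r) (hm₀ : 0 < m₀)
    (hball : ∀ h : G, m₀ ≤ (haarProbability G).real {g | ‖ρ g - ρ h‖ ≤ r}) (ht : 0 ≤ t) :
    ∫ U, wilsonBoundaryAction ρ Λ U ∂(ymSpecification ρ β Λ η) ≤
      wilsonBoundaryAction ρ Λ (glueWith Λ ζ₀ η) + 4 * Real.sqrt N * (plaquettesTouching Λ).card * r +
        ((Λ.card : ℝ) * Real.log (1 / m₀) + t) / β + 2 * N * (plaquettesTouching Λ).card * Real.exp (-t) := by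
  set π := (Measure.pi fun _ : ↥Λ => haarProbability G).map (glueWith Λ · η) with hπ
  set s := wilsonBoundaryAction ρ Λ (glueWith Λ ζ₀ η) + 4 * Real.sqrt N * (plaquettesTouching Λ).card * r
    with hs_def
  have hs0 : 0 ≤ s := add_nonneg (wilsonBoundaryAction_nonneg ρ hρu Λ _) (by positivity)
  have hball_sub : (Set.pi Set.univ fun e : ↥Λ => {g | ‖ρ g - ρ (ζ₀ e)‖ ≤ r}) ⊆
      (glueWith Λ · η) ⁻¹' {U | wilsonBoundaryAction ρ Λ U ≤ s} := by
    intro ζ hζ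
    simp only [Set.mem_preimage, Set.mem_setOf_eq]
    refine wilsonBoundaryAction_le_of_ball ρ hρu Λ hr (fun e he => ?_) (fun e he => ?_)
    · rw [glueWith_apply_mem Λ ζ η he, glueWith_apply_mem Λ ζ₀ η he]
      exact (Set.mem_univ_pi.1 hζ) ⟨e, he⟩
    · rw [glueWith_apply_not_mem Λ ζ η he, glueWith_apply_not_mem Λ ζ₀ η he]
  have hmass : m₀ ^ Λ.card ≤ π.real {U | wilsonBoundaryAction ρ Λ U ≤ s} := by
    have hmeas : MeasurableSet {U | wilsonBoundaryAction ρ Λ U ≤ s} :=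
      measurableSet_le (continuous_wilsonBoundaryAction ρ hρ Λ).measurable measurable_const
    rw [hπ, measureReal_def, Measure.map_apply (measurable_glueWith Λ η) hmeas, ← measureReal_def]
    exact (pi_real_ball_ge ρ Λ ζ₀ hm₀.le hball).trans (measureReal_mono hball_sub)
  have hpos : 0 < π.real {U | wilsonBoundaryAction ρ Λ U ≤ s} := lt_of_lt_of_le (pow_pos hm₀ _) hmass
  have hmain := ymSpecification_mean_action_le ρ hρ hρu hβ Λ η hs0 ht hpos
  have hlog : Real.log (1 / π.real {U | wilsonBoundaryAction ρ Λ U ≤ s}) ≤ Λ.card * Real.log (1 / m₀) := by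
    have h1 : 1 / π.real {U | wilsonBoundaryAction ρ Λ U ≤ s} ≤ 1 / m₀ ^ Λ.card :=
      one_div_le_one_div_of_le (pow_pos hm₀ _) hmass
    calc Real.log (1 / π.real {U | wilsonBoundaryAction ρ Λ U ≤ s}) ≤ Real.log (1 / m₀ ^ Λ.card) :=
          Real.log_le_log (one_div_pos.2 hpos) h1
      _ = Λ.card * Real.log (1 / m₀) := by rw [← one_div_pow, Real.log_pow]
  have hdiv : (Real.log (1 / π.real {U | wilsonBoundaryAction ρ Λ U ≤ s}) + t) / β ≤
      ((Λ.card : ℝ) * Real.log (1 / m₀) + t) / β := by gcongr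
  linarith [hmain, hdiv]

open Summit.QuantumFields.YangMills.Theorems.FreeEnergyLogCoefficient (dimE exists_haar_gball_ge)

omit [SecondCountableTopology G] in
theorem haar_ball_one_le_ball (hρu : ∀ g, ρ g ∈ Matrix.unitaryGroup (Fin N) ℂ) (h : G) (r : ℝ) :
    haarProbability G {g | ‖ρ g - 1‖ ≤ r} ≤ haarProbability G {g | ‖ρ g - ρ h‖ ≤ r} := by
  haveI : (haarProbability G).IsMulLeftInvariant := by unfold haarProbability; infer_instance
  have hsub : {g : G | ‖ρ g - 1‖ ≤ r} ⊆ (fun g => h * g) ⁻¹' {g | ‖ρ g - ρ h‖ ≤ r} := by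
    intro g hg
    simp only [Set.mem_preimage, Set.mem_setOf_eq] at hg ⊢
    have e : ρ (h * g) - ρ h = ρ h * (ρ g - 1) := by rw [map_mul, mul_sub, mul_one]
    rw [e, Matrix.frobenius_norm_unitaryGroup_mul ⟨ρ h, hρu h⟩]
    exact hg
  calc haarProbability G {g | ‖ρ g - 1‖ ≤ r} ≤ haarProbability G ((fun g => h * g) ⁻¹' {g | ‖ρ g - ρ h‖ ≤ r}) :=
        measure_mono hsub
    _ = haarProbability G {g | ‖ρ g - ρ h‖ ≤ r} := measure_preimage_mul _ _ _

omit [SecondCountableTopology G] in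
theorem exists_haar_ball_center_ge (hρ : Continuous ρ) (hρi : Function.Injective ρ)
    (hρu : ∀ g, ρ g ∈ Matrix.unitaryGroup (Fin N) ℂ) :
    ∃ C : ℝ, 0 < C ∧ ∀ δ : ℝ, 0 < δ → δ ≤ 1 → ∀ h : G,
      C * δ ^ dimE ρ ≤ (haarProbability G).real {g | ‖ρ g - ρ h‖ ≤ δ} := by
  obtain ⟨C, hC, hball⟩ := exists_haar_gball_ge ρ hρ hρi hρu
  refine ⟨C, hC, fun δ hδ hδ1 h => ?_⟩
  have h1 := (hball δ hδ hδ1).trans (haar_ball_one_le_ball ρ hρu h δ)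
  rw [measureReal_def]
  exact (ENNReal.ofReal_le_iff_le_toReal (measure_ne_top _ _)).1 h1

end Ref

section RefAssembly

open scoped Matrix Matrix.Norms.Frobenius
open Literature.MathematicalPhysics.QuantumFieldTheory (haarProbability wilsonMeasure GaugeConfig isProbabilityMeasure_wilsonMeasure)
open Summit.QuantumFields.YangMills.Theorems.TunedSequenceExists.Negative.Freezing (integrable_of_continuous)
open Summit.QuantumFields.YangMills.Theorems.FreeEnergyLogCoefficient (dimE exists_haar_gball_ge)

variable {G : Type} [Group G] [TopologicalSpace G] [IsTopologicalGroup G] [CompactSpace G]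
  [SecondCountableTopology G] [MeasurableSpace G] [BorelSpace G]
  {N : ℕ} (ρ : G →* Matrix (Fin N) (Fin N) ℂ)

theorem one_le_log_of_three_le {β : ℝ} (hβ : 3 ≤ β) : 1 ≤ Real.log β := by
  have hβ0 : 0 < β := by linarith
  rw [Real.le_log_iff_exp_le hβ0]
  have := Real.exp_one_lt_d9
  norm_num at this
  linarith

theorem kernelAction_le_ref (hρ : Continuous ρ) (hρi : Function.Injective ρ)
    (hρu : ∀ g, ρ g ∈ Matrix.unitaryGroup (Fin N) ℂ) (n : ℕ) (k₀ : G) :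
    ∃ K : ℝ, 0 < K ∧ ∀ β : ℝ, 3 ≤ β → ∀ (b : ℕ) (V : GaugeConfig 4 (2 * ((2 * n + 2) * b + 1) + 1) G)
      (ζ₀ : ↥(rowRegion b n) → G),
      kernelAction ρ β b n k₀ V ≤
        wilsonBoundaryAction ρ (rowRegion b n) (glueWith (rowRegion b n) ζ₀
          (twistΦ b (comb b ((2 * n + 2) * b + 1) k₀) (torusLift (2 * ((2 * n + 2) * b + 1) + 1) V))) +
        K * ((rowRegion b n).card + (plaquettesTouching (rowRegion b n)).card + 1) * (Real.log β / β) := by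
  obtain ⟨C, hC, hball⟩ := exists_haar_ball_center_ge ρ hρ hρi hρu
  refine ⟨4 * Real.sqrt N + 2 * N + dimE ρ + |Real.log C| + 1, by positivity, fun β hβ b V ζ₀ => ?_⟩
  have hβ0 : 0 < β := by linarith
  have hβ1 : 1 ≤ β := by linarith
  have hlog1 : 1 ≤ Real.log β := one_le_log_of_three_le hβ
  have hL0 : 0 < Real.log β / β := div_pos (by linarith) hβ0
  have hr : (0 : ℝ) ≤ 1 / β := by positivity
  have hδ : (0 : ℝ) < 1 / β := by positivity
  have hδ1 : 1 / β ≤ 1 := by rw [div_le_one hβ0]; exact hβ1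
  have hm₀pos : 0 < C * (1 / β) ^ dimE ρ := by positivity
  have hballr : ∀ h : G, C * (1 / β) ^ dimE ρ ≤ (haarProbability G).real {g | ‖ρ g - ρ h‖ ≤ 1 / β} :=
    fun h => hball _ hδ hδ1 h
  have ht0 : 0 ≤ Real.log β := by linarith
  have key := ymSpecification_mean_action_le_ref ρ hρ hρu hβ0 (rowRegion b n)
    (twistΦ b (comb b ((2 * n + 2) * b + 1) k₀) (torusLift (2 * ((2 * n + 2) * b + 1) + 1) V)) ζ₀ hr hm₀pos hballr ht0
  have hT0 : (0 : ℝ) ≤ (plaquettesTouching (rowRegion b n)).card := by positivity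
  have hΛc0 : (0 : ℝ) ≤ (rowRegion b n).card := by positivity
  have hD0 : (0 : ℝ) ≤ dimE ρ := by positivity
  have hexp : Real.exp (-Real.log β) = 1 / β := by rw [Real.exp_neg, Real.exp_log hβ0, one_div]
  have hlogm : Real.log (1 / (C * (1 / β) ^ dimE ρ)) ≤ ((dimE ρ : ℝ) + |Real.log C|) * Real.log β := by
    have e : Real.log (1 / (C * (1 / β) ^ dimE ρ)) = (dimE ρ : ℝ) * Real.log β - Real.log C := by
      rw [one_div, Real.log_inv, Real.log_mul hC.ne' (pow_ne_zero _ hδ.ne'), Real.log_pow, one_div, Real.log_inv]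
      ring
    rw [e]
    have h1 : -Real.log C ≤ |Real.log C| * Real.log β := by
      calc -Real.log C ≤ |Real.log C| := neg_le_abs _
        _ = |Real.log C| * 1 := (mul_one _).symm
        _ ≤ |Real.log C| * Real.log β := mul_le_mul_of_nonneg_left hlog1 (abs_nonneg _)
    linarith
  have h1β : 1 / β ≤ Real.log β / β := div_le_div_of_nonneg_right hlog1 hβ0.le
  have e1 : 4 * Real.sqrt N * ((plaquettesTouching (rowRegion b n)).card : ℝ) * (1 / β) ≤
      4 * Real.sqrt N * ((plaquettesTouching (rowRegion b n)).card : ℝ) * (Real.log β / β) :=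
    mul_le_mul_of_nonneg_left h1β (by positivity)
  have e2 : (((rowRegion b n).card : ℝ) * Real.log (1 / (C * (1 / β) ^ dimE ρ)) + Real.log β) / β ≤
      (((rowRegion b n).card : ℝ) * ((dimE ρ : ℝ) + |Real.log C|) + 1) * (Real.log β / β) := by
    have h2 : ((rowRegion b n).card : ℝ) * Real.log (1 / (C * (1 / β) ^ dimE ρ)) + Real.log β ≤
        (((rowRegion b n).card : ℝ) * ((dimE ρ : ℝ) + |Real.log C|) + 1) * Real.log β := by
      have := mul_le_mul_of_nonneg_left hlogm hΛc0
      linarith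
    calc (((rowRegion b n).card : ℝ) * Real.log (1 / (C * (1 / β) ^ dimE ρ)) + Real.log β) / β
        = (((rowRegion b n).card : ℝ) * Real.log (1 / (C * (1 / β) ^ dimE ρ)) + Real.log β) * (1 / β) := by ring
      _ ≤ ((((rowRegion b n).card : ℝ) * ((dimE ρ : ℝ) + |Real.log C|) + 1) * Real.log β) * (1 / β) :=
          mul_le_mul_of_nonneg_right h2 (by positivity)
      _ = (((rowRegion b n).card : ℝ) * ((dimE ρ : ℝ) + |Real.log C|) + 1) * (Real.log β / β) := by ring
  have e3 : 2 * N * ((plaquettesTouching (rowRegion b n)).card : ℝ) * Real.exp (-Real.log β) ≤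
      2 * N * ((plaquettesTouching (rowRegion b n)).card : ℝ) * (Real.log β / β) := by
    rw [hexp]; exact mul_le_mul_of_nonneg_left h1β (by positivity)
  have hcoef : 4 * Real.sqrt N * ((plaquettesTouching (rowRegion b n)).card : ℝ) +
      (((rowRegion b n).card : ℝ) * ((dimE ρ : ℝ) + |Real.log C|) + 1) +
      2 * N * ((plaquettesTouching (rowRegion b n)).card : ℝ) ≤
      (4 * Real.sqrt N + 2 * N + dimE ρ + |Real.log C| + 1) *
        (((rowRegion b n).card : ℝ) + (plaquettesTouching (rowRegion b n)).card + 1) := by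
    have hN0 : (0 : ℝ) ≤ N := Nat.cast_nonneg N
    have hs0 : (0 : ℝ) ≤ Real.sqrt N := Real.sqrt_nonneg _
    have ha0 : (0 : ℝ) ≤ |Real.log C| := abs_nonneg _
    nlinarith [mul_nonneg hT0 hD0, mul_nonneg hT0 ha0, mul_nonneg hΛc0 hs0, mul_nonneg hΛc0 hN0,
      mul_nonneg hs0 hΛc0, hT0, hΛc0, hD0]
  have hfin := mul_le_mul_of_nonneg_right hcoef hL0.le
  have hsum : 4 * Real.sqrt N * ((plaquettesTouching (rowRegion b n)).card : ℝ) * (Real.log β / β) +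
      (((rowRegion b n).card : ℝ) * ((dimE ρ : ℝ) + |Real.log C|) + 1) * (Real.log β / β) +
      2 * N * ((plaquettesTouching (rowRegion b n)).card : ℝ) * (Real.log β / β) ≤
      (4 * Real.sqrt N + 2 * N + dimE ρ + |Real.log C| + 1) *
        (((rowRegion b n).card : ℝ) + (plaquettesTouching (rowRegion b n)).card + 1) * (Real.log β / β) := by
    have e : 4 * Real.sqrt N * ((plaquettesTouching (rowRegion b n)).card : ℝ) * (Real.log β / β) +
      (((rowRegion b n).card : ℝ) * ((dimE ρ : ℝ) + |Real.log C|) + 1) * (Real.log β / β) +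
      2 * N * ((plaquettesTouching (rowRegion b n)).card : ℝ) * (Real.log β / β) =
      (4 * Real.sqrt N * ((plaquettesTouching (rowRegion b n)).card : ℝ) +
      (((rowRegion b n).card : ℝ) * ((dimE ρ : ℝ) + |Real.log C|) + 1) +
      2 * N * ((plaquettesTouching (rowRegion b n)).card : ℝ)) * (Real.log β / β) := by ring
    rw [e]; exact hfin
  unfold kernelAction
  linarith [key, e1, e2, e3, hsum]

set_option maxHeartbeats 400000 in
theorem integral_kernelAction_le_of_ref (hρ : Continuous ρ) (hρi : Function.Injective ρ)
    (hρu : ∀ g, ρ g ∈ Matrix.unitaryGroup (Fin N) ℂ) {n : ℕ} {k₀ : G}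
    (hcount : ∃ C₀ : ℝ, ∀ b : ℕ, 1 ≤ b →
      ((rowRegion b n).card : ℝ) + (plaquettesTouching (rowRegion b n)).card + 1 ≤ C₀ * (b : ℝ) ^ 4)
    (href : ∃ C₁ : ℝ, 0 < C₁ ∧ ∃ β₂ : ℝ, ∀ β : ℝ, β₂ ≤ β → ∀ b : ℕ, 1 ≤ b →
      ∃ ζ₀ : GaugeConfig 4 (2 * ((2 * n + 2) * b + 1) + 1) G → (↥(rowRegion b n) → G),
        Measurable (fun V => wilsonBoundaryAction ρ (rowRegion b n) (glueWith (rowRegion b n) (ζ₀ V)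
          (twistΦ b (comb b ((2 * n + 2) * b + 1) k₀) (torusLift (2 * ((2 * n + 2) * b + 1) + 1) V)))) ∧
        ∫ V, wilsonBoundaryAction ρ (rowRegion b n) (glueWith (rowRegion b n) (ζ₀ V)
          (twistΦ b (comb b ((2 * n + 2) * b + 1) k₀) (torusLift (2 * ((2 * n + 2) * b + 1) + 1) V)))
          ∂(wilsonMeasure (d := 4) (L := 2 * ((2 * n + 2) * b + 1) + 1) ρ β) ≤ C₁ * (b : ℝ) ^ 5 * (Real.log β / β)) :
    ∃ C : ℝ, 0 < C ∧ ∃ β₁ : ℝ, ∀ β : ℝ, β₁ ≤ β → ∀ b : ℕ, 1 ≤ b →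
      ∫ V, kernelAction ρ β b n k₀ V ∂(wilsonMeasure (d := 4) (L := 2 * ((2 * n + 2) * b + 1) + 1) ρ β) ≤
        C * (b : ℝ) ^ 5 * (Real.log β / β) := by
  obtain ⟨K, hK, hpt⟩ := kernelAction_le_ref ρ hρ hρi hρu n k₀
  obtain ⟨C₀, hC₀⟩ := hcount
  obtain ⟨C₁, hC₁, β₂, href⟩ := href
  have hC₀1 : 1 ≤ C₀ := by
    have h := hC₀ 1 le_rfl
    have h0 : (0 : ℝ) ≤ ((rowRegion 1 n).card : ℝ) + (plaquettesTouching (rowRegion 1 n)).card := by positivity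
    simp only [Nat.cast_one, one_pow, mul_one] at h
    linarith
  have hC₀0 : 0 ≤ C₀ := by linarith
  refine ⟨C₁ + K * C₀, by positivity, max β₂ 3, fun β hβ b hb => ?_⟩
  have hβ2 : β₂ ≤ β := (le_max_left _ _).trans hβ
  have hβ3 : (3 : ℝ) ≤ β := (le_max_right _ _).trans hβ
  have hβ0 : 0 < β := by linarith
  have hL0 : 0 ≤ Real.log β / β := div_nonneg (by linarith [one_le_log_of_three_le hβ3]) hβ0.le
  obtain ⟨ζ₀, hmeas, hint⟩ := href β hβ2 b hb
  haveI : IsProbabilityMeasure (wilsonMeasure (d := 4) (L := 2 * ((2 * n + 2) * b + 1) + 1) ρ β) :=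
    isProbabilityMeasure_wilsonMeasure ρ hρ β
  have hb1 : (1 : ℝ) ≤ b := by exact_mod_cast hb
  have hKC : 0 ≤ K * C₀ * (Real.log β / β) := mul_nonneg (mul_nonneg hK.le hC₀0) hL0
  have hptV : ∀ V : GaugeConfig 4 (2 * ((2 * n + 2) * b + 1) + 1) G, kernelAction ρ β b n k₀ V ≤
      wilsonBoundaryAction ρ (rowRegion b n) (glueWith (rowRegion b n) (ζ₀ V)
        (twistΦ b (comb b ((2 * n + 2) * b + 1) k₀) (torusLift (2 * ((2 * n + 2) * b + 1) + 1) V))) +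
        K * C₀ * (Real.log β / β) * (b : ℝ) ^ 4 := fun V => by
    have h := hpt β hβ3 b V (ζ₀ V)
    have hc : K * (((rowRegion b n).card : ℝ) + (plaquettesTouching (rowRegion b n)).card + 1) * (Real.log β / β) ≤
        K * (C₀ * (b : ℝ) ^ 4) * (Real.log β / β) :=
      mul_le_mul_of_nonneg_right (mul_le_mul_of_nonneg_left (hC₀ b hb) hK.le) hL0
    have e : K * (C₀ * (b : ℝ) ^ 4) * (Real.log β / β) = K * C₀ * (Real.log β / β) * (b : ℝ) ^ 4 := by ring
    linarith [h, hc, e.le, e.ge]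
  have hintK : Integrable (kernelAction ρ β b n k₀) (wilsonMeasure (d := 4) (L := 2 * ((2 * n + 2) * b + 1) + 1) ρ β) :=
    integrable_of_continuous _ (continuous_kernelAction ρ hρ hρu β b n k₀)
  have hintA : Integrable (fun V => wilsonBoundaryAction ρ (rowRegion b n) (glueWith (rowRegion b n) (ζ₀ V)
        (twistΦ b (comb b ((2 * n + 2) * b + 1) k₀) (torusLift (2 * ((2 * n + 2) * b + 1) + 1) V))))
      (wilsonMeasure (d := 4) (L := 2 * ((2 * n + 2) * b + 1) + 1) ρ β) :=
    Integrable.of_bound hmeas.aestronglyMeasurable (2 * N * (plaquettesTouching (rowRegion b n)).card)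
      (ae_of_all _ fun V => by
        rw [Real.norm_eq_abs, abs_of_nonneg (wilsonBoundaryAction_nonneg ρ hρu _ _)]
        exact wilsonBoundaryAction_le_card ρ hρu _ _)
  have hintS : Integrable (fun V => wilsonBoundaryAction ρ (rowRegion b n) (glueWith (rowRegion b n) (ζ₀ V)
        (twistΦ b (comb b ((2 * n + 2) * b + 1) k₀) (torusLift (2 * ((2 * n + 2) * b + 1) + 1) V))) +
        K * C₀ * (Real.log β / β) * (b : ℝ) ^ 4) (wilsonMeasure (d := 4) (L := 2 * ((2 * n + 2) * b + 1) + 1) ρ β) :=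
    hintA.add (integrable_const _)
  have h45 : (b : ℝ) ^ 4 ≤ (b : ℝ) ^ 5 := pow_le_pow_right₀ hb1 (by norm_num)
  have hgrow := mul_le_mul_of_nonneg_left h45 hKC
  calc ∫ V, kernelAction ρ β b n k₀ V ∂(wilsonMeasure (d := 4) (L := 2 * ((2 * n + 2) * b + 1) + 1) ρ β)
      ≤ ∫ V, (wilsonBoundaryAction ρ (rowRegion b n) (glueWith (rowRegion b n) (ζ₀ V)
          (twistΦ b (comb b ((2 * n + 2) * b + 1) k₀) (torusLift (2 * ((2 * n + 2) * b + 1) + 1) V))) +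
          K * C₀ * (Real.log β / β) * (b : ℝ) ^ 4)
          ∂(wilsonMeasure (d := 4) (L := 2 * ((2 * n + 2) * b + 1) + 1) ρ β) :=
        integral_mono hintK hintS hptV
    _ = ∫ V, wilsonBoundaryAction ρ (rowRegion b n) (glueWith (rowRegion b n) (ζ₀ V)
          (twistΦ b (comb b ((2 * n + 2) * b + 1) k₀) (torusLift (2 * ((2 * n + 2) * b + 1) + 1) V)))
          ∂(wilsonMeasure (d := 4) (L := 2 * ((2 * n + 2) * b + 1) + 1) ρ β) +
          K * C₀ * (Real.log β / β) * (b : ℝ) ^ 4 := by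
        rw [integral_add hintA (integrable_const _), integral_const, probReal_univ, one_smul]
    _ ≤ C₁ * (b : ℝ) ^ 5 * (Real.log β / β) + K * C₀ * (Real.log β / β) * (b : ℝ) ^ 5 := add_le_add hint hgrow
    _ = (C₁ + K * C₀) * (b : ℝ) ^ 5 * (Real.log β / β) := by ring

end RefAssembly

section Counts

theorem card_cellEdges_stdFrame_le (b : ℕ) (y : Fin 4 → ℤ) : (cellEdges (stdFrame b) y).card ≤ 64 * b ^ 4 := by
  have hwid : ∀ i ∈ (Finset.univ : Finset (Fin 4)),
      (Finset.Ico (stdFrame b i (y i)) (stdFrame b i (y i + 1))).card ≤ 2 * b := by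
    intro i _
    rw [Int.card_Ico]
    have h := (stdFrame_admissible b i (y i)).2
    omega
  rw [Summit.QuantumFields.YangMills.Cruxes.IR.Tempered.cellEdges, Finset.card_product, Fintype.card_piFinset,
    Finset.card_univ, Fintype.card_fin]
  calc (∏ i : Fin 4, (Finset.Ico (stdFrame b i (y i)) (stdFrame b i (y i + 1))).card) * 4
      ≤ (∏ _i : Fin 4, 2 * b) * 4 :=
        Nat.mul_le_mul_right 4 (Finset.prod_le_prod (fun i _ => Nat.zero_le _) hwid)
    _ = 64 * b ^ 4 := by rw [Finset.prod_const, Finset.card_univ, Fintype.card_fin]; ring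

theorem card_rowRegion_le (b n : ℕ) : (rowRegion b n).card ≤ (rowCells n).card * (64 * b ^ 4) := by
  unfold rowRegion Summit.QuantumFields.YangMills.Cruxes.IR.Tempered.regionEdges
  calc ((rowCells n).biUnion (cellEdges (stdFrame b))).card ≤ ∑ y ∈ rowCells n, (cellEdges (stdFrame b) y).card :=
        Finset.card_biUnion_le
    _ ≤ (rowCells n).card • (64 * b ^ 4) :=
        Finset.sum_le_card_nsmul _ _ _ fun y _ => card_cellEdges_stdFrame_le b y
    _ = (rowCells n).card * (64 * b ^ 4) := smul_eq_mul _ _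

theorem rowRegion_counts (n : ℕ) : ∃ C₀ : ℝ, ∀ b : ℕ, 1 ≤ b →
    ((rowRegion b n).card : ℝ) + (plaquettesTouching (rowRegion b n)).card + 1 ≤ C₀ * (b : ℝ) ^ 4 := by
  refine ⟨(rowCells n).card * 64 * (1 + (1 + 4) * Fintype.card {p : Fin 4 × Fin 4 // p.1 < p.2}) + 1,
    fun b hb => ?_⟩
  have h1 : ((rowRegion b n).card : ℝ) ≤ (rowCells n).card * (64 * (b : ℝ) ^ 4) := by
    exact_mod_cast card_rowRegion_le b n
  have h2 : ((plaquettesTouching (rowRegion b n)).card : ℝ) ≤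
      (1 + 4) * Fintype.card {p : Fin 4 × Fin 4 // p.1 < p.2} * (rowRegion b n).card := by
    exact_mod_cast card_plaquettesTouching_le (rowRegion b n)
  have hb4 : (1 : ℝ) ≤ (b : ℝ) ^ 4 := one_le_pow₀ (by exact_mod_cast hb)
  have hP : (0 : ℝ) ≤ Fintype.card {p : Fin 4 × Fin 4 // p.1 < p.2} := by positivity
  have h2' : ((plaquettesTouching (rowRegion b n)).card : ℝ) ≤
      (1 + 4) * Fintype.card {p : Fin 4 × Fin 4 // p.1 < p.2} * ((rowCells n).card * (64 * (b : ℝ) ^ 4)) :=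
    h2.trans (mul_le_mul_of_nonneg_left h1 (by positivity))
  have e : ((rowCells n).card * 64 * (1 + (1 + 4) * Fintype.card {p : Fin 4 × Fin 4 // p.1 < p.2}) + 1) * (b : ℝ) ^ 4
      = (rowCells n).card * (64 * (b : ℝ) ^ 4) +
        (1 + 4) * Fintype.card {p : Fin 4 × Fin 4 // p.1 < p.2} * ((rowCells n).card * (64 * (b : ℝ) ^ 4)) +
        (b : ℝ) ^ 4 := by ring
  rw [e]
  linarith

end Counts

section Weighted

open scoped Matrix Matrix.Norms.Frobenius
open Literature.MathematicalPhysics.QuantumFieldTheory (wilsonMeasure GaugeConfig isProbabilityMeasure_wilsonMeasure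
  LatticeRep plaquetteCost Plaquette)
open Summit.QuantumFields.YangMills.Theorems.TunedSequenceExists.Negative.Freezing (plaquetteHolonomyZd_torusLift'
  integrable_of_continuous)

variable {G : Type} [Group G] [TopologicalSpace G] [IsTopologicalGroup G] [CompactSpace G]
  [SecondCountableTopology G] [MeasurableSpace G] [BorelSpace G]
  {N : ℕ} (ρ : G →* Matrix (Fin N) (Fin N) ℂ)

def refFill (b n : ℕ) (k₀ : G) (σ : LGConfig 4 G) : ↥(rowRegion b n) → G :=
  fun e => gaugeTransformZd (layerGauge b (comb b ((2 * n + 2) * b + 1) k₀ σ)) σ e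

noncomputable def refConfig (b n : ℕ) (k₀ : G) (σ : LGConfig 4 G) : LGConfig 4 G :=
  glueWith (rowRegion b n) (refFill b n k₀ σ) (twistΦ b (comb b ((2 * n + 2) * b + 1) k₀) σ)

omit [CompactSpace G] [SecondCountableTopology G] [MeasurableSpace G] [BorelSpace G] in
theorem continuous_layerGauge_comb (b R : ℕ) (k₀ : G) (x : Site 4) :
    Continuous fun ζ : LGConfig 4 G => layerGauge b (comb b R k₀ ζ) x := by
  unfold layerGauge
  by_cases hx : x 0 = (b : ℤ) + 1
  · simp only [if_pos hx]; exact continuous_comb b R k₀ x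
  · simp only [if_neg hx]; exact continuous_const

omit [CompactSpace G] [SecondCountableTopology G] [MeasurableSpace G] [BorelSpace G] in
theorem continuous_refConfig (b n : ℕ) (k₀ : G) : Continuous (refConfig (G := G) b n k₀) := by
  refine continuous_pi fun e => ?_
  by_cases he : e ∈ rowRegion b n
  · have h : (fun σ => refConfig b n k₀ σ e) =
        fun σ => gaugeTransformZd (layerGauge b (comb b ((2 * n + 2) * b + 1) k₀ σ)) σ e := by
      funext σ; simp only [refConfig, glueWith, dif_pos he, refFill]
    rw [h]
    unfold gaugeTransformZd
    exact ((continuous_layerGauge_comb _ _ _ _).mul (continuous_apply e)).mul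
      (continuous_layerGauge_comb _ _ _ _).inv
  · have h : (fun σ => refConfig b n k₀ σ e) =
        fun σ => topTwist b (comb b ((2 * n + 2) * b + 1) k₀ σ) σ e := by
      funext σ; simp only [refConfig, glueWith, dif_neg he, twistΦ]
    rw [h]
    exact (continuous_apply e).comp (continuous_twist_comb b _ k₀)

omit [TopologicalSpace G] [IsTopologicalGroup G] [CompactSpace G] [SecondCountableTopology G] [MeasurableSpace G]
  [BorelSpace G] in
theorem plaquetteEnergy_torusLift (L : ℕ) (V : GaugeConfig 4 L G) (q : ZdPlaquette 4) :
    (N : ℝ) - plaquetteObs ρ q.1 q.2.1.1 q.2.1.2 (torusLift L V) =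
      plaquetteCost ρ V (Torus.proj L q.1, q.2) := by
  simp only [plaquetteObs, plaquetteHolonomyZd_torusLift', plaquetteCost]

theorem integral_refAction_le_of_weighted (hρ : Continuous ρ) (hρi : Function.Injective ρ)
    (hρu : ∀ g, ρ g ∈ Matrix.unitaryGroup (Fin N) ℂ) (n : ℕ) (k₀ : G)
    (hW : ∃ C : ℝ, 0 < C ∧ ∀ b : ℕ, 1 ≤ b → ∃ (P : Finset (ZdPlaquette 4)) (w : ZdPlaquette 4 → ℝ),
      (∀ q, 0 ≤ w q) ∧ ∑ q ∈ P, w q ≤ C * (b : ℝ) ^ 5 ∧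
      ∀ σ : LGConfig 4 G, wilsonBoundaryAction ρ (rowRegion b n) (refConfig b n k₀ σ) ≤
        ∑ q ∈ P, w q * ((N : ℝ) - plaquetteObs ρ q.1 q.2.1.1 q.2.1.2 σ)) :
    ∃ C₁ : ℝ, 0 < C₁ ∧ ∃ β₂ : ℝ, ∀ β : ℝ, β₂ ≤ β → ∀ b : ℕ, 1 ≤ b →
      ∃ ζ₀ : GaugeConfig 4 (2 * ((2 * n + 2) * b + 1) + 1) G → (↥(rowRegion b n) → G),
        Measurable (fun V => wilsonBoundaryAction ρ (rowRegion b n) (glueWith (rowRegion b n) (ζ₀ V)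
          (twistΦ b (comb b ((2 * n + 2) * b + 1) k₀) (torusLift (2 * ((2 * n + 2) * b + 1) + 1) V)))) ∧
        ∫ V, wilsonBoundaryAction ρ (rowRegion b n) (glueWith (rowRegion b n) (ζ₀ V)
          (twistΦ b (comb b ((2 * n + 2) * b + 1) k₀) (torusLift (2 * ((2 * n + 2) * b + 1) + 1) V)))
          ∂(wilsonMeasure (d := 4) (L := 2 * ((2 * n + 2) * b + 1) + 1) ρ β) ≤ C₁ * (b : ℝ) ^ 5 * (Real.log β / β) := by
  obtain ⟨C, hC, hCb⟩ := hW
  set r : LatticeRep G := ⟨N, ρ, hρ, hρi, hρu⟩ with hr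
  obtain ⟨K, hK0, hmom⟩ := AfOnset.exists_plaquetteCost_moments_le r
  refine ⟨2 * C * K + 1, by positivity, 3, fun β hβ b hb => ?_⟩
  obtain ⟨P, w, hw0, hwsum, hdom⟩ := hCb b hb
  set S : ℕ := 2 * ((2 * n + 2) * b + 1) + 1 with hS
  refine ⟨fun V => refFill b n k₀ (torusLift S V), ?_, ?_⟩
  · change Measurable fun V : GaugeConfig 4 S G =>
      wilsonBoundaryAction ρ (rowRegion b n) (refConfig b n k₀ (torusLift S V))
    exact ((continuous_wilsonBoundaryAction ρ hρ _).comp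
      ((continuous_refConfig b n k₀).comp (continuous_torusLift S))).measurable
  · change ∫ V, wilsonBoundaryAction ρ (rowRegion b n) (refConfig b n k₀ (torusLift S V))
        ∂(wilsonMeasure (d := 4) (L := S) ρ β) ≤ (2 * C * K + 1) * (b : ℝ) ^ 5 * (Real.log β / β)
    set μ := wilsonMeasure (d := 4) (L := S) ρ β with hμ
    haveI : IsProbabilityMeasure μ := isProbabilityMeasure_wilsonMeasure ρ hρ β
    have hβ0 : 0 < β := by linarith
    have hβ1 : 1 ≤ β := by linarith
    have hlog1 : 1 ≤ Real.log β := by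
      rw [Real.le_log_iff_exp_le hβ0]
      have := Real.exp_one_lt_d9; norm_num at this; linarith
    have hL1 : 1 ≤ (2 * n + 2) * b + 1 := by omega
    have hφcont : ∀ q : ZdPlaquette 4, Continuous fun V : GaugeConfig 4 S G =>
        (N : ℝ) - plaquetteObs ρ q.1 q.2.1.1 q.2.1.2 (torusLift S V) := fun q =>
      continuous_const.sub ((continuous_plaquetteObs ρ hρ _ _ _).comp (continuous_torusLift S))
    have hφint : ∀ q : ZdPlaquette 4, Integrable (fun V : GaugeConfig 4 S G =>
        (N : ℝ) - plaquetteObs ρ q.1 q.2.1.1 q.2.1.2 (torusLift S V)) μ := fun q =>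
      integrable_of_continuous μ (hφcont q)
    have hφmean : ∀ q : ZdPlaquette 4,
        ∫ V, ((N : ℝ) - plaquetteObs ρ q.1 q.2.1.1 q.2.1.2 (torusLift S V)) ∂μ ≤ K * (1 + Real.log β) / β := by
      intro q
      have h := (hmom ((2 * n + 2) * b + 1) hL1 β hβ1 (Torus.proj S q.1, q.2)).1
      have heq : ∫ V, ((N : ℝ) - plaquetteObs ρ q.1 q.2.1.1 q.2.1.2 (torusLift S V)) ∂μ =
          ∫ V, plaquetteCost r.ρ V (Torus.proj S q.1, q.2) ∂μ :=
        integral_congr_ae (ae_of_all _ fun V => plaquetteEnergy_torusLift ρ S V q)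
      rw [heq]
      exact h
    have hintA : Integrable (fun V : GaugeConfig 4 S G =>
        wilsonBoundaryAction ρ (rowRegion b n) (refConfig b n k₀ (torusLift S V))) μ :=
      integrable_of_continuous μ ((continuous_wilsonBoundaryAction ρ hρ _).comp
        ((continuous_refConfig b n k₀).comp (continuous_torusLift S)))
    have hintS : Integrable (fun V : GaugeConfig 4 S G =>
        ∑ q ∈ P, w q * ((N : ℝ) - plaquetteObs ρ q.1 q.2.1.1 q.2.1.2 (torusLift S V))) μ :=
      integrable_finsetSum P fun q _ => (hφint q).const_mul (w q)
    have hpt : ∀ V : GaugeConfig 4 S G,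
        wilsonBoundaryAction ρ (rowRegion b n) (refConfig b n k₀ (torusLift S V)) ≤
          ∑ q ∈ P, w q * ((N : ℝ) - plaquetteObs ρ q.1 q.2.1.1 q.2.1.2 (torusLift S V)) := fun V =>
      hdom (torusLift S V)
    have hKβ : 0 ≤ K * (1 + Real.log β) / β := by positivity
    have hb5 : (0 : ℝ) ≤ C * (b : ℝ) ^ 5 := by positivity
    have hkey : K * (1 + Real.log β) ≤ 2 * K * Real.log β := by nlinarith [hK0, hlog1]
    have hnn : (0 : ℝ) ≤ (b : ℝ) ^ 5 * (Real.log β / β) :=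
      mul_nonneg (pow_nonneg (Nat.cast_nonneg _) _) (div_nonneg (by linarith) hβ0.le)
    calc ∫ V, wilsonBoundaryAction ρ (rowRegion b n) (refConfig b n k₀ (torusLift S V)) ∂μ
        ≤ ∫ V, ∑ q ∈ P, w q * ((N : ℝ) - plaquetteObs ρ q.1 q.2.1.1 q.2.1.2 (torusLift S V)) ∂μ :=
          integral_mono hintA hintS hpt
      _ = ∑ q ∈ P, w q * ∫ V, ((N : ℝ) - plaquetteObs ρ q.1 q.2.1.1 q.2.1.2 (torusLift S V)) ∂μ := by
          rw [integral_finsetSum P fun q _ => (hφint q).const_mul (w q)]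
          refine Finset.sum_congr rfl fun q _ => ?_
          exact integral_const_mul _ _
      _ ≤ ∑ q ∈ P, w q * (K * (1 + Real.log β) / β) :=
          Finset.sum_le_sum fun q _ => mul_le_mul_of_nonneg_left (hφmean q) (hw0 q)
      _ = (∑ q ∈ P, w q) * (K * (1 + Real.log β) / β) := by rw [Finset.sum_mul]
      _ ≤ C * (b : ℝ) ^ 5 * (K * (1 + Real.log β) / β) := mul_le_mul_of_nonneg_right hwsum hKβ
      _ = C * (b : ℝ) ^ 5 * (K * (1 + Real.log β)) / β := by ring
      _ ≤ C * (b : ℝ) ^ 5 * (2 * K * Real.log β) / β :=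
          div_le_div_of_nonneg_right (mul_le_mul_of_nonneg_left hkey hb5) hβ0.le
      _ = 2 * C * K * ((b : ℝ) ^ 5 * (Real.log β / β)) := by ring
      _ ≤ (2 * C * K + 1) * ((b : ℝ) ^ 5 * (Real.log β / β)) := by nlinarith [hnn]
      _ = (2 * C * K + 1) * (b : ℝ) ^ 5 * (Real.log β / β) := by ring

end Weighted

section TwistEnergy

open scoped Matrix Matrix.Norms.Frobenius

variable {G : Type} [Group G] {N : ℕ} (ρ : G →* Matrix (Fin N) (Fin N) ℂ)

theorem height_le_of_mem_rowRegion {b n : ℕ} {e : ZdEdge 4} (he : e ∈ rowRegion b n) : e.1 0 ≤ (b : ℤ) := by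
  unfold rowRegion regionEdges at he
  obtain ⟨c, hc, hec⟩ := Finset.mem_biUnion.1 he
  have hc0 : c 0 = 0 := by unfold rowCells at hc; exact (Finset.mem_filter.1 hc).2
  have h := base_height_of_mem_cellEdges hec
  rw [hc0] at h
  linarith [h.2]

theorem refConfig_eq_twistΦ (b n : ℕ) (k₀ : G) (σ : LGConfig 4 G) :
    refConfig b n k₀ σ = twistΦ b (comb b ((2 * n + 2) * b + 1) k₀) σ := by
  funext e
  by_cases he : e ∈ rowRegion b n
  · simp only [refConfig, glueWith, dif_pos he, refFill, twistΦ]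
    exact gaugeTransformZd_layerGauge_apply _ _ (height_le_of_mem_rowRegion he)
  · simp only [refConfig, glueWith, dif_neg he]

theorem topTwist_apply_of_dir_ne {b : ℕ} (k : Site 4 → G) (U : LGConfig 4 G) {e : ZdEdge 4} (he : e.2 ≠ 0) :
    topTwist b k U e = U e := by
  unfold topTwist; exact if_neg fun h => he h.1

theorem plaquetteHolonomyZd_topTwist_of_not_topFace (b : ℕ) (k : Site 4 → G) (σ : LGConfig 4 G) (x : Site 4)
    {i j : Fin 4} (hj : j ≠ 0) (h : ¬ (i = 0 ∧ x 0 = (b : ℤ))) :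
    plaquetteHolonomyZd (topTwist b k σ) x i j = plaquetteHolonomyZd σ x i j := by
  unfold plaquetteHolonomyZd
  have e2 : topTwist b k σ (x + Pi.single i 1, j) = σ (x + Pi.single i 1, j) := topTwist_apply_of_dir_ne k σ hj
  have e4 : topTwist b k σ (x, j) = σ (x, j) := topTwist_apply_of_dir_ne k σ hj
  by_cases hi : i = 0
  · have hx : x 0 ≠ (b : ℤ) := fun hx => h ⟨hi, hx⟩
    have e1 : topTwist b k σ (x, i) = σ (x, i) := topTwist_apply_of_ne k σ hx
    have hx' : ((x + Pi.single j (1 : ℤ) : Site 4)) 0 ≠ (b : ℤ) := by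
      rw [add_single_apply_zero, if_neg hj, add_zero]; exact hx
    have e3 : topTwist b k σ (x + Pi.single j 1, i) = σ (x + Pi.single j 1, i) := topTwist_apply_of_ne k σ hx'
    rw [e1, e2, e3, e4]
  · have e1 : topTwist b k σ (x, i) = σ (x, i) := topTwist_apply_of_dir_ne k σ hi
    have e3 : topTwist b k σ (x + Pi.single j 1, i) = σ (x + Pi.single j 1, i) := topTwist_apply_of_dir_ne k σ hi
    rw [e1, e2, e3, e4]

def linkDefect (k : Site 4 → G) (σ : LGConfig 4 G) (y : Site 4) (j : Fin 4) : G :=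
  (k y)⁻¹ * σ (y, j) * k (y + Pi.single j 1) * (σ (y, j))⁻¹

theorem plaquetteHolonomyZd_topTwist_topFace (b : ℕ) (k : Site 4 → G) (σ : LGConfig 4 G) (x : Site 4) {j : Fin 4}
    (hj : j ≠ 0) (hx : x 0 = (b : ℤ)) :
    plaquetteHolonomyZd (topTwist b k σ) x 0 j =
      σ (x, 0) * linkDefect k σ (x + Pi.single 0 1) j * (σ (x, 0))⁻¹ * plaquetteHolonomyZd σ x 0 j := by
  unfold plaquetteHolonomyZd linkDefect
  have e1 : topTwist b k σ (x, 0) = σ (x, 0) * (k (x + Pi.single 0 1))⁻¹ := by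
    unfold topTwist; exact if_pos ⟨rfl, hx⟩
  have e2 : topTwist b k σ (x + Pi.single 0 1, j) = σ (x + Pi.single 0 1, j) := topTwist_apply_of_dir_ne k σ hj
  have hx' : ((x + Pi.single j (1 : ℤ) : Site 4)) 0 = (b : ℤ) := by
    rw [add_single_apply_zero, if_neg hj, add_zero]; exact hx
  have e3 : topTwist b k σ (x + Pi.single j 1, 0) =
      σ (x + Pi.single j 1, 0) * (k (x + Pi.single j 1 + Pi.single 0 1))⁻¹ := by
    unfold topTwist; exact if_pos ⟨rfl, hx'⟩
  have e4 : topTwist b k σ (x, j) = σ (x, j) := topTwist_apply_of_dir_ne k σ hj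
  rw [e1, e2, e3, e4]
  have hc : x + Pi.single j (1 : ℤ) + Pi.single 0 1 = x + Pi.single 0 1 + Pi.single j 1 := add_right_comm _ _ _
  rw [hc]
  group

theorem topFace_energy_le (hρu : ∀ g, ρ g ∈ Matrix.unitaryGroup (Fin N) ℂ) (b : ℕ) (k : Site 4 → G)
    (σ : LGConfig 4 G) (x : Site 4) {j : Fin 4} (hj : j ≠ 0) (hx : x 0 = (b : ℤ)) :
    (N : ℝ) - plaquetteObs ρ x 0 j (topTwist b k σ) ≤
      ‖ρ (linkDefect k σ (x + Pi.single 0 1) j) - 1‖ ^ 2 + 2 * ((N : ℝ) - plaquetteObs ρ x 0 j σ) := by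
  unfold plaquetteObs
  rw [plaquetteHolonomyZd_topTwist_topFace b k σ x hj hx, sub_re_trace_eq_norm_sq ρ hρu, sub_re_trace_eq_norm_sq ρ hρu]
  have h1 : ‖ρ (σ (x, 0) * linkDefect k σ (x + Pi.single 0 1) j * (σ (x, 0))⁻¹ * plaquetteHolonomyZd σ x 0 j) - 1‖ ≤
      ‖ρ (linkDefect k σ (x + Pi.single 0 1) j) - 1‖ + ‖ρ (plaquetteHolonomyZd σ x 0 j) - 1‖ := by
    calc _ ≤ ‖ρ (σ (x, 0) * linkDefect k σ (x + Pi.single 0 1) j * (σ (x, 0))⁻¹) - 1‖ +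
          ‖ρ (plaquetteHolonomyZd σ x 0 j) - 1‖ := norm_map_mul_sub_one_le ρ hρu _ _
      _ = _ := by rw [norm_map_conj_sub_one ρ hρu]
  nlinarith [h1, norm_nonneg (ρ (σ (x, 0) * linkDefect k σ (x + Pi.single 0 1) j * (σ (x, 0))⁻¹ *
    plaquetteHolonomyZd σ x 0 j) - 1), norm_nonneg (ρ (linkDefect k σ (x + Pi.single 0 1) j) - 1),
    norm_nonneg (ρ (plaquetteHolonomyZd σ x 0 j) - 1),
    sq_nonneg (‖ρ (linkDefect k σ (x + Pi.single 0 1) j) - 1‖ - ‖ρ (plaquetteHolonomyZd σ x 0 j) - 1‖)]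

def hairpin (b R : ℕ) (σ : LGConfig 4 G) (y : Site 4) (j : Fin 4) : G :=
  stair b R σ y * σ (y, j) * (stair b R σ (y + Pi.single j 1))⁻¹

theorem norm_linkDefect_comb_le (hρu : ∀ g, ρ g ∈ Matrix.unitaryGroup (Fin N) ℂ) (b R : ℕ) (k₀ : G)
    (σ : LGConfig 4 G) (y : Site 4) (j : Fin 4) :
    ‖ρ (linkDefect (comb b R k₀ σ) σ y j) - 1‖ ≤ 2 * ‖ρ (hairpin b R σ y j) - 1‖ := by
  have hD : linkDefect (comb b R k₀ σ) σ y j =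
      (stair b R σ y)⁻¹ * (k₀⁻¹ * hairpin b R σ y j * k₀ * (hairpin b R σ y j)⁻¹) * (stair b R σ y)⁻¹⁻¹ := by
    unfold linkDefect comb hairpin; group
  rw [hD, norm_map_conj_sub_one ρ hρu]
  have h1 := norm_map_mul_sub_one_le ρ hρu (k₀⁻¹ * hairpin b R σ y j * k₀) (hairpin b R σ y j)⁻¹
  have h2 := norm_map_conj_sub_one ρ hρu k₀⁻¹ (hairpin b R σ y j)
  rw [inv_inv] at h2
  rw [norm_map_inv_sub_one ρ hρu, h2] at h1
  linarith

theorem topFace_energy_comb_le (hρu : ∀ g, ρ g ∈ Matrix.unitaryGroup (Fin N) ℂ) (b R : ℕ) (k₀ : G)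
    (σ : LGConfig 4 G) (x : Site 4) {j : Fin 4} (hj : j ≠ 0) (hx : x 0 = (b : ℤ)) :
    (N : ℝ) - plaquetteObs ρ x 0 j (topTwist b (comb b R k₀ σ) σ) ≤
      4 * ‖ρ (hairpin b R σ (x + Pi.single 0 1) j) - 1‖ ^ 2 + 2 * ((N : ℝ) - plaquetteObs ρ x 0 j σ) := by
  have h1 := topFace_energy_le ρ hρu b (comb b R k₀ σ) σ x hj hx
  have h2 := norm_linkDefect_comb_le ρ hρu b R k₀ σ (x + Pi.single 0 1) j
  have h0 := norm_nonneg (ρ (linkDefect (comb b R k₀ σ) σ (x + Pi.single 0 1) j) - 1)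
  nlinarith [h1, h2, h0]

theorem energy_topTwist_of_not_topFace (b : ℕ) (k : Site 4 → G) (σ : LGConfig 4 G) (q : ZdPlaquette 4)
    (h : ¬ (q.2.1.1 = 0 ∧ q.1 0 = (b : ℤ))) :
    (N : ℝ) - plaquetteObs ρ q.1 q.2.1.1 q.2.1.2 (topTwist b k σ) = (N : ℝ) - plaquetteObs ρ q.1 q.2.1.1 q.2.1.2 σ := by
  have hj : q.2.1.2 ≠ 0 := fun h0 => by have := q.2.2; rw [h0] at this; exact (Fin.not_lt_zero _) this
  unfold plaquetteObs
  rw [plaquetteHolonomyZd_topTwist_of_not_topFace b k σ q.1 hj h]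

end TwistEnergy

section Stubs

open Literature.MathematicalPhysics.QuantumFieldTheory (wilsonMeasure GaugeConfig isProbabilityMeasure_wilsonMeasure)

variable {G : Type} [Group G] [TopologicalSpace G] [IsTopologicalGroup G] [CompactSpace G]
  [SecondCountableTopology G] [MeasurableSpace G] [BorelSpace G]
  {N : ℕ} (ρ : G →* Matrix (Fin N) (Fin N) ℂ)

theorem loopFreezingPoly_quarter (hρ : Continuous ρ) (hρi : Function.Injective ρ)
    (hρu : ∀ g, ρ g ∈ Matrix.unitaryGroup (Fin N) ℂ) (hN : 1 ≤ N) (n : ℕ) :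
    LoopFreezingPoly ρ n (1 / 4) := by
  intro η hη
  obtain ⟨K, hK0, hK⟩ := one_sub_integral_loopObs_le ρ hρ hρi hρu hN
  have hN0 : (0 : ℝ) < N := by exact_mod_cast hN
  set D : ℝ := 8 * (2 * n + 1) ^ 2 * (K + 1) with hD
  have hD0 : 0 < D := by positivity
  set c : ℝ := min 1 (η * N / D) with hc
  have hc0 : 0 < c := lt_min one_pos (by positivity)
  have hc1 : c ≤ 1 := min_le_left _ _
  have hcD : c ≤ η * N / D := min_le_right _ _
  refine ⟨c, hc0, Real.exp 1, fun β hβ b hb hbc => ?_⟩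
  have hβ1 : 1 ≤ β := (Real.one_lt_exp_iff.2 one_pos).le.trans hβ |>.trans' le_rfl
  have hβ0 : 0 < β := by linarith
  have hlog1 : 1 ≤ Real.log β := by
    rw [← Real.log_exp 1]; exact Real.log_le_log (Real.exp_pos 1) hβ
  have hlog0 : 0 < Real.log β := by linarith
  set L : ℕ := (2 * n + 2) * b + 1 with hL
  have hL1 : 1 ≤ L := by omega
  have hmain := hK L hL1 β hβ1 hb ((2 * n + 1) * b)
  have hx0 : 0 ≤ β / Real.log β := by positivity
  have hb4 : (b : ℝ) ^ 4 ≤ c * (β / Real.log β) := by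
    have h1 : (b : ℝ) ^ 4 ≤ (c * (β / Real.log β) ^ (1 / 4 : ℝ)) ^ 4 :=
      pow_le_pow_left₀ (by positivity) hbc 4
    have h2 : ((β / Real.log β) ^ (1 / 4 : ℝ)) ^ 4 = β / Real.log β := by
      rw [show (1 / 4 : ℝ) = ((4 : ℕ) : ℝ)⁻¹ by norm_num]
      exact Real.rpow_inv_natCast_pow hx0 (by norm_num)
    have h3 : c ^ 4 ≤ c := by
      calc c ^ 4 ≤ c ^ 1 := pow_le_pow_of_le_one hc0.le hc1 (by norm_num)
        _ = c := pow_one c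
    calc (b : ℝ) ^ 4 ≤ c ^ 4 * (β / Real.log β) := by rw [mul_pow, h2] at h1; exact h1
      _ ≤ c * (β / Real.log β) := by gcongr
  have hb1 : (1 : ℝ) ≤ b := by exact_mod_cast hb
  have hA : (((b + 1 : ℕ) : ℝ) * (((2 * n + 1) * b : ℕ) : ℝ)) ^ 2 ≤ 4 * (2 * n + 1) ^ 2 * (b : ℝ) ^ 4 := by
    push_cast
    have : ((b : ℝ) + 1) ≤ 2 * b := by linarith
    calc (((b : ℝ) + 1) * ((2 * n + 1) * b)) ^ 2 = ((b : ℝ) + 1) ^ 2 * ((2 * n + 1) * b) ^ 2 := by ring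
      _ ≤ (2 * (b : ℝ)) ^ 2 * ((2 * n + 1) * b) ^ 2 := by gcongr
      _ = 4 * (2 * n + 1) ^ 2 * (b : ℝ) ^ 4 := by ring
  have hlogβ : (1 + Real.log β) / β ≤ 2 * Real.log β / β := by
    gcongr; linarith
  have hfinal : (((b + 1 : ℕ) : ℝ) * (((2 * n + 1) * b : ℕ) : ℝ)) ^ 2 / N * (K * (1 + Real.log β) / β) ≤ η := by
    calc (((b + 1 : ℕ) : ℝ) * (((2 * n + 1) * b : ℕ) : ℝ)) ^ 2 / N * (K * (1 + Real.log β) / β)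
        ≤ 4 * (2 * n + 1) ^ 2 * (c * (β / Real.log β)) / N * (K * (2 * Real.log β / β)) := by
          have hK1 : K * (1 + Real.log β) / β ≤ K * (2 * Real.log β / β) := by
            rw [mul_div_assoc]; exact mul_le_mul_of_nonneg_left hlogβ hK0
          gcongr
          exact hA.trans (by gcongr)
      _ = 8 * (2 * n + 1) ^ 2 * K * c / N := by
          field_simp
          ring
      _ ≤ D * c / N := by
          gcongr
          rw [hD]; nlinarith [sq_nonneg (2 * (n : ℝ) + 1), hK0]
      _ ≤ η := by
          rw [div_le_iff₀ hN0]
          calc D * c ≤ D * (η * N / D) := by gcongr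
            _ = η * N := by field_simp
  have hcast : ((b + 1 : ℕ) * ((2 * n + 1) * b : ℕ) : ℝ) = ((b + 1 : ℕ) : ℝ) * (((2 * n + 1) * b : ℕ) : ℝ) := by
    push_cast; ring
  linarith [hmain, hfinal]

set_option linter.unusedVariables false in
omit [TopologicalSpace G] [IsTopologicalGroup G] [CompactSpace G] [SecondCountableTopology G]
    [MeasurableSpace G] [BorelSpace G] in
theorem refAction_le_weighted (hρu : ∀ g, ρ g ∈ Matrix.unitaryGroup (Fin N) ℂ) (hN : 1 ≤ N) (n : ℕ) (k₀ : G) :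
    ∃ C : ℝ, 0 < C ∧ ∀ b : ℕ, 1 ≤ b → ∃ (P : Finset (ZdPlaquette 4)) (w : ZdPlaquette 4 → ℝ),
      (∀ q, 0 ≤ w q) ∧ ∑ q ∈ P, w q ≤ C * (b : ℝ) ^ 5 ∧
      ∀ σ : LGConfig 4 G, wilsonBoundaryAction ρ (rowRegion b n) (refConfig b n k₀ σ) ≤
        ∑ q ∈ P, w q * ((N : ℝ) - plaquetteObs ρ q.1 q.2.1.1 q.2.1.2 σ) := by
  obtain ⟨C, hC, h⟩ := CruxIdea2g7Hairpin.twistAction_le_weighted ρ hρu n k₀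
  refine ⟨C, hC, fun b hb => ?_⟩
  obtain ⟨P, w, hw, hs, hd⟩ := h b hb
  exact ⟨P, w, hw, hs, fun σ => by rw [refConfig_eq_twistΦ]; exact hd σ⟩

theorem integral_refAction_le (hρ : Continuous ρ) (hρi : Function.Injective ρ)
    (hρu : ∀ g, ρ g ∈ Matrix.unitaryGroup (Fin N) ℂ) (hN : 1 ≤ N) (n : ℕ) (k₀ : G) :
    ∃ C₁ : ℝ, 0 < C₁ ∧ ∃ β₂ : ℝ, ∀ β : ℝ, β₂ ≤ β → ∀ b : ℕ, 1 ≤ b →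
      ∃ ζ₀ : GaugeConfig 4 (2 * ((2 * n + 2) * b + 1) + 1) G → (↥(rowRegion b n) → G),
        Measurable (fun V => wilsonBoundaryAction ρ (rowRegion b n) (glueWith (rowRegion b n) (ζ₀ V)
          (twistΦ b (comb b ((2 * n + 2) * b + 1) k₀) (torusLift (2 * ((2 * n + 2) * b + 1) + 1) V)))) ∧
        ∫ V, wilsonBoundaryAction ρ (rowRegion b n) (glueWith (rowRegion b n) (ζ₀ V)
          (twistΦ b (comb b ((2 * n + 2) * b + 1) k₀) (torusLift (2 * ((2 * n + 2) * b + 1) + 1) V)))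
          ∂(wilsonMeasure (d := 4) (L := 2 * ((2 * n + 2) * b + 1) + 1) ρ β) ≤ C₁ * (b : ℝ) ^ 5 * (Real.log β / β) :=
  integral_refAction_le_of_weighted ρ hρ hρi hρu n k₀ (refAction_le_weighted ρ hρu hN n k₀)

theorem integral_kernelAction_le (hρ : Continuous ρ) (hρi : Function.Injective ρ)
    (hρu : ∀ g, ρ g ∈ Matrix.unitaryGroup (Fin N) ℂ) (hN : 1 ≤ N) (n : ℕ) (k₀ : G) :
    ∃ C : ℝ, 0 < C ∧ ∃ β₁ : ℝ, ∀ β : ℝ, β₁ ≤ β → ∀ b : ℕ, 1 ≤ b →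
      ∫ V, kernelAction ρ β b n k₀ V ∂(wilsonMeasure (d := 4) (L := 2 * ((2 * n + 2) * b + 1) + 1) ρ β) ≤
        C * (b : ℝ) ^ 5 * (Real.log β / β) :=
  integral_kernelAction_le_of_ref ρ hρ hρi hρu (rowRegion_counts n) (integral_refAction_le ρ hρ hρi hρu hN n k₀)

theorem integral_kernelPlaqDefectSq_le (hρ : Continuous ρ) (hρi : Function.Injective ρ)
    (hρu : ∀ g, ρ g ∈ Matrix.unitaryGroup (Fin N) ℂ) (hN : 1 ≤ N) (n : ℕ) (k₀ : G) :
    ∃ C : ℝ, 0 < C ∧ ∃ β₁ : ℝ, ∀ β : ℝ, β₁ ≤ β → ∀ b : ℕ, 1 ≤ b →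
      ∫ V, kernelPlaqDefectSq ρ β b n k₀ V ∂(wilsonMeasure (d := 4) (L := 2 * ((2 * n + 2) * b + 1) + 1) ρ β) ≤
        C * (b : ℝ) ^ 5 * (Real.log β / β) :=
  integral_kernelPlaqDefectSq_le_of_action ρ hρ hρu (integral_kernelAction_le ρ hρ hρi hρu hN n k₀)

theorem integral_kernelPlaqDefect_le (hρ : Continuous ρ) (hρi : Function.Injective ρ)
    (hρu : ∀ g, ρ g ∈ Matrix.unitaryGroup (Fin N) ℂ) (hN : 1 ≤ N) (n : ℕ) (k₀ : G) :
    ∃ C : ℝ, 0 < C ∧ ∃ β₁ : ℝ, ∀ β : ℝ, β₁ ≤ β → ∀ b : ℕ, 1 ≤ b →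
      ∫ V, kernelPlaqDefect ρ β b n k₀ V ∂(wilsonMeasure (d := 4) (L := 2 * ((2 * n + 2) * b + 1) + 1) ρ β) ≤
        C * (b : ℝ) ^ (7 / 2 : ℝ) * Real.sqrt (Real.log β / β) :=
  integral_kernelPlaqDefect_le_of_sq ρ hρ hρu (integral_kernelPlaqDefectSq_le ρ hρ hρi hρu hN n k₀)

theorem integral_twistDefect_le (hρ : Continuous ρ) (hρi : Function.Injective ρ)
    (hρu : ∀ g, ρ g ∈ Matrix.unitaryGroup (Fin N) ℂ) (hN : 1 ≤ N) (n : ℕ) (k₀ : G) :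
    ∃ C : ℝ, 0 < C ∧ ∃ β₁ : ℝ, ∀ β : ℝ, β₁ ≤ β → ∀ b : ℕ, 1 ≤ b →
      ∫ V, twistDefect ρ β b n k₀ V ∂(wilsonMeasure (d := 4) (L := 2 * ((2 * n + 2) * b + 1) + 1) ρ β) ≤
        C * (b : ℝ) ^ (7 / 2 : ℝ) * Real.sqrt (Real.log β / β) :=
  integral_twistDefect_le_of_kernelPlaqDefect ρ hρ hρu (integral_kernelPlaqDefect_le ρ hρ hρi hρu hN n k₀)

theorem kernelDefectPoly_seventh (hρ : Continuous ρ) (hρi : Function.Injective ρ)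
    (hρu : ∀ g, ρ g ∈ Matrix.unitaryGroup (Fin N) ℂ) (hN : 1 ≤ N) (n : ℕ) (k₀ : G) :
    KernelDefectPoly ρ n k₀ (1 / 7) :=
  kernelDefectPoly_of_mean ρ hρ hρu (fun β b => measurable_twistDefect ρ hρ hρu β b n k₀)
    (integral_twistDefect_le ρ hρ hρi hρu hN n k₀)

theorem frameValuePoly_seventh (hρ : Continuous ρ) (hρi : Function.Injective ρ)
    (hρu : ∀ g, ρ g ∈ Matrix.unitaryGroup (Fin N) ℂ) (hN : 1 ≤ N) (n : ℕ) {k₀ : G} (hk₀ : k₀ ≠ 1) :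
    FrameValuePoly ρ n k₀ (1 / 7) :=
  frameValuePoly_of_kernelDefectPoly ρ hρ hρu hN (re_trace_div_lt_one ρ hρi hρu hN hk₀)
    (kernelDefectPoly_seventh ρ hρ hρi hρu hN n k₀)

theorem rowFloorPoly_seventh (hρ : Continuous ρ) (hρi : Function.Injective ρ)
    (hρu : ∀ g, ρ g ∈ Matrix.unitaryGroup (Fin N) ℂ) (hN : 1 ≤ N) {k₀ : G} (hk₀ : k₀ ≠ 1)
    (n : ℕ) {ε δ : ℝ} (hε : ε < 1) (hδ0 : 0 ≤ δ) (hδ : 4 * ((windowCellsPlus n).card : ℝ) * δ < 1) :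
    RowFloorPoly ρ n ε δ (1 / 7) :=
  rowFloorPoly_of_inputs ρ hρ hρi hρu hN hk₀ n hε hδ0 hδ
    (loopFreezingPoly_mono ρ (by norm_num) (loopFreezingPoly_quarter ρ hρ hρi hρu hN n))
    (frameValuePoly_seventh ρ hρ hρi hρu hN n hk₀)

theorem typFloor_seventh [Nontrivial G] (hρ : Continuous ρ) (hρi : Function.Injective ρ)
    (hρu : ∀ g, ρ g ∈ Matrix.unitaryGroup (Fin N) ℂ) (hN : 1 ≤ N)
    (n : ℕ) {ε δ : ℝ} (hε : ε < 1) (hδ0 : 0 ≤ δ) (hδ : 4 * ((windowCellsPlus n).card : ℝ) * δ < 1) :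
    ∃ c : ℝ, 0 < c ∧ ∃ β₀ : ℝ, ∀ β : ℝ, β₀ ≤ β → ∀ b : ℕ, 1 ≤ b → TypShellCond ρ β b n ε δ →
      c * (β / Real.log β) ^ (1 / 7 : ℝ) < b := by
  obtain ⟨k₀, hk₀⟩ := exists_ne (1 : G)
  exact typFloor_of_rowFloorPoly ρ (rowFloorPoly_seventh ρ hρ hρi hρu hN hk₀ n hε hδ0 hδ)

end Stubs

end Summit.QuantumFields.YangMills.Cruxes.IR.CruxIdea2g7

end
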